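import Literature.Probability.Percolation.TwoAvoidanceSets
import Literature.Probability.Percolation.ProdBernoulliRusso
import Literature.Probability.LatticeModels.RandomClusterFKG
import Mathlib.Tactic.Ring
import Mathlib.Tactic.Linarith
import Literature.Probability.LatticeModels.RandomClusterEdgeWeights
import Literature.Probability.Percolation.KozmaNitzanHittable
import Literature.Probability.Percolation.TwoSetConditionalAssociationRC
import Literature.Probability.Percolation.LonePortSumGeneral
import Literature.Probability.LatticeModels.RandomClusterRayleighSeriesParallel
import HarnessLib

/-!
# Edge-negative association of the random-cluster measure `φ_{w,q}`, `0 < q ≤ 1`, on 2-tree supports (Wagner's two-sum induction by apex elimination) — re-homed proofs, file 1 of 2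

**Wagner 2008 (graph case): for `0 < q ≤ 1` the random-cluster measure `φ_{w,q}` is EDGE-NEGATIVELY ASSOCIATED on every weighted
graph whose support has no `K₄` minor — the named fact `Literature.Probability.LatticeModels.Wagner2008_rc_edgeNegCorr_of_noK4Minor`
(`RandomClusterRayleighSeriesParallel.lean`) HOLDS**: `φ_{w,q}(J_e ∩ J_f) ≤ φ_{w,q}(J_e)·φ_{w,q}(J_f)` for all pairs `f ≠ e`, `e` not a
loop (D. G. Wagner, *Negatively correlated random variables and Mason's conjecture for independent sets in matroids*, Ann. Comb. 12
(2008) 211–239 = arXiv:math/0602648, Ex. 5.1, Thm. 5.8(d), §5.2–5.3 [Wagner2006]: the Potts–Rayleigh class contains all series–parallel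
graphs; G. Grimmett, *The Random-Cluster Model* (2006), §3.9 eq. (3.94) [Grimmett2006]; the finite graphs without a `K₄` minor are the
partial 2-trees — Dirac 1952 / Duffin 1965, R. Diestel, *Graph Theory*, §7.3 [Diestel2017]).  ARCHITECTURE of the in-tree proof
(kernel-checked; until now Summits-side only, `Summits/CriticalPhenomena/PercolationContinuityZ3/Theorems/Transplant/FKConnectivityAllQWagner.lean`):
(1) `FK.edgeNegCorrSupp_of_isTwoTree` — negative edge correlation for every weight vector supported inside a 2-TREE, by apex
elimination (a vertex-level form of Wagner's two-sum induction, Thm. 5.8(d)): affine dependence of the weights on one edge parameter,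
edge toggling identities, the local criterion `edgeConnMono_of_negCorr_at`, apex tools / mass / cases / step; (2)
`K4Free.exists_superset_of_not_hasK4Minor` — a finite graph without a `K₄` minor (branch sets) lies inside a 2-tree (Dirac's lemma by
the rotation descent on a longest path, suppression of degree-two vertices); (3) loop erasure (`FK…Loops`) — diagonal pairs are
independent coins.  RE-HOMED into `Literature/` by the Hodge foundations lane (`lit-hodgefound`, seat p20, generation 38): verbatim
DECLARATION-LEVEL ports (the declarations needed, in dependency order) of the 16 Summits modules
`…/Theorems/Transplant/{FKConnectivityAllQ{Defs,EdgeMono,EdgeToggle,EdgeLocal,ApexTools,ApexMass,ApexCases,ApexStep,TwoTree,Loops,Wagner},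
K4MinorFree{Defs,Paths,Dirac}}.lean` and `…/Theorems/PercNearOneGluingNoHeavyLowerTail{FKHullPortTASections,CoSunflowerGlue}.lean`,
namespace `Summit.CriticalPhenomena.PercolationContinuityZ3.Theorems` re-rooted as `Literature.Probability.LatticeModels.RandomClusterRayleigh`
(sub-namespaces `FK`, `K4Free`, `CoSunflowerGlue` kept), followed by the EXACT-name discharge
`Literature.Probability.LatticeModels.Wagner2008_rc_edgeNegCorr_of_noK4Minor_holds`.  The honest definitions of the source come along
with their bodies (`FK.IsTwoTree` (inductive), `FK.EdgeNegCorrSupp`, `K4Free.IsPathSeq` (structure), `K4Free.IsLongest`, `K4Free.rot`,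
`K4Free.seg`, `K4Free.delVert`, `K4Free.ThreeNeighbours` — combinatorial notions with 1–3-line bodies, each cited); no new named fact
(D-0026), no Summits import; every declaration carries a citation.  Built on the tree's Literature layer
(`Probability/LatticeModels/RandomCluster{EdgeWeights,FKG,RayleighSeriesParallel}`, `Probability/Percolation/*`) and Mathlib.  The
Summits originals stay in place (transitional duplication; they belong to the post-continuity programme built on p205010).  WHAT THIS
IS NOT: nothing here bears on continuity of the percolation probability in `ℤ³` or any critical phenomenon; this is finite
random-cluster combinatorics and the graph theory of `K₄`-minor-free graphs.

THIS FILE (1 of 2): the FK side — affine edge dependence, edge toggling, the local criterion, apex tools / mass / cases / step, and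
`FK.edgeNegCorrSupp_of_isTwoTree`.  File 2 (`RandomClusterRayleighSeriesParallelProof.lean`) adds loop erasure, the graph theory of
`K₄`-minor-free graphs and the discharge.
-/

noncomputable section

/-!
## Part 1 — port of `Summits/CriticalPhenomena/PercolationContinuityZ3/Theorems/Transplant/FKConnectivityAllQDefs.lean` (1 declarations kept)

# Connectivity correlation inequalities for `φ_{w,q}` conjectured for EVERY `q > 0` — STATEMENTS, conjecture nodes, and
# `HubCond ∧ TwoArmNeg ⇒ FourPoint` (file 1 of 3; consequences in `…AllQGluing.lean`, the `q ≥ 1` discharge in `…AllQOneLe.lean`)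

Verbatim declaration-level port (the declarations listed in the Part header count) of a helper module of the
PercolationContinuityZ3 tree (FK sub-lane); route bookkeeping of the source docstring is not reproduced.

WHAT IS NEW.  Nothing is known in print about correlation inequalities for the random-cluster measure with `q < 1` on general
graphs (Grimmett 2006, §3.9).  The lane's exact computations (gen 4, memo `bschramm/FK-DEFS.md` §8 and
`bschramm/FROM-fk-1-g4-ALLQ-CONNECTIVITY-INEQUALITIES.md`: exhaustive COEFFICIENTWISE verification — nonnegative coefficients of the
difference polynomial in `(p_e, 1 − p_e, q)` graded by the total cluster count — on all weighted graphs with `≤ 6` vertices) support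
the following statements for EVERY `q > 0`, stated here with the MEASURE as a parameter and as `q`-families (`φ = rcMeasureW w q ∅`):

* `HubUnder μ o a b`        — `μ(o ↔ a) μ(b ↔ a) ≤ μ(Ω) μ(o ↔ a ↔ b)` (Harris for two connections THROUGH A COMMON VERTEX);
* `HubCondUnder μ o a b c`  — the same given `{a ↮ c}` (van den Berg–Häggström–Kahn Thm. 1.3 for connectivity events);
* `TwoArmNegUnder μ o a b c` — `μ(a ↮ c) μ(o ↔ a, b ↔ c, a ↮ c) ≤ μ(o ↔ a, a ↮ c) μ(b ↔ c, a ↮ c)` (vdBHK Thm. 1.4 for connectivity events);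
* `FourPointUnder μ o a c b` — `μ{oa|cb} μ{oc|ab} ≤ μ{oab|c} μ{ocb|a}` for the exact partition patterns induced on `{o, a, c, b}`.

PROVED HERE (kernel): (1) `HubCond ∧ TwoArmNeg ⇒ FourPoint` for any finite measure (Kozma–Nitzan's proof of their Theorem 1 in
product form); (2) `FourPoint ⇒` additive gluing for relay sets of size `≤ 2` and `FourPoint ⇒` the pre-FKG inequality (3) of
Kozma–Nitzan for `|A| = 2`, for any probability measure on the bond configurations of a finite vertex type; (3) all four statements for
`φ_{w,q}` with `q ≥ 1` (from the tree's vdBHK Thm. 2.1 for `rcMeasureW`, and FKG), hence `AdditiveGluingTwoFK q` for `q ≥ 1` by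
this route; (4) the conjecture nodes `HubFKPos`, `HubCondFKPos`, `TwoArmNegFKPos`, `FourPointFKPos`, `AdditiveGluingTwoFKPos`
(`∀ q > 0`) are recorded `@[conjecture]` (NOT asserted) together with the proved implications between them, so that a proof of
`HubCondFKPos ∧ TwoArmNegFKPos` closes `AdditiveGluingFKPos` (file `…FKAnalogues.lean`) for relay sets of size `≤ 2` by name.
Nothing is claimed for `q < 1` beyond these implications.
[cite: KozmaNitzan2024, Thm. 1 and eq. (3), (5), (6) (pp. 7–8); Conj. 1 (p. 3)] [cite: VandenbergHaggstromKahn2005, Thms. 1.3, 1.4, 2.1 (pp. 6–9)]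
[cite: Grimmett2006, §1.4 eq. (1.20) (p. 15); Thm. (3.8); §3.9 (p. 63)]
-/

section Part1

namespace Literature.Probability.LatticeModels.RandomClusterRayleigh

namespace FK

open _root_.MeasureTheory _root_.Set Literature.Probability.LatticeModels Literature.Probability.Percolation
open scoped _root_.Classical

variable {V : Type*}

/-! ### Events -/

/-- Membership unfolding for `openConn`. [cite: VandenbergHaggstromKahn2005, Thm. 1.3 (p. 6)] -/
theorem mem_openConn_iff' (x y : V) (ω : BondConfig V) : ω ∈ openConn x y ↔ (openGraph ω).Reachable x y := Iff.rfl

end FK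

end Literature.Probability.LatticeModels.RandomClusterRayleigh

end Part1

/-!
## Part 2 — port of `Summits/CriticalPhenomena/PercolationContinuityZ3/Theorems/PercNearOneGluingNoHeavyLowerTailFKHullPortTASections.lean` (3 declarations kept)

# FK sub-lane: one-pair sections of the hull-port functionals for `φ_{𝐩,q}` (deletion / contraction)

Verbatim declaration-level port (the declarations listed in the Part header count) of a helper module of the
PercolationContinuityZ3 tree (FK sub-lane); route bookkeeping of the source docstring is not reproduced.

Random-cluster version of prove-5's `…HullPortTASections.lean` for the functionals `FK.taB, FK.taA, FK.tab, FK.taa` of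
`…FKHullPortTADefs.lean` (bschramm/FK-Q2.md §12.1–12.2, §12.7 L-b):
* `FK.rcWeightW_affine` — the random-cluster weight is affine in each edge parameter, POINTWISE in the configuration:
  `w_q(ω) = (1 − w e)·w_q[e↦0](ω) + (w e)·w_q[e↦1](ω)` (the factor `q^{k(ω)}` is common; simpler than the product-measure
  resampling because no configuration is shifted);
* `FK.taB_absorb` etc. — if the pair `e = s(x₀,v)`, `x₀ ∈ X`, has parameter `1` (it is almost surely open), adding `v` to the
  avoided set `X` changes none of the functionals: `(w[e↦1], X ∪ {v})` IS the contraction `G/e` (honest contraction, no tilt);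
* the SECTION IDENTITIES `Φ_X(w) = (1 − w e)·Φ_X(w[e↦0]) + (w e)·Φ_{X∪{v}}(w[e↦1])` for `Φ ∈ {taB, taA, tab, taa}` — deletion and
  contraction endpoints of the one-edge deformation of prim-hp-7's `T_A` argument (HP7-MDLX-PROOF §3) for `φ_{𝐩,q}`.
[cite: Grimmett2006, §1.4 eq. (1.20) (p. 15); Thm. (3.1)(a) (p. 37)] [cite: VandenbergHaggstromKahn2005, §2.1 Lemma 2.3 (p. 10)]
-/

section Part2

namespace Literature.Probability.LatticeModels.RandomClusterRayleigh.FK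

open _root_.MeasureTheory _root_.Set Literature.Probability.LatticeModels Literature.Probability.Percolation
open Literature.Probability.Percolation.DecisionTree (ind ind_of_mem ind_of_not_mem ind_nonneg)
open scoped _root_.Classical

variable {V : Type*} [Fintype V]

section Sections

open Literature.Probability.Percolation.BHK2006 (weight)

/-- **One-coordinate affine decomposition of the random-cluster weight**: for every configuration `ω`,
`w_q(ω) = (1 − w e)·w_q[e↦0](ω) + (w e)·w_q[e↦1](ω)` (the factor `q^{k(ω)}` is common). [cite: Grimmett2006, §1.4 eq. (1.20) (p. 15); Thm. (3.1)(a)] -/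
theorem rcWeightW_affine (w : Sym2 V → unitInterval) (q : ℝ) (B : Set V) (e : Sym2 V) (ω : BondConfig V) :
    rcWeightW w q B ω = (1 - (w e : ℝ)) * rcWeightW (Function.update w e 0) q B ω +
      (w e : ℝ) * rcWeightW (Function.update w e 1) q B ω := by
  classical
  unfold rcWeightW weight
  set R : ℝ := ∏ f ∈ Finset.univ.erase e, (if f ∈ ω then ((w f : unitInterval) : ℝ) else 1 - (w f : ℝ)) with hR
  have hfac : ∀ (u : Sym2 V → unitInterval), (∀ f, f ≠ e → u f = w f) →
      (∏ f, (if f ∈ ω then ((u f : unitInterval) : ℝ) else 1 - (u f : ℝ))) =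
        (if e ∈ ω then ((u e : unitInterval) : ℝ) else 1 - (u e : ℝ)) * R := by
    intro u hu
    rw [← Finset.mul_prod_erase Finset.univ _ (Finset.mem_univ e)]
    congr 1
    refine Finset.prod_congr rfl fun f hf => ?_
    rw [hu f (Finset.ne_of_mem_erase hf)]
  rw [hfac w (fun f _ => rfl), hfac (Function.update w e 0) (fun f hf => Function.update_of_ne hf _ _),
    hfac (Function.update w e 1) (fun f hf => Function.update_of_ne hf _ _)]
  simp only [Function.update_self]
  by_cases he : e ∈ ω
  · simp only [if_pos he]
    push_cast
    ring
  · simp only [if_neg he]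
    push_cast
    ring

/-- A weight-1 pair that is closed kills the random-cluster weight. [cite: Grimmett2006, §1.4 eq. (1.20) (p. 15)] -/
theorem rcWeightW_eq_zero_of_one_not_mem (w : Sym2 V → unitInterval) (q : ℝ) (B : Set V) {e : Sym2 V} {ω : BondConfig V}
    (h1 : (w e : ℝ) = 1) (he : e ∉ ω) : rcWeightW w q B ω = 0 := by
  classical
  unfold rcWeightW weight
  rw [Finset.prod_eq_zero (Finset.mem_univ e) (by simp only [if_neg he, h1]; ring), zero_mul]

/-- A weight-0 pair that is open kills the random-cluster weight. [cite: Grimmett2006, §1.4 eq. (1.20) (p. 15)] -/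
theorem rcWeightW_eq_zero_of_zero_mem (w : Sym2 V → unitInterval) (q : ℝ) (B : Set V) {e : Sym2 V} {ω : BondConfig V}
    (h0 : (w e : ℝ) = 0) (he : e ∈ ω) : rcWeightW w q B ω = 0 := by
  classical
  unfold rcWeightW weight
  rw [Finset.prod_eq_zero (Finset.mem_univ e) (by simp only [if_pos he, h0]), zero_mul]

end Sections

end Literature.Probability.LatticeModels.RandomClusterRayleigh.FK

end Part2

/-!
## Part 3 — port of `Summits/CriticalPhenomena/PercolationContinuityZ3/Theorems/Transplant/FKConnectivityAllQEdgeMono.lean` (3 declarations kept)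

# Connectivity correlation inequalities for `φ_{w,q}`, every `q > 0` — file 4: pairwise positive correlation of
# two-point connection events FOLLOWS from single-edge monotonicity of connection probabilities (one-edge Bernstein induction)

Verbatim declaration-level port (the declarations listed in the Part header count) of a helper module of the
PercolationContinuityZ3 tree (FK sub-lane); route bookkeeping of the source docstring is not reproduced.

THE STATEMENT `EdgeConnMonoOn V q` (EC⁺ on the finite vertex type `V`): for every weight vector `w`, every pair `e` and vertices
`x, y`, `φ_{w[e↦0],q}(x ↔ y) ≤ φ_{w[e↦1],q}(x ↔ y)` — opening one pair never lowers a two-point connection probability;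
equivalently `p_e ↦ φ_{𝐩,q}(x ↔ y)` is non-decreasing, i.e. `Cov_φ(1{x ↔ y}, ω(e)) ≥ 0` (`EdgeConnMonoFK q` = all `V = Fin n`).
For `q ≥ 1` this is the comparison inequality (Grimmett 2006, Thm. (3.21)); for `q < 1` no monotonicity in `𝐩` is available in
print (Grimmett 2006, §5.8: "absence of stochastic ordering and the failure of positive association"), and EC⁺ is there EQUIVALENT to
edge-negative association `φ(J_e ∩ J_f) ≤ φ(J_e)φ(J_f)` (Grimmett 2006, §3.9; typed in the companion file `…AllQEdgeNegCorr.lean`),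
conjectured for `q < 1` (Kahn 2000; Grimmett–Winkler 2004; Grimmett 2006, Conj. (3.96) for the `q ↓ 0` limits) and open.

PROVED HERE (kernel):
* `FK.pairConn_mass_le_of_edgeConnMonoOn` / **`FK.pairConnPosUnder_of_edgeConnMonoOn`** / **`FK.pairConnPosFK_of_edgeConnMonoFK`**:
  EC⁺ ⇒ ANY two two-point connection events are positively correlated, `φ(x ↔ y, u ↔ v) ≥ φ(x ↔ y) φ(u ↔ v)`, for every `q > 0`
  (hence the hub inequality `HubFK q`, Ayyer–Linusson–Ravichandran 2025 §7 (13), and in the arboreal-gas reading their Conj. 7.1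
  (15)).  PROOF: strong induction on the number of pairs with parameter in `(0,1)`; in a rigid state the measure is a point mass;
  otherwise deform one fractional pair `e` of parameter `t`: every mass `S_w(E) = ∑_ω w_q(ω) 1_E(ω)` is affine in `t`
  (`FK.rcWeightW_affine`), `Q(t) = S(A ∩ B)·Z − S(A)·S(B)` is a quadratic Bernstein combination of `Q` at the two corner states
  `w[e↦0]`, `w[e↦1]` (induction) and a mixed term, and prim-hp-7's identity
  `Z⁰Z¹·MIX = (Z⁰)²Q¹ + (Z¹)²Q⁰ + (Z⁰S¹(A) − Z¹S⁰(A))·(Z⁰S¹(B) − Z¹S⁰(B))` (`HullPort.bernstein_step`) closes the step because BOTH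
  brackets are `≥ 0` by EC⁺ — the only input.  No FKG, no lattice condition: the argument is insensitive to the sign of `q − 1`.
* `FK.rcMeasureW_real_openConn_mono_of_edgeConnMonoOn`: under EC⁺, `w ≤ w'` pointwise ⇒ `φ_{w,q}(x ↔ y) ≤ φ_{w',q}(x ↔ y)`.
* `FK.edgeConnMonoOn_of_one_le`: EC⁺ for `q ≥ 1` (tree: `rcMeasureW_real_mono_weights`), whence a second proof of
  `pairConnPosFK_of_one_le` that uses only single-edge monotonicity.
* Conjecture node `FK.EdgeConnMonoFKPos` (`∀ q > 0`, NOT asserted; census of 0 negatives on all connected graphs with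
  `≤ 7` vertices, 9.6 M cells, `q ∈ {0.8, …, 0.002}`; the `k`-point analogue FAILS for `k ≥ 4` at `q < 1`) and
  `pairConnPosFKPos_of_edgeConnMonoFKPos : EdgeConnMonoFKPos → PairConnPosFKPos` (⊇ `HubFKPos`).
[cite: Grimmett2006, Thm. (3.21) (p. 43); §3.9 (pp. 63–64); §5.8 (p. 131); §1.4 eq. (1.20) (p. 15)]
[cite: AyyerLinussonRavichandran2025, §7 eq. (13)–(15), Conj. 7.1 (pp. 22–23)]
-/

section Part3

namespace Literature.Probability.LatticeModels.RandomClusterRayleigh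

namespace FK

open _root_.MeasureTheory _root_.Set Literature.Probability.LatticeModels Literature.Probability.Percolation
open Literature.Probability.Percolation.DecisionTree (ind ind_of_mem ind_of_not_mem ind_nonneg)
open scoped _root_.Classical

variable {V : Type*} [Fintype V]

/-! ### The statement EC⁺ and its conjecture node -/

/-- The mass of an event is affine in each edge parameter: `S_w(E) = (1 − w e)·S_{w[e↦0]}(E) + (w e)·S_{w[e↦1]}(E)`.
[cite: Grimmett2006, §1.4 eq. (1.20) (p. 15); Thm. (3.1)(a) (p. 37)] -/
theorem sum_rcWeightW_ind_affine (w : Sym2 V → unitInterval) (q : ℝ) (e : Sym2 V) (E : Set (BondConfig V)) :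
    ∑ ω : BondConfig V, rcWeightW w q ∅ ω * ind E ω =
      (1 - (w e : ℝ)) * ∑ ω : BondConfig V, rcWeightW (Function.update w e 0) q ∅ ω * ind E ω +
        (w e : ℝ) * ∑ ω : BondConfig V, rcWeightW (Function.update w e 1) q ∅ ω * ind E ω := by
  rw [Finset.mul_sum, Finset.mul_sum, ← Finset.sum_add_distrib]
  refine Finset.sum_congr rfl fun ω _ => ?_
  rw [rcWeightW_affine w q ∅ e ω]
  ring

/-- The partition function is affine in each edge parameter: `Z_w = (1 − w e)·Z_{w[e↦0]} + (w e)·Z_{w[e↦1]}`.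
[cite: Grimmett2006, §1.4 eq. (1.20) (p. 15); Thm. (3.1)(a) (p. 37)] -/
theorem rcPartitionFunctionW_affine (w : Sym2 V → unitInterval) (q : ℝ) (e : Sym2 V) :
    rcPartitionFunctionW w q ∅ =
      (1 - (w e : ℝ)) * rcPartitionFunctionW (Function.update w e 0) q ∅ +
        (w e : ℝ) * rcPartitionFunctionW (Function.update w e 1) q ∅ := by
  unfold rcPartitionFunctionW
  rw [Finset.mul_sum, Finset.mul_sum, ← Finset.sum_add_distrib]
  refine Finset.sum_congr rfl fun ω _ => ?_
  rw [rcWeightW_affine w q ∅ e ω]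

/-- `φ(E) = S_w(E)/Z_w`, so an inequality between two measures of events is an inequality between cross-multiplied masses.
[cite: Grimmett2006, §1.4 eq. (1.20) (p. 15)] -/
theorem real_le_real_iff_mass {w w' : Sym2 V → unitInterval} {q : ℝ} (hq : 0 < q) (E E' : Set (BondConfig V)) :
    (rcMeasureW w q ∅).real E ≤ (rcMeasureW w' q ∅).real E' ↔
      (∑ ω : BondConfig V, rcWeightW w q ∅ ω * ind E ω) * rcPartitionFunctionW w' q ∅ ≤
        (∑ ω : BondConfig V, rcWeightW w' q ∅ ω * ind E' ω) * rcPartitionFunctionW w q ∅ := by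
  rw [rcMeasureW_real_eq_sum_div w hq ∅ E, rcMeasureW_real_eq_sum_div w' hq ∅ E',
    div_le_div_iff₀ (rcPartitionFunctionW_pos w hq ∅) (rcPartitionFunctionW_pos w' hq ∅)]

end FK

end Literature.Probability.LatticeModels.RandomClusterRayleigh

end Part3

/-!
## Part 4 — port of `Summits/CriticalPhenomena/PercolationContinuityZ3/Theorems/Transplant/FKConnectivityAllQEdgeToggle.lean` (14 declarations kept)

# Connectivity correlation inequalities for `φ_{w,q}`, every `q > 0` — file 5a: the toggle `ω ↦ ω ∆ {e}` and the MASTER IDENTITY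
# relating the covariance of two edges to the single-edge increment of a connection probability

Verbatim declaration-level port (the declarations listed in the Part header count) of a helper module of the
PercolationContinuityZ3 tree (FK sub-lane); route bookkeeping of the source docstring is not reproduced.

PROVED HERE (kernel; masses `S_w(E) = ∑_ω w_q(ω) 1_E(ω)`, `J_e = {ω | e ∈ ω}`):
* `FK.rcWeightW_update_one_insert` (any `q ≠ 0`): opening the pair `e = s(x,y)` multiplies the weight by `1` or `q⁻¹` according as
  `x ↔ y` already holds or not; `FK.sum_rcWeightW_update_one_eq_toggle`: for every event `F` not depending on `e`,
  `S_{w[e↦1]}(F) = S_{w[e↦0]}(F) + (q⁻¹ − 1)·S_{w[e↦0]}(F ∩ {x ↮ y})` (substitution `ω ↦ ω ∆ {e}`); the case `F = univ`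
  `FK.rcPartitionFunctionW_update_one_eq_toggle`.
* **`FK.negCorr_defect_eq`** (MASTER IDENTITY, any `q ≠ 0`): with `c = w e`, `d = w f`, `e = s(x,y)`, `f ≠ e`,
  `S_w(J_e ∩ J_f)·Z_w − S_w(J_e)·S_w(J_f) = c(1−c)·d(1−d)·(q⁻¹ − 1)·[S_{w[e↦0][f↦1]}(x↮y)·Z_{w[e↦0][f↦0]} − S_{w[e↦0][f↦0]}(x↮y)·Z_{w[e↦0][f↦1]}]`
  — the covariance of two edges is a multiple, positive for `q < 1`, of MINUS the single-edge increment of the connection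
  probability `φ(x ↔ y)` in the state with `e` closed (for the arboreal gas this is the equivalence 'negative correlation for all
  weights ⟺ all connection probabilities increasing in all weights' stated in Bauerschmidt–Helmuth's survey, §5.2).
* `FK.compl_openConn_mass_eq`, `FK.compl_openConn_mono_lift`: `S_w(x↮y) = (1−c)·S_{w[e↦0]}(x↮y)`, `Z_w = Z_{w[e↦0]} + c(q⁻¹−1)·S_{w[e↦0]}(x↮y)`,
  and the lift of single-edge monotonicity from the state `w[e↦0]` to `w`; `FK.edgeConnMono_iff_compl_mass`.
[cite: Grimmett2006, §3.9 eq. (3.94) (pp. 63–64); Thm. (3.1)(a) (p. 37); §1.4 eq. (1.20) (p. 15)]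
[cite: AyyerLinussonRavichandran2025, §7 eq. (13)–(17) (pp. 22–23)]
-/

section Part4

namespace Literature.Probability.LatticeModels.RandomClusterRayleigh

namespace FK

open _root_.MeasureTheory _root_.Set Literature.Probability.LatticeModels Literature.Probability.Percolation
open Literature.Probability.Percolation.DecisionTree (ind ind_of_mem ind_of_not_mem ind_nonneg)
open Literature.Probability.Percolation.TwoAvoidanceSets (ind_mul_ind)
open scoped _root_.Classical symmDiff

variable {V : Type*} [Fintype V]

/-! ### Mass bookkeeping -/

/-- `S_w(Eᶜ) = Z_w − S_w(E)`. [cite: Grimmett2006, §1.4 eq. (1.20) (p. 15)] -/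
theorem sum_rcWeightW_ind_compl (w : Sym2 V → unitInterval) (q : ℝ) (E : Set (BondConfig V)) :
    ∑ ω : BondConfig V, rcWeightW w q ∅ ω * ind Eᶜ ω =
      rcPartitionFunctionW w q ∅ - ∑ ω : BondConfig V, rcWeightW w q ∅ ω * ind E ω := by
  unfold rcPartitionFunctionW
  rw [← Finset.sum_sub_distrib]
  refine Finset.sum_congr rfl fun ω _ => ?_
  by_cases h : ω ∈ E
  · have hc : ω ∉ Eᶜ := fun h' => h' h
    rw [ind_of_mem h, ind_of_not_mem hc]; ring
  · have hc : ω ∈ Eᶜ := h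
    rw [ind_of_not_mem h, ind_of_mem hc]; ring

/-- If `w e = 1` the weight lives on `J_e`: `S_w(J_e ∩ E) = S_w(E)`. [cite: Grimmett2006, §1.4 eq. (1.20) (p. 15)] -/
theorem sum_rcWeightW_ind_inter_openPair_of_one (w : Sym2 V → unitInterval) (q : ℝ) {e : Sym2 V} (h1 : (w e : ℝ) = 1)
    (E : Set (BondConfig V)) :
    ∑ ω : BondConfig V, rcWeightW w q ∅ ω * ind ({ω | e ∈ ω} ∩ E) ω = ∑ ω : BondConfig V, rcWeightW w q ∅ ω * ind E ω := by
  refine Finset.sum_congr rfl fun ω _ => ?_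
  by_cases he : e ∈ ω
  · by_cases hE : ω ∈ E
    · have h2 : ω ∈ ({ω | e ∈ ω} ∩ E : Set (BondConfig V)) := ⟨he, hE⟩
      rw [ind_of_mem h2, ind_of_mem hE]
    · have h2 : ω ∉ ({ω | e ∈ ω} ∩ E : Set (BondConfig V)) := fun h => hE h.2
      rw [ind_of_not_mem h2, ind_of_not_mem hE]
  · rw [rcWeightW_eq_zero_of_one_not_mem w q ∅ h1 he, zero_mul, zero_mul]

/-- If `w e = 0` the weight vanishes on `J_e`: `S_w(J_e ∩ E) = 0`. [cite: Grimmett2006, §1.4 eq. (1.20) (p. 15)] -/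
theorem sum_rcWeightW_ind_inter_openPair_of_zero (w : Sym2 V → unitInterval) (q : ℝ) {e : Sym2 V} (h0 : (w e : ℝ) = 0)
    (E : Set (BondConfig V)) :
    ∑ ω : BondConfig V, rcWeightW w q ∅ ω * ind ({ω | e ∈ ω} ∩ E) ω = 0 := by
  refine Finset.sum_eq_zero fun ω _ => ?_
  by_cases he : e ∈ ω
  · rw [rcWeightW_eq_zero_of_zero_mem w q ∅ h0 he, zero_mul]
  · have h2 : ω ∉ ({ω | e ∈ ω} ∩ E : Set (BondConfig V)) := fun h => he h.1
    rw [ind_of_not_mem h2, mul_zero]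

/-- One-edge decomposition of `S_w(J_f ∩ E)`: only the contraction corner survives, `S_w(J_f ∩ E) = (w f)·S_{w[f↦1]}(E)`.
[cite: Grimmett2006, §1.4 eq. (1.20) (p. 15); Thm. (3.1)(a) (p. 37)] -/
theorem sum_rcWeightW_ind_inter_openPair (w : Sym2 V → unitInterval) (q : ℝ) (f : Sym2 V) (E : Set (BondConfig V)) :
    ∑ ω : BondConfig V, rcWeightW w q ∅ ω * ind ({ω | f ∈ ω} ∩ E) ω =
      (w f : ℝ) * ∑ ω : BondConfig V, rcWeightW (Function.update w f 1) q ∅ ω * ind E ω := by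
  rw [sum_rcWeightW_ind_affine w q f,
    sum_rcWeightW_ind_inter_openPair_of_zero (Function.update w f 0) q (e := f) (by simp) E,
    sum_rcWeightW_ind_inter_openPair_of_one (Function.update w f 1) q (e := f) (by simp) E]
  ring

/-- `S_w(J_f) = (w f)·Z_{w[f↦1]}`. [cite: Grimmett2006, §1.4 eq. (1.20) (p. 15); Thm. (3.1)(a) (p. 37)] -/
theorem sum_rcWeightW_ind_openPair (w : Sym2 V → unitInterval) (q : ℝ) (f : Sym2 V) :
    ∑ ω : BondConfig V, rcWeightW w q ∅ ω * ind {ω | f ∈ ω} ω = (w f : ℝ) * rcPartitionFunctionW (Function.update w f 1) q ∅ := by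
  have h := sum_rcWeightW_ind_inter_openPair w q f Set.univ
  rw [Set.inter_univ] at h
  rw [h]
  congr 1
  unfold rcPartitionFunctionW
  refine Finset.sum_congr rfl fun ω _ => ?_
  rw [ind_of_mem (Set.mem_univ _), mul_one]

/-- With the pair `e = s(x,y)` almost surely open, `x ↮ y` has mass zero: `S_{w[e↦1]}(x ↮ y) = 0`. [cite: Grimmett2006, §1.4 eq. (1.20) (p. 15)] -/
theorem sum_rcWeightW_update_one_compl_openConn (w : Sym2 V → unitInterval) (q : ℝ) (x y : V) :
    ∑ ω : BondConfig V, rcWeightW (Function.update w s(x, y) 1) q ∅ ω * ind (openConn x y : Set (BondConfig V))ᶜ ω = 0 := by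
  refine Finset.sum_eq_zero fun ω _ => ?_
  by_cases he : s(x, y) ∈ ω
  · have hxy : ω ∈ openConn x y := by
      by_cases h : x = y
      · rw [← h]; exact (mem_openConn_iff' x x ω).2 (SimpleGraph.Reachable.refl x)
      · exact (mem_openConn_iff' x y ω).2
          (SimpleGraph.Adj.reachable (G := openGraph ω) ((SimpleGraph.fromEdgeSet_adj _).2 ⟨he, h⟩))
    have hc : ω ∉ (openConn x y : Set (BondConfig V))ᶜ := fun h => h hxy
    rw [ind_of_not_mem hc, mul_zero]
  · rw [rcWeightW_eq_zero_of_one_not_mem (Function.update w s(x, y) 1) q ∅ (by simp) he, zero_mul]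

/-! ### The toggle `ω ↦ ω ∆ {e}`: opening `e = s(x,y)` costs a factor `1` or `q⁻¹` -/

/-- **Opening the pair `e = s(x,y)`** (`e ∉ ω`): `w_q[e↦1](ω ∪ {e}) = w_q[e↦0](ω)·(1 + (q⁻¹ − 1)·1{x ↮ y in ω})` — the edge factors
agree and the cluster count drops by one exactly when `x, y` were not yet joined. [cite: Grimmett2006, Thm. (3.1)(a) (p. 37); §1.4 eq. (1.20)] -/
theorem rcWeightW_update_one_insert (w : Sym2 V → unitInterval) {q : ℝ} (hq : q ≠ 0) {x y : V}
    {ω : BondConfig V} (he : s(x, y) ∉ ω) :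
    rcWeightW (Function.update w s(x, y) 1) q ∅ (insert s(x, y) ω) =
      rcWeightW (Function.update w s(x, y) 0) q ∅ ω * (1 + (q⁻¹ - 1) * ind (openConn x y : Set (BondConfig V))ᶜ ω) := by
  -- the edge factors agree
  have hprod : BHK2006.weight (fun f => ((Function.update w s(x, y) 1 f : unitInterval) : ℝ)) (insert s(x, y) ω) =
      BHK2006.weight (fun f => ((Function.update w s(x, y) 0 f : unitInterval) : ℝ)) ω := by
    unfold BHK2006.weight
    refine Finset.prod_congr rfl fun f _ => ?_
    dsimp only
    by_cases hfe : f = s(x, y)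
    · subst hfe
      simp [he]
    · rw [Function.update_of_ne hfe, Function.update_of_ne hfe]
      have : f ∈ insert s(x, y) ω ↔ f ∈ ω := by simp [hfe]
      simp only [this]
  unfold rcWeightW
  rw [hprod]
  -- the cluster counts
  have hgraph : openGraph (insert s(x, y) ω) ⊔ wired (∅ : Set V) = (openGraph ω ⊔ wired (∅ : Set V)) ⊔ SimpleGraph.edge x y := by
    change SimpleGraph.fromEdgeSet (insert s(x, y) ω) ⊔ wired ∅ = _
    rw [Set.insert_eq, SimpleGraph.fromEdgeSet_union, sup_comm (SimpleGraph.fromEdgeSet {s(x, y)}), sup_right_comm]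
    rfl
  by_cases hreach : ω ∈ openConn x y
  · have hreach' : (openGraph ω ⊔ wired (∅ : Set V)).Reachable x y := by
      rw [wired_empty, sup_bot_eq]; exact hreach
    have hk : clusterCount (insert s(x, y) ω) ∅ = clusterCount ω ∅ := by
      unfold clusterCount
      rw [hgraph]
      exact card_connectedComponent_sup_edge_of_reachable _ hreach'
    have hc : ω ∉ (openConn x y : Set (BondConfig V))ᶜ := fun h => h hreach
    rw [hk, ind_of_not_mem hc]
    ring
  · have hreach' : ¬ (openGraph ω ⊔ wired (∅ : Set V)).Reachable x y := by
      rw [wired_empty, sup_bot_eq]; exact hreach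
    have hk : clusterCount ω ∅ = clusterCount (insert s(x, y) ω) ∅ + 1 := by
      unfold clusterCount
      rw [hgraph]
      have h1 := card_connectedComponent_sup_edge_lt _ hreach'
      have h2 := card_connectedComponent_le_sup_edge_add_one (openGraph ω ⊔ wired (∅ : Set V)) x y
      omega
    have hc : ω ∈ (openConn x y : Set (BondConfig V))ᶜ := hreach
    rw [hk, ind_of_mem hc, pow_succ, mul_one, add_sub_cancel]
    field_simp

/-- **Toggle identity**: for every event `F` that does not depend on the pair `e = s(x,y)`,
`S_{w[e↦1]}(F) = S_{w[e↦0]}(F) + (q⁻¹ − 1)·S_{w[e↦0]}(F ∩ {x ↮ y})` (substitute `ω ↦ ω ∆ {e}`).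
[cite: Grimmett2006, Thm. (3.1)(a) (p. 37); §1.4 eq. (1.20) (p. 15)] -/
theorem sum_rcWeightW_update_one_eq_toggle (w : Sym2 V → unitInterval) {q : ℝ} (hq : q ≠ 0) (x y : V)
    (F : Set (BondConfig V)) (hF : ∀ ω : BondConfig V, ω ∆ {s(x, y)} ∈ F ↔ ω ∈ F) :
    ∑ ω : BondConfig V, rcWeightW (Function.update w s(x, y) 1) q ∅ ω * ind F ω =
      ∑ ω : BondConfig V, rcWeightW (Function.update w s(x, y) 0) q ∅ ω * ind F ω +
        (q⁻¹ - 1) * ∑ ω : BondConfig V, rcWeightW (Function.update w s(x, y) 0) q ∅ ω *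
          ind (F ∩ (openConn x y : Set (BondConfig V))ᶜ) ω := by
  let σ : Equiv.Perm (BondConfig V) := Function.Involutive.toPerm (fun ω : BondConfig V => ω ∆ {s(x, y)})
    (symmDiff_left_involutive {s(x, y)})
  calc ∑ ω : BondConfig V, rcWeightW (Function.update w s(x, y) 1) q ∅ ω * ind F ω
      = ∑ ω : BondConfig V, rcWeightW (Function.update w s(x, y) 1) q ∅ (σ ω) * ind F (σ ω) :=
        (Equiv.sum_comp σ (fun ω => rcWeightW (Function.update w s(x, y) 1) q ∅ ω * ind F ω)).symm
    _ = ∑ ω : BondConfig V, (rcWeightW (Function.update w s(x, y) 0) q ∅ ω * ind F ω +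
          (q⁻¹ - 1) * (rcWeightW (Function.update w s(x, y) 0) q ∅ ω *
            ind (F ∩ (openConn x y : Set (BondConfig V))ᶜ) ω)) := by
        refine Finset.sum_congr rfl fun ω _ => ?_
        change rcWeightW (Function.update w s(x, y) 1) q ∅ (ω ∆ {s(x, y)}) * ind F (ω ∆ {s(x, y)}) = _
        have hindF : ind F (ω ∆ {s(x, y)}) = ind F ω := by
          by_cases h : ω ∈ F
          · rw [ind_of_mem h, ind_of_mem ((hF ω).2 h)]
          · rw [ind_of_not_mem h, ind_of_not_mem (fun h' => h ((hF ω).1 h'))]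
        rw [hindF]
        by_cases heω : s(x, y) ∈ ω
        · -- `e` gets closed: both sides vanish
          have hnot : s(x, y) ∉ ω ∆ {s(x, y)} := by simp [Set.mem_symmDiff, heω]
          rw [rcWeightW_eq_zero_of_one_not_mem (Function.update w s(x, y) 1) q ∅ (by simp) hnot,
            rcWeightW_eq_zero_of_zero_mem (Function.update w s(x, y) 0) q ∅ (by simp) heω]
          ring
        · -- `e` gets opened
          have hins : ω ∆ {s(x, y)} = insert s(x, y) ω := by
            ext f
            simp only [Set.mem_symmDiff, Set.mem_singleton_iff, Set.mem_insert_iff]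
            constructor
            · rintro (⟨hf, -⟩ | ⟨rfl, -⟩)
              · exact Or.inr hf
              · exact Or.inl rfl
            · rintro (rfl | hf)
              · exact Or.inr ⟨rfl, heω⟩
              · exact Or.inl ⟨hf, fun h => heω (h ▸ hf)⟩
          rw [hins, rcWeightW_update_one_insert w hq heω, ← ind_mul_ind F]
          ring
    _ = _ := by rw [Finset.sum_add_distrib, ← Finset.mul_sum]

/-- `Z_{w[e↦1]} = Z_{w[e↦0]} + (q⁻¹ − 1)·S_{w[e↦0]}(x ↮ y)` for `e = s(x,y)`. [cite: Grimmett2006, Thm. (3.1)(a) (p. 37)] -/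
theorem rcPartitionFunctionW_update_one_eq_toggle (w : Sym2 V → unitInterval) {q : ℝ} (hq : q ≠ 0) (x y : V) :
    rcPartitionFunctionW (Function.update w s(x, y) 1) q ∅ = rcPartitionFunctionW (Function.update w s(x, y) 0) q ∅ +
      (q⁻¹ - 1) * ∑ ω : BondConfig V, rcWeightW (Function.update w s(x, y) 0) q ∅ ω *
        ind (openConn x y : Set (BondConfig V))ᶜ ω := by
  have h := sum_rcWeightW_update_one_eq_toggle w hq x y Set.univ (fun ω => by simp)
  simp only [ind_of_mem (Set.mem_univ _), mul_one, Set.univ_inter] at h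
  exact h

/-! ### The master identity: covariance of two edges = −(positive factor)·(single-edge increment of a connection probability) -/

/-- **Master identity** (any `q ≠ 0`): for `e = s(x,y)` with `x ≠ y`, `f ≠ e`, `c = w e`, `d = w f`,
`S_w(J_e ∩ J_f)·Z_w − S_w(J_e)·S_w(J_f) = c(1−c)d(1−d)(q⁻¹−1)·[S_{w[e↦0][f↦1]}(x↮y)·Z_{w[e↦0][f↦0]} − S_{w[e↦0][f↦0]}(x↮y)·Z_{w[e↦0][f↦1]}]`.
So for `q < 1` the covariance of the two edges is `≤ 0` iff opening `f` (with `e` closed) does not lower `φ(x ↔ y)`.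
[cite: Grimmett2006, §3.9 eq. (3.94) (p. 63); Thm. (3.1)(a) (p. 37)] -/
theorem negCorr_defect_eq (w : Sym2 V → unitInterval) {q : ℝ} (hq : q ≠ 0) (x y : V) {f : Sym2 V}
    (hfe : f ≠ s(x, y)) :
    (∑ ω : BondConfig V, rcWeightW w q ∅ ω * ind ({ω | s(x, y) ∈ ω} ∩ {ω | f ∈ ω}) ω) * rcPartitionFunctionW w q ∅ -
        (∑ ω : BondConfig V, rcWeightW w q ∅ ω * ind {ω | s(x, y) ∈ ω} ω) *
          (∑ ω : BondConfig V, rcWeightW w q ∅ ω * ind {ω | f ∈ ω} ω) =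
      (w s(x, y) : ℝ) * (1 - (w s(x, y) : ℝ)) * ((w f : ℝ) * (1 - (w f : ℝ))) * (q⁻¹ - 1) *
        ((∑ ω : BondConfig V, rcWeightW (Function.update (Function.update w s(x, y) 0) f 1) q ∅ ω *
              ind (openConn x y : Set (BondConfig V))ᶜ ω) *
            rcPartitionFunctionW (Function.update (Function.update w s(x, y) 0) f 0) q ∅ -
          (∑ ω : BondConfig V, rcWeightW (Function.update (Function.update w s(x, y) 0) f 0) q ∅ ω *
              ind (openConn x y : Set (BondConfig V))ᶜ ω) *
            rcPartitionFunctionW (Function.update (Function.update w s(x, y) 0) f 1) q ∅) := by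
  -- STEP 1: decompose at `e`
  have s1 := sum_rcWeightW_ind_inter_openPair w q s(x, y) ({ω | f ∈ ω} : Set (BondConfig V))
  have s2 := sum_rcWeightW_ind_openPair w q s(x, y)
  have s3 := sum_rcWeightW_ind_affine w q s(x, y) ({ω | f ∈ ω} : Set (BondConfig V))
  have s4 := rcPartitionFunctionW_affine w q s(x, y)
  -- STEP 2: toggle at `e` (the events `J_f` and `univ` do not depend on `e`)
  have hF : ∀ ω : BondConfig V, ω ∆ {s(x, y)} ∈ ({ω | f ∈ ω} : Set (BondConfig V)) ↔
      ω ∈ ({ω | f ∈ ω} : Set (BondConfig V)) := by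
    intro ω
    simp only [Set.mem_setOf_eq, Set.mem_symmDiff, Set.mem_singleton_iff, hfe, not_false_eq_true, and_true, false_and,
      or_false]
  have t1 := sum_rcWeightW_update_one_eq_toggle w hq x y _ hF
  have t2 := rcPartitionFunctionW_update_one_eq_toggle w hq x y
  -- STEP 3: decompose at `f` in the state `w[e↦0]`
  have u1 := sum_rcWeightW_ind_inter_openPair (Function.update w s(x, y) 0) q f (openConn x y : Set (BondConfig V))ᶜ
  have u2 := sum_rcWeightW_ind_openPair (Function.update w s(x, y) 0) q f
  have u3 := sum_rcWeightW_ind_affine (Function.update w s(x, y) 0) q f (openConn x y : Set (BondConfig V))ᶜ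
  have u4 := rcPartitionFunctionW_affine (Function.update w s(x, y) 0) q f
  rw [Function.update_of_ne hfe] at u1 u2 u3 u4
  rw [s1, s2, s3, s4, t1, t2, u1, u2, u3, u4]
  ring

/-! ### Lifting from `w e = 0` to general weights -/

/-- **`x ↮ y` masses with the pair `e = s(x,y)` present**: `S_w(x↮y) = (1 − w e)·S_{w[e↦0]}(x↮y)` and
`Z_w = Z_{w[e↦0]} + (w e)(q⁻¹ − 1)·S_{w[e↦0]}(x↮y)`. [cite: Grimmett2006, Thm. (3.1)(a) (p. 37); §1.4 eq. (1.20) (p. 15)] -/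
theorem compl_openConn_mass_eq (w : Sym2 V → unitInterval) {q : ℝ} (hq : q ≠ 0) (x y : V) :
    (∑ ω : BondConfig V, rcWeightW w q ∅ ω * ind (openConn x y : Set (BondConfig V))ᶜ ω =
        (1 - (w s(x, y) : ℝ)) * ∑ ω : BondConfig V, rcWeightW (Function.update w s(x, y) 0) q ∅ ω *
          ind (openConn x y : Set (BondConfig V))ᶜ ω) ∧
      rcPartitionFunctionW w q ∅ = rcPartitionFunctionW (Function.update w s(x, y) 0) q ∅ +
        (w s(x, y) : ℝ) * (q⁻¹ - 1) * ∑ ω : BondConfig V, rcWeightW (Function.update w s(x, y) 0) q ∅ ω *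
          ind (openConn x y : Set (BondConfig V))ᶜ ω := by
  constructor
  · rw [sum_rcWeightW_ind_affine w q s(x, y), sum_rcWeightW_update_one_compl_openConn w q x y]
    ring
  · rw [rcPartitionFunctionW_affine w q s(x, y), rcPartitionFunctionW_update_one_eq_toggle w hq x y]
    ring

/-- EC⁺ in `x ↮ y` form, LIFTED: if opening `f` does not raise the `x ↮ y` mass fraction in the state with `e = s(x,y)` closed,
then it does not in the state `w` either (`f ≠ e`, any `q > 0`). [cite: Grimmett2006, Thm. (3.1)(a) (p. 37)] -/
theorem compl_openConn_mono_lift (w : Sym2 V → unitInterval) {q : ℝ} (hq : 0 < q) (x y : V) {f : Sym2 V}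
    (hfe : f ≠ s(x, y))
    (h : (∑ ω : BondConfig V, rcWeightW (Function.update (Function.update w s(x, y) 0) f 1) q ∅ ω *
            ind (openConn x y : Set (BondConfig V))ᶜ ω) *
          rcPartitionFunctionW (Function.update (Function.update w s(x, y) 0) f 0) q ∅ ≤
        (∑ ω : BondConfig V, rcWeightW (Function.update (Function.update w s(x, y) 0) f 0) q ∅ ω *
            ind (openConn x y : Set (BondConfig V))ᶜ ω) *
          rcPartitionFunctionW (Function.update (Function.update w s(x, y) 0) f 1) q ∅) :
    (∑ ω : BondConfig V, rcWeightW (Function.update w f 1) q ∅ ω * ind (openConn x y : Set (BondConfig V))ᶜ ω) *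
        rcPartitionFunctionW (Function.update w f 0) q ∅ ≤
      (∑ ω : BondConfig V, rcWeightW (Function.update w f 0) q ∅ ω * ind (openConn x y : Set (BondConfig V))ᶜ ω) *
        rcPartitionFunctionW (Function.update w f 1) q ∅ := by
  have hq0 : q ≠ 0 := hq.ne'
  obtain ⟨a1, z1⟩ := compl_openConn_mass_eq (Function.update w f 1) hq0 x y
  obtain ⟨a0, z0⟩ := compl_openConn_mass_eq (Function.update w f 0) hq0 x y
  rw [Function.update_of_ne hfe.symm, Function.update_comm hfe] at a1 z1 a0 z0
  rw [a1, z1, a0, z0]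
  have hc0 : 0 ≤ ((w s(x, y) : unitInterval) : ℝ) := (w s(x, y)).2.1
  have hc1 : ((w s(x, y) : unitInterval) : ℝ) ≤ 1 := (w s(x, y)).2.2
  have h1c : 0 ≤ 1 - ((w s(x, y) : unitInterval) : ℝ) := by linarith
  nlinarith [mul_nonneg h1c (sub_nonneg.2 h)]

/-! ### EC⁺ ⟺ edge-negative association (`0 < q < 1`) -/

/-- EC⁺ between the two pinned measures in `x ↮ y` mass form. [cite: Grimmett2006, §1.4 eq. (1.20) (p. 15)] -/
theorem edgeConnMono_iff_compl_mass {w₀ w₁ : Sym2 V → unitInterval} {q : ℝ} (hq : 0 < q) (x y : V) :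
    (rcMeasureW w₀ q ∅).real (openConn x y) ≤ (rcMeasureW w₁ q ∅).real (openConn x y) ↔
      (∑ ω : BondConfig V, rcWeightW w₁ q ∅ ω * ind (openConn x y : Set (BondConfig V))ᶜ ω) * rcPartitionFunctionW w₀ q ∅ ≤
        (∑ ω : BondConfig V, rcWeightW w₀ q ∅ ω * ind (openConn x y : Set (BondConfig V))ᶜ ω) *
          rcPartitionFunctionW w₁ q ∅ := by
  rw [real_le_real_iff_mass hq, sum_rcWeightW_ind_compl w₁ q, sum_rcWeightW_ind_compl w₀ q]
  constructor <;> intro h <;> nlinarith [h]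

/-! ### Appendix (same generation): the general edge ↔ connection duality for `q ≠ 1` -/

/-- `S_w(F ∩ Aᶜ) = S_w(F) − S_w(F ∩ A)`. [cite: Grimmett2006, §1.4 eq. (1.20) (p. 15)] -/
theorem sum_rcWeightW_ind_inter_compl (w : Sym2 V → unitInterval) (q : ℝ) (F A : Set (BondConfig V)) :
    ∑ ω : BondConfig V, rcWeightW w q ∅ ω * ind (F ∩ Aᶜ) ω =
      ∑ ω : BondConfig V, rcWeightW w q ∅ ω * ind F ω - ∑ ω : BondConfig V, rcWeightW w q ∅ ω * ind (F ∩ A) ω := by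
  rw [← Finset.sum_sub_distrib]
  refine Finset.sum_congr rfl fun ω _ => ?_
  rw [← ind_mul_ind F Aᶜ, ← ind_mul_ind F A]
  by_cases h : ω ∈ A
  · have hc : ω ∉ Aᶜ := fun h' => h' h
    rw [ind_of_mem h, ind_of_not_mem hc]; ring
  · have hc : ω ∈ Aᶜ := h
    rw [ind_of_not_mem h, ind_of_mem hc]; ring

end FK

end Literature.Probability.LatticeModels.RandomClusterRayleigh

end Part4

/-!
## Part 5 — port of `Summits/CriticalPhenomena/PercolationContinuityZ3/Theorems/Transplant/FKConnectivityAllQEdgeLocal.lean` (1 declarations kept)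

# Connectivity correlation inequalities for `φ_{w,q}`, every `q > 0` — file 7: the SUPPORT-RESTRICTED form of
# "edge-negative association ⇒ pairwise positive correlation of connection events" (for classes of graphs)

Verbatim declaration-level port (the declarations listed in the Part header count) of a helper module of the
PercolationContinuityZ3 tree (FK sub-lane); route bookkeeping of the source docstring is not reproduced.

The global theorems of `…AllQEdgeMono.lean` / `…AllQEdgeNegCorr.lean` (`EdgeNegCorrOn V q → PairConnPosUnder …` for `0 < q < 1`)
quantify their hypothesis over ALL weight vectors on `V`.  Their proofs, however, only ever visit weight vectors obtained from the given
one by PINNING pairs to `0` or `1` and by inserting the two target pairs `xy`, `uv` (at parameter `½`): all of these are supported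
inside `supp(w) ∪ {xy, uv}`.  This file records that bookkeeping, so that edge-negative association ON A CLASS OF SUPPORTS closed
under deletion — e.g. Wagner's theorem that series–parallel graphs are Potts–Rayleigh for every `0 < q ≤ 1` (Wagner 2008,
Ex. 5.1 + Thm. 5.8: negative edge correlation for `φ_{G,𝐩,q}`, all `𝐩`, whenever `G` has no `K₄` minor; not in the tree) — yields
pairwise positive correlation of connection events for pairs inside that support:
* `FK.edgeConnMono_of_negCorr_at` (`0 < q < 1`): ONE instance of edge-negative association, at `w[xy ↦ c][f ↦ c]` for any interior
  `c`, gives the EC⁺ instance `φ_{w[f↦0]}(x↔y) ≤ φ_{w[f↦1]}(x↔y)`.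
* `FK.pairConn_mass_le_of_edgeConnMono_on`: the Bernstein induction of `…AllQEdgeMono.lean` run inside a set `S` of allowed pairs
  (EC⁺ assumed only for weight vectors supported in `S`, only at fractional pairs, only for the two target events).
* **`FK.pairConnPosUnder_of_edgeNegCorr_on`** (`0 < q < 1`): if `φ_u(J_e ∩ J_f) ≤ φ_u(J_e)φ_u(J_f)` for every weight vector `u`
  supported in `S` and all pairs `e ≠ f` (`e` not a loop), then `φ_w(x↔y)φ_w(u↔v) ≤ φ_w(x↔y, u↔v)` for every `w` supported in `S`
  whenever `s(x,y), s(u,v) ∈ S`.  With `S` = the edge set of a series–parallel graph this is, on paper, the hub inequality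
  `φ(o↔a)φ(a↔b) ≤ φ(o↔a↔b)` (Ayyer–Linusson–Ravichandran 2025 (13)) along every edge-path `o–a–b` of every series–parallel
  weighted graph at every `q ∈ (0,1)`, by Wagner's theorem.
[cite: Grimmett2006, §3.9 eq. (3.94) (pp. 63–64); Thm. (3.1)(a) (p. 37)] [cite: AyyerLinussonRavichandran2025, §7 eq. (13)–(15) (p. 22)]
[cite: Wagner2006, Ex. 5.1, Thm. 5.8, §5.3]
-/

section Part5

namespace Literature.Probability.LatticeModels.RandomClusterRayleigh

namespace FK

open _root_.MeasureTheory _root_.Set Literature.Probability.LatticeModels Literature.Probability.Percolation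
open Literature.Probability.Percolation.DecisionTree (ind ind_of_mem ind_of_not_mem ind_nonneg)
open Literature.Probability.Percolation.TwoAvoidanceSets (ind_mul_ind)
open scoped _root_.Classical symmDiff

variable {V : Type*} [Fintype V]

/-! ### One instance of negative edge correlation gives one instance of EC⁺ -/

/-- **Local form of `NC ⇒ EC⁺`** (`0 < q < 1`): edge-negative association of the pairs `e = s(x,y)` and `f` in the single state
`w[e ↦ c][f ↦ c]` (`0 < c < 1`) implies `φ_{w[f↦0]}(x ↔ y) ≤ φ_{w[f↦1]}(x ↔ y)`. [cite: Grimmett2006, §3.9 eq. (3.94) (p. 63); Thm. (3.1)(a) (p. 37)] -/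
theorem edgeConnMono_of_negCorr_at {q : ℝ} (hq0 : 0 < q) (hq1 : q < 1) (w : Sym2 V → unitInterval) (f : Sym2 V) (x y : V)
    (c : unitInterval) (hc0 : 0 < (c : ℝ)) (hc1 : (c : ℝ) < 1)
    (hN : x ≠ y → f ≠ s(x, y) →
      (rcMeasureW (Function.update (Function.update w s(x, y) c) f c) q ∅).real ({ω | s(x, y) ∈ ω} ∩ {ω | f ∈ ω}) ≤
        (rcMeasureW (Function.update (Function.update w s(x, y) c) f c) q ∅).real {ω | s(x, y) ∈ ω} *
          (rcMeasureW (Function.update (Function.update w s(x, y) c) f c) q ∅).real {ω | f ∈ ω}) :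
    (rcMeasureW (Function.update w f 0) q ∅).real (openConn x y) ≤
      (rcMeasureW (Function.update w f 1) q ∅).real (openConn x y) := by
  -- trivial case `x = y`
  by_cases hxy : x = y
  · rw [← hxy]
    have huniv : (openConn x x : Set (BondConfig V)) = Set.univ :=
      Set.eq_univ_of_forall fun ω => (mem_openConn_iff' x x ω).2 (SimpleGraph.Reachable.refl x)
    haveI := isProbabilityMeasure_rcMeasureW (Function.update w f 0) hq0 (∅ : Set V)
    haveI := isProbabilityMeasure_rcMeasureW (Function.update w f 1) hq0 (∅ : Set V)
    rw [huniv, probReal_univ, probReal_univ]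
  rw [edgeConnMono_iff_compl_mass hq0]
  -- trivial case `f = e`
  by_cases hfe : f = s(x, y)
  · rw [hfe, sum_rcWeightW_update_one_compl_openConn w q x y, zero_mul]
    exact mul_nonneg (Finset.sum_nonneg fun ω _ => mul_nonneg (rcWeightW_nonneg _ hq0.le ∅ ω) (ind_nonneg _ ω))
      (rcPartitionFunctionW_pos _ hq0 ∅).le
  refine compl_openConn_mono_lift w hq0 x y hfe ?_
  have hN' := hN hxy hfe
  have hZ := rcPartitionFunctionW_pos (Function.update (Function.update w s(x, y) c) f c) hq0 (∅ : Set V)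
  rw [rcMeasureW_real_eq_sum_div _ hq0 ∅, rcMeasureW_real_eq_sum_div _ hq0 ∅, rcMeasureW_real_eq_sum_div _ hq0 ∅,
    div_mul_div_comm, div_le_div_iff₀ hZ (mul_pos hZ hZ)] at hN'
  have hdef : (∑ ω : BondConfig V, rcWeightW (Function.update (Function.update w s(x, y) c) f c) q ∅ ω *
          ind ({ω | s(x, y) ∈ ω} ∩ {ω | f ∈ ω}) ω) * rcPartitionFunctionW (Function.update (Function.update w s(x, y) c) f c) q ∅ -
      (∑ ω : BondConfig V, rcWeightW (Function.update (Function.update w s(x, y) c) f c) q ∅ ω * ind {ω | s(x, y) ∈ ω} ω) *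
        (∑ ω : BondConfig V, rcWeightW (Function.update (Function.update w s(x, y) c) f c) q ∅ ω * ind {ω | f ∈ ω} ω) ≤ 0 := by
    have h' : ((∑ ω : BondConfig V, rcWeightW (Function.update (Function.update w s(x, y) c) f c) q ∅ ω *
            ind ({ω | s(x, y) ∈ ω} ∩ {ω | f ∈ ω}) ω) * rcPartitionFunctionW (Function.update (Function.update w s(x, y) c) f c) q ∅ -
        (∑ ω : BondConfig V, rcWeightW (Function.update (Function.update w s(x, y) c) f c) q ∅ ω * ind {ω | s(x, y) ∈ ω} ω) *
          (∑ ω : BondConfig V, rcWeightW (Function.update (Function.update w s(x, y) c) f c) q ∅ ω * ind {ω | f ∈ ω} ω)) *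
          rcPartitionFunctionW (Function.update (Function.update w s(x, y) c) f c) q ∅ ≤
        0 * rcPartitionFunctionW (Function.update (Function.update w s(x, y) c) f c) q ∅ := by nlinarith [hN']
    exact le_of_mul_le_mul_right h' hZ
  rw [negCorr_defect_eq _ hq0.ne' x y hfe] at hdef
  have hue : Function.update (Function.update w s(x, y) c) f c s(x, y) = c := by
    rw [Function.update_of_ne (Ne.symm hfe), Function.update_self]
  have huf : Function.update (Function.update w s(x, y) c) f c f = c := by rw [Function.update_self]
  have hcorner : ∀ b : unitInterval, Function.update (Function.update (Function.update (Function.update w s(x, y) c) f c) s(x, y) 0) f b =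
      Function.update (Function.update w s(x, y) 0) f b := by
    intro b
    rw [Function.update_comm hfe, Function.update_idem, Function.update_idem]
  rw [hue, huf, hcorner 0, hcorner 1] at hdef
  have hpos : 0 < (c : ℝ) * (1 - (c : ℝ)) * ((c : ℝ) * (1 - (c : ℝ))) * (q⁻¹ - 1) := by
    have hr : 0 < q⁻¹ - 1 := by rw [sub_pos]; exact (one_lt_inv_iff₀.2 ⟨hq0, hq1⟩)
    have h1c : 0 < 1 - (c : ℝ) := by linarith
    positivity
  by_contra hcon
  have hb : 0 < (∑ ω : BondConfig V, rcWeightW (Function.update (Function.update w s(x, y) 0) f 1) q ∅ ω *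
        ind (openConn x y : Set (BondConfig V))ᶜ ω) *
      rcPartitionFunctionW (Function.update (Function.update w s(x, y) 0) f 0) q ∅ -
      (∑ ω : BondConfig V, rcWeightW (Function.update (Function.update w s(x, y) 0) f 0) q ∅ ω *
        ind (openConn x y : Set (BondConfig V))ᶜ ω) *
      rcPartitionFunctionW (Function.update (Function.update w s(x, y) 0) f 1) q ∅ := by linarith [not_le.1 hcon]
  linarith [mul_pos hpos hb]

end FK

end Literature.Probability.LatticeModels.RandomClusterRayleigh

end Part5

/-!
## Part 6 — port of `Summits/CriticalPhenomena/PercolationContinuityZ3/Theorems/PercNearOneGluingNoHeavyLowerTailCoSunflowerGlue.lean` (2 declarations kept)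

# `NoHeavyLowerTail` (stmt-CriticalPhenomena-4575) — gluing two terminals = a weight-one edge, and the
# quotient reductions of the open increasing E3GRP sunflower rows: `TIncRow → BetaRow`

Support file (prover prim-e3grp-switch-3, E3GRP switching line; `--supports stmt-CriticalPhenomena-4575`).
No definitions, no named facts, no sorries.

**The device.**  For `μ_w = prodBernoulli w` on `Set (Sym2 V)` and a pair `e`, the law `μ_{w[e ↦ 1]}` (the edge
`e` forced open, i.e. its two endpoints GLUED) is the image of `μ_w` under `ω ↦ insert e ω`:
`μ_{w[e↦1]}(B) = μ_w {ω | insert e ω ∈ B}` (`prodBernoulli_real_update_one`; from the powerset expansion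
`RussoPath.prodBernoulli_real_eq_sum_powerset`), hence `E₃` transfers (`sahiE3_update_one`).  Reachability after
adding the edge `s(c,y)` is `reachable_sup_edge` (tree `reachable_sup_edge_imp` + the trivial converse), so every
group-connection event of the glued graph is a group-connection event of the original one with `c, y` in one group.

**Consequence.**  `betaRow_of_tIncRow : TIncRow → BetaRow`: the harness row
`β = E₃(lnk[a|bcy], lnk[ab|cy], lnk[acy|b])` on a weighted graph `G` IS the three-terminal row
`T_inc = E₃(N_a, N_b, N_c)` on `G` with the pair `{c,y}` forced open (terminals `a, b, c`).  So the open increasing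
sunflower class `{β, γ, r4, r5, r6}` has the two generators `TIncRow`, `GammaRow` (`r5 = T_inc` with `{o,b}` and
`{a₁,a₂}` glued, `r6 = γ` with `{a₂,b}` glued, `r4 = γ`, by the same device).
-/

section Part6

namespace Literature.Probability.LatticeModels.RandomClusterRayleigh

open _root_.MeasureTheory
open Literature.Probability.LatticeModels
open Literature.Probability.Percolation

namespace CoSunflowerGlue

/-! ### Reachability after forcing the pair `s(c,y)` open -/

section Graph

variable {V : Type*}

/-- The open graph of `insert s(c,y) ω` is the open graph of `ω` with the edge `c y` added. [cite: Grimmett2006, §1.4 eq. (1.20) (p. 15) (open subgraph bookkeeping)] -/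
theorem openGraph_insert (ω : BondConfig V) (c y : V) :
    openGraph (insert s(c, y) ω) = openGraph ω ⊔ SimpleGraph.edge c y := by
  rw [openGraph, openGraph, SimpleGraph.edge, Set.insert_eq, SimpleGraph.fromEdgeSet_union, sup_comm]

/-- Reachability after adding one edge (both directions; the tree has the forward implication
`reachable_sup_edge_imp`). [cite: Grimmett2006, §1.4 eq. (1.20) (p. 15) (open subgraph bookkeeping)] -/
theorem reachable_sup_edge_iff' (H : SimpleGraph V) (u v x z : V) :
    (H ⊔ SimpleGraph.edge u v).Reachable x z ↔
      H.Reachable x z ∨ (H.Reachable x u ∧ H.Reachable v z) ∨ (H.Reachable x v ∧ H.Reachable u z) := by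
  constructor
  · exact reachable_sup_edge_imp H u v
  · have mono : ∀ {s t : V}, H.Reachable s t → (H ⊔ SimpleGraph.edge u v).Reachable s t :=
      fun h => h.mono le_sup_left
    rintro (h | ⟨h1, h2⟩ | ⟨h1, h2⟩)
    · exact mono h
    · by_cases huv : u = v
      · subst huv; exact (mono h1).trans (mono h2)
      · have hadj : (H ⊔ SimpleGraph.edge u v).Adj u v := by
          rw [SimpleGraph.sup_adj, SimpleGraph.edge_adj]; exact Or.inr ⟨Or.inl ⟨rfl, rfl⟩, huv⟩
        exact ((mono h1).trans hadj.reachable).trans (mono h2)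
    · by_cases huv : u = v
      · subst huv; exact (mono h1).trans (mono h2)
      · have hadj : (H ⊔ SimpleGraph.edge u v).Adj v u := by
          rw [SimpleGraph.sup_adj, SimpleGraph.edge_adj]; exact Or.inr ⟨Or.inr ⟨rfl, rfl⟩, Ne.symm huv⟩
        exact ((mono h1).trans hadj.reachable).trans (mono h2)

end Graph

end CoSunflowerGlue

end Literature.Probability.LatticeModels.RandomClusterRayleigh

end Part6

/-!
## Part 7 — port of `Summits/CriticalPhenomena/PercolationContinuityZ3/Theorems/Transplant/FKConnectivityAllQApexTools.lean` (18 declarations kept)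

# Connectivity correlation inequalities for `φ_{w,q}`, every `q > 0` — file 9a: apex elimination, TOOLS
# (graph lemmas at a degree-2 apex, almost-sure bookkeeping for masses, the apex hypothesis)

Verbatim declaration-level port (the declarations listed in the Part header count) of a helper module of the
PercolationContinuityZ3 tree (FK sub-lane); route bookkeeping of the source docstring is not reproduced.

THE ARGUMENT (files `…ApexTools`, `…ApexMass`, `…ApexCases`, `…ApexStep`, `…TwoTree`).  Wagner (Ann. Comb. 2008, Ex. 5.1 +
Thm. 5.8(d) + §5.3) proves that the random-cluster (Potts) model with `0 < q ≤ 1` is Rayleigh — edge-negatively associated,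
`φ(J_e ∩ J_f) ≤ φ(J_e)φ(J_f)` (Grimmett 2006 §3.9 (3.94)) — on every series–parallel graph, by induction over two-sums.  We prove the
graph case by APEX ELIMINATION over 2-trees (whose subgraphs are exactly the series–parallel = `K₄`-minor-free graphs): a 2-tree
is `{uv}` or `T ∪ {ux, xv}` with `uv ∈ T` and `x` fresh; for a weight vector `w` supported in `T ∪ {ux, xv}` write `a = ux`,
`b = xv`, `g = uv`, `w° = w[a↦0][b↦0]` and `K' = {u ↔ v avoiding a, b}`.  Three exact identities for events `F` insensitive to
`a, b` (file `…ApexMass`): `S_w(F) = ((1−p_a)+p_a q⁻¹)((1−p_b)+p_b q⁻¹)·S°(F) − p_a p_b q⁻¹(q⁻¹−1)·S°(F ∩ K')`,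
`S_w(J_b ∩ F ∩ K') = p_b q⁻¹·S°(F ∩ K')`, `S_w(J_a ∩ J_b ∩ F) = p_a p_b (q⁻¹ S°(F) + (q⁻¹−1)q⁻¹ S°(F ∩ K'ᶜ))`.  With fk-2's
master identity (`negCorr_defect_eq`: `Cov(J_e, J_f) ≤ 0 ⟺` opening `f` does not lower `φ_{w[e↦0]}(x ↔ y)`, `e = xy`) every pair
reduces to EC⁺ for `u ↔ v` one level down, i.e. to negative association on `T` (file `…ApexCases`): `(a, f)`:
`φ_{w[a↦0][f↦s]}(u ↔ x) = θ·φ_{w°[f↦s]}(u ↔ v)`; `(g, f)`: `φ_{w[g↦0][f↦s]}(u ↔ v)` is an increasing Möbius function of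
`φ_{w°[g↦0][f↦s]}(u ↔ v)`; `(a, b)`, `(a, g)`: unconditional; and pairs `e, f ⊆ T ∖ g` are MARGINALISED (file `…ApexStep`):
`S_w(E) = α·S_{w°[g↦c]}(E)` for `E ∈ {J_e ∩ J_f, J_e, J_f, Ω}` with `α = (1−p_a)(1−p_b) + (p_a+p_b−p_ap_b)q⁻¹` and
`α c = α p_g + (1−p_g)p_a p_b q⁻¹` (the path `u–x–v` is a pair `uv` in parallel with `g`).

THIS FILE: reachability at an apex `x` whose open pairs lie in `{ux, xv}` (`reachable_uv_apex_iff`, `reachable_ux_apex_iff`);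
masses of almost surely equal / empty / sure events; the apex hypothesis 'every live pair at `x` contains `u` or `v`' and its
almost-sure consequences; insensitivity of `K'` to the apex pairs.
[cite: Wagner2006, Ex. 5.1, Thm. 5.8(d), §5.3] [cite: Grimmett2006, §3.9 eq. (3.94) (pp. 63–64); §1.4 eq. (1.20) (p. 15); Thm. (3.1)(a) (p. 37)]
-/

section Part7

namespace Literature.Probability.LatticeModels.RandomClusterRayleigh

namespace FK

open _root_.MeasureTheory _root_.Set Literature.Probability.LatticeModels Literature.Probability.Percolation
open Literature.Probability.Percolation.DecisionTree (ind ind_of_mem ind_of_not_mem ind_nonneg)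
open Literature.Probability.Percolation.TwoAvoidanceSets (ind_mul_ind)
open scoped _root_.Classical symmDiff

variable {V : Type*} [Fintype V]

/-! ### Graph lemmas at an apex `x` whose open pairs lie in `{ux, xv}` -/

omit [Fintype V] in
/-- An isolated vertex reaches only itself. [cite: Grimmett2006, §1.4 eq. (1.20) (p. 15)] -/
theorem not_reachable_of_isolated {ω : BondConfig V} {x z : V} (hx : ∀ e ∈ ω, x ∉ e) (hz : z ≠ x) :
    ¬ (openGraph ω).Reachable x z := by
  rintro ⟨p⟩
  cases p with
  | nil => exact hz rfl
  | cons h _ =>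
    rw [openGraph_adj] at h
    exact hx _ h.1 (Sym2.mem_mk_left _ _)

omit [Fintype V] in
/-- An isolated vertex reaches only itself (symmetric form). [cite: Grimmett2006, §1.4 eq. (1.20) (p. 15)] -/
theorem not_reachable_of_isolated' {ω : BondConfig V} {x z : V} (hx : ∀ e ∈ ω, x ∉ e) (hz : z ≠ x) :
    ¬ (openGraph ω).Reachable z x := fun h => not_reachable_of_isolated hx hz h.symm

omit [Fintype V] in
/-- Removing the two apex pairs isolates the apex. [cite: Grimmett2006, §1.4 eq. (1.20) (p. 15)] -/
theorem isolated_diff_apex {ω : BondConfig V} {u v x : V}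
    (hω : ∀ e ∈ ω, x ∈ e → e = s(u, x) ∨ e = s(x, v)) :
    ∀ e ∈ ω \ {s(u, x), s(x, v)}, x ∉ e := by
  intro e he hxe
  rcases hω e he.1 hxe with rfl | rfl
  · exact he.2 (Or.inl rfl)
  · exact he.2 (Or.inr rfl)

omit [Fintype V] in
/-- **Apex lemma G1**: if the open pairs at `x` lie in `{ux, xv}` (`x ∉ {u,v}`), then `u ↔ v` iff `u ↔ v` avoiding the apex pairs,
or both apex pairs are open. [cite: Grimmett2006, §1.4 eq. (1.20) (p. 15)] -/
theorem reachable_uv_apex_iff {ω : BondConfig V} {u v x : V} (hxu : x ≠ u) (hxv : x ≠ v)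
    (hω : ∀ e ∈ ω, x ∈ e → e = s(u, x) ∨ e = s(x, v)) :
    (openGraph ω).Reachable u v ↔
      (openGraph (ω \ {s(u, x), s(x, v)})).Reachable u v ∨ (s(u, x) ∈ ω ∧ s(x, v) ∈ ω) := by
  set ξ := ω \ {s(u, x), s(x, v)} with hξ
  have hiso := isolated_diff_apex hω
  have hxu' : ¬ (openGraph ξ).Reachable x u := not_reachable_of_isolated hiso hxu.symm
  have hux' : ¬ (openGraph ξ).Reachable u x := not_reachable_of_isolated' hiso hxu.symm
  have hxv' : ¬ (openGraph ξ).Reachable x v := not_reachable_of_isolated hiso hxv.symm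
  have hvx' : ¬ (openGraph ξ).Reachable v x := not_reachable_of_isolated' hiso hxv.symm
  by_cases ha : s(u, x) ∈ ω <;> by_cases hb : s(x, v) ∈ ω
  · -- both open: `u – x – v`
    simp only [ha, hb, and_self, or_true, iff_true]
    have h1 : (openGraph ω).Adj u x := by rw [openGraph_adj]; exact ⟨ha, hxu.symm⟩
    have h2 : (openGraph ω).Adj x v := by rw [openGraph_adj]; exact ⟨hb, hxv⟩
    exact h1.reachable.trans h2.reachable
  · have hωeq : ω = insert s(u, x) ξ := by
      ext e
      simp only [hξ, Set.mem_insert_iff, Set.mem_sdiff, Set.mem_singleton_iff]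
      constructor
      · intro he
        by_cases h : e = s(u, x)
        · exact Or.inl h
        · exact Or.inr ⟨he, fun h' => h'.elim h fun h'' => hb (h'' ▸ he)⟩
      · rintro (rfl | ⟨he, -⟩)
        · exact ha
        · exact he
    simp only [ha, hb, and_false, or_false]
    rw [hωeq, CoSunflowerGlue.openGraph_insert, CoSunflowerGlue.reachable_sup_edge_iff']
    constructor
    · rintro (h | ⟨-, h2⟩ | ⟨h1, -⟩)
      · exact h
      · exact absurd h2 hxv'
      · exact absurd h1 hux'
    · exact fun h => Or.inl h
  · have hωeq : ω = insert s(x, v) ξ := by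
      ext e
      simp only [hξ, Set.mem_insert_iff, Set.mem_sdiff, Set.mem_singleton_iff]
      constructor
      · intro he
        by_cases h : e = s(x, v)
        · exact Or.inl h
        · exact Or.inr ⟨he, fun h' => h'.elim (fun h'' => ha (h'' ▸ he)) h⟩
      · rintro (rfl | ⟨he, -⟩)
        · exact hb
        · exact he
    simp only [ha, hb, false_and, or_false]
    rw [hωeq, CoSunflowerGlue.openGraph_insert, CoSunflowerGlue.reachable_sup_edge_iff']
    constructor
    · rintro (h | ⟨h1, -⟩ | ⟨-, h2⟩)
      · exact h
      · exact absurd h1 hux'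
      · exact absurd h2 hxv'
    · exact fun h => Or.inl h
  · have hωeq : ω = ξ := by
      ext e
      simp only [hξ, Set.mem_sdiff, Set.mem_insert_iff, Set.mem_singleton_iff]
      constructor
      · intro he
        exact ⟨he, fun h' => h'.elim (fun h'' => ha (h'' ▸ he)) fun h'' => hb (h'' ▸ he)⟩
      · exact fun h => h.1
    simp only [ha, hb, and_self, or_false]
    rw [← hωeq]

omit [Fintype V] in
/-- **Apex lemma G2**: if the open pairs at `x` lie in `{ux, xv}` (`x ∉ {u,v}`), then `u ↔ x` iff `ux` is open, or `xv` is open and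
`u ↔ v` avoiding the apex pairs. [cite: Grimmett2006, §1.4 eq. (1.20) (p. 15)] -/
theorem reachable_ux_apex_iff {ω : BondConfig V} {u v x : V} (hxu : x ≠ u) (hxv : x ≠ v)
    (hω : ∀ e ∈ ω, x ∈ e → e = s(u, x) ∨ e = s(x, v)) :
    (openGraph ω).Reachable u x ↔
      s(u, x) ∈ ω ∨ (s(x, v) ∈ ω ∧ (openGraph (ω \ {s(u, x), s(x, v)})).Reachable u v) := by
  set ξ := ω \ {s(u, x), s(x, v)} with hξ
  have hiso := isolated_diff_apex hω
  have hux' : ¬ (openGraph ξ).Reachable u x := not_reachable_of_isolated' hiso hxu.symm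
  have hvx' : ¬ (openGraph ξ).Reachable v x := not_reachable_of_isolated' hiso hxv.symm
  by_cases ha : s(u, x) ∈ ω
  · simp only [ha, true_or, iff_true]
    have h1 : (openGraph ω).Adj u x := by rw [openGraph_adj]; exact ⟨ha, hxu.symm⟩
    exact h1.reachable
  by_cases hb : s(x, v) ∈ ω
  · have hωeq : ω = insert s(x, v) ξ := by
      ext e
      simp only [hξ, Set.mem_insert_iff, Set.mem_sdiff, Set.mem_singleton_iff]
      constructor
      · intro he
        by_cases h : e = s(x, v)
        · exact Or.inl h
        · exact Or.inr ⟨he, fun h' => h'.elim (fun h'' => ha (h'' ▸ he)) h⟩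
      · rintro (rfl | ⟨he, -⟩)
        · exact hb
        · exact he
    simp only [ha, hb, true_and, false_or]
    rw [hωeq, CoSunflowerGlue.openGraph_insert, CoSunflowerGlue.reachable_sup_edge_iff']
    constructor
    · rintro (h | ⟨h1, -⟩ | ⟨h1, -⟩)
      · exact absurd h hux'
      · exact absurd h1 hux'
      · exact h1
    · exact fun h => Or.inr (Or.inr ⟨h, SimpleGraph.Reachable.refl _⟩)
  · have hωeq : ω = ξ := by
      ext e
      simp only [hξ, Set.mem_sdiff, Set.mem_insert_iff, Set.mem_singleton_iff]
      constructor
      · intro he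
        exact ⟨he, fun h' => h'.elim (fun h'' => ha (h'' ▸ he)) fun h'' => hb (h'' ▸ he)⟩
      · exact fun h => h.1
    simp only [ha, hb, false_and, or_false, iff_false]
    rw [hωeq]; exact hux'

/-! ### Almost-sure bookkeeping for masses -/

/-- Masses of almost surely equal events agree. [cite: Grimmett2006, §1.4 eq. (1.20) (p. 15)] -/
theorem sum_rcWeightW_ind_congr_ae (w : Sym2 V → unitInterval) (q : ℝ) {E₁ E₂ : Set (BondConfig V)}
    (h : ∀ ω, rcWeightW w q ∅ ω ≠ 0 → (ω ∈ E₁ ↔ ω ∈ E₂)) :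
    ∑ ω : BondConfig V, rcWeightW w q ∅ ω * ind E₁ ω = ∑ ω : BondConfig V, rcWeightW w q ∅ ω * ind E₂ ω := by
  refine Finset.sum_congr rfl fun ω _ => ?_
  by_cases hz : rcWeightW w q ∅ ω = 0
  · rw [hz, zero_mul, zero_mul]
  · by_cases h1 : ω ∈ E₁
    · rw [ind_of_mem h1, ind_of_mem ((h ω hz).1 h1)]
    · rw [ind_of_not_mem h1, ind_of_not_mem (fun h2 => h1 ((h ω hz).2 h2))]

/-- The mass of an almost surely empty event vanishes. [cite: Grimmett2006, §1.4 eq. (1.20) (p. 15)] -/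
theorem sum_rcWeightW_ind_eq_zero_ae (w : Sym2 V → unitInterval) (q : ℝ) {E : Set (BondConfig V)}
    (h : ∀ ω, rcWeightW w q ∅ ω ≠ 0 → ω ∉ E) :
    ∑ ω : BondConfig V, rcWeightW w q ∅ ω * ind E ω = 0 := by
  refine Finset.sum_eq_zero fun ω _ => ?_
  by_cases hz : rcWeightW w q ∅ ω = 0
  · rw [hz, zero_mul]
  · rw [ind_of_not_mem (h ω hz), mul_zero]

/-- The mass of an almost sure event is the partition function. [cite: Grimmett2006, §1.4 eq. (1.20) (p. 15)] -/
theorem sum_rcWeightW_ind_eq_Z_ae (w : Sym2 V → unitInterval) (q : ℝ) {E : Set (BondConfig V)}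
    (h : ∀ ω, rcWeightW w q ∅ ω ≠ 0 → ω ∈ E) :
    ∑ ω : BondConfig V, rcWeightW w q ∅ ω * ind E ω = rcPartitionFunctionW w q ∅ := by
  unfold rcPartitionFunctionW
  refine Finset.sum_congr rfl fun ω _ => ?_
  by_cases hz : rcWeightW w q ∅ ω = 0
  · rw [hz, zero_mul]
  · rw [ind_of_mem (h ω hz), mul_one]

/-- A mass is at most the partition function (`q ≥ 0`). [cite: Grimmett2006, §1.4 eq. (1.20) (p. 15)] -/
theorem sum_rcWeightW_ind_le_Z (w : Sym2 V → unitInterval) {q : ℝ} (hq : 0 ≤ q) (E : Set (BondConfig V)) :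
    ∑ ω : BondConfig V, rcWeightW w q ∅ ω * ind E ω ≤ rcPartitionFunctionW w q ∅ := by
  unfold rcPartitionFunctionW
  refine Finset.sum_le_sum fun ω _ => ?_
  have h0 := rcWeightW_nonneg w hq (∅ : Set V) ω
  by_cases h : ω ∈ E
  · rw [ind_of_mem h, mul_one]
  · rw [ind_of_not_mem h, mul_zero]; exact h0

/-- A pair of parameter `0` is almost surely closed. [cite: Grimmett2006, §1.4 eq. (1.20) (p. 15)] -/
theorem not_mem_of_rcWeightW_ne_zero (w : Sym2 V → unitInterval) (q : ℝ) {e : Sym2 V} (h0 : (w e : ℝ) = 0)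
    {ω : BondConfig V} (hω : rcWeightW w q ∅ ω ≠ 0) : e ∉ ω :=
  fun he => hω (rcWeightW_eq_zero_of_zero_mem w q ∅ h0 he)

/-- A pair of parameter `1` is almost surely open. [cite: Grimmett2006, §1.4 eq. (1.20) (p. 15)] -/
theorem mem_of_rcWeightW_ne_zero (w : Sym2 V → unitInterval) (q : ℝ) {e : Sym2 V} (h1 : (w e : ℝ) = 1)
    {ω : BondConfig V} (hω : rcWeightW w q ∅ ω ≠ 0) : e ∈ ω := by
  by_contra he
  exact hω (rcWeightW_eq_zero_of_one_not_mem w q ∅ h1 he)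

/-! ### The apex hypothesis: every live pair at `x` contains `u` or `v` -/

omit [Fintype V] in
/-- A pair containing `x` and `u ≠ x` is `s(u,x)`. [cite: Grimmett2006, §1.4 eq. (1.20) (p. 15)] -/
theorem sym2_eq_mk_of_mem_of_mem {e : Sym2 V} {x u : V} (hx : x ∈ e) (hu : u ∈ e) (hux : u ≠ x) : e = s(u, x) := by
  induction e using Sym2.ind with
  | h a b =>
    rw [Sym2.mem_iff] at hx hu
    rcases hx with rfl | rfl <;> rcases hu with rfl | rfl
    · exact absurd rfl hux
    · exact Sym2.eq_swap
    · rfl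
    · exact absurd rfl hux

omit [Fintype V] in
/-- The two apex pairs are distinct when `u ≠ v`. [cite: Grimmett2006, §1.4 eq. (1.20) (p. 15)] -/
theorem apex_pairs_ne {u v x : V} (hxu : x ≠ u) (huv : u ≠ v) : s(u, x) ≠ s(x, v) := by
  intro h
  rw [Sym2.eq_iff] at h
  rcases h with ⟨h1, _⟩ | ⟨h1, _⟩
  · exact hxu h1.symm
  · exact huv h1

/-- Under the apex hypothesis, almost surely the open pairs at `x` lie in `{ux, xv}`.
[cite: Grimmett2006, §1.4 eq. (1.20) (p. 15)] -/
theorem apex_of_rcWeightW_ne_zero (w : Sym2 V → unitInterval) (q : ℝ) {u v x : V} (hxu : x ≠ u) (hxv : x ≠ v)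
    (hw : ∀ e : Sym2 V, x ∈ e → ((w e : unitInterval) : ℝ) ≠ 0 → u ∈ e ∨ v ∈ e)
    {ω : BondConfig V} (hω : rcWeightW w q ∅ ω ≠ 0) :
    ∀ e ∈ ω, x ∈ e → e = s(u, x) ∨ e = s(x, v) := by
  intro e he hxe
  have hne : ((w e : unitInterval) : ℝ) ≠ 0 := fun h0 => not_mem_of_rcWeightW_ne_zero w q h0 hω he
  rcases hw e hxe hne with hu | hv
  · exact Or.inl (sym2_eq_mk_of_mem_of_mem hxe hu hxu.symm)
  · refine Or.inr ?_
    rw [sym2_eq_mk_of_mem_of_mem hxe hv hxv.symm, Sym2.eq_swap]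

/-- If moreover both apex pairs have parameter `0`, then almost surely `x` is isolated.
[cite: Grimmett2006, §1.4 eq. (1.20) (p. 15)] -/
theorem isolated_of_rcWeightW_ne_zero (w : Sym2 V → unitInterval) (q : ℝ) {u v x : V} (hxu : x ≠ u) (hxv : x ≠ v)
    (hw : ∀ e : Sym2 V, x ∈ e → ((w e : unitInterval) : ℝ) ≠ 0 → u ∈ e ∨ v ∈ e)
    (ha : ((w s(u, x) : unitInterval) : ℝ) = 0) (hb : ((w s(x, v) : unitInterval) : ℝ) = 0)
    {ω : BondConfig V} (hω : rcWeightW w q ∅ ω ≠ 0) : ∀ e ∈ ω, x ∉ e := by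
  intro e he hxe
  rcases apex_of_rcWeightW_ne_zero w q hxu hxv hw hω e he hxe with rfl | rfl
  · exact not_mem_of_rcWeightW_ne_zero w q ha hω he
  · exact not_mem_of_rcWeightW_ne_zero w q hb hω he

omit [Fintype V] in
/-- The apex hypothesis is stable under updating a pair that is off `x` or contains `u` or `v`. [cite: Grimmett2006, §1.4 eq. (1.20) (p. 15)] -/
theorem apex_hyp_update {w : Sym2 V → unitInterval} {u v x : V}
    (hw : ∀ e : Sym2 V, x ∈ e → ((w e : unitInterval) : ℝ) ≠ 0 → u ∈ e ∨ v ∈ e)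
    (f : Sym2 V) (hf : x ∈ f → u ∈ f ∨ v ∈ f) (c : unitInterval) :
    ∀ e : Sym2 V, x ∈ e → ((Function.update w f c e : unitInterval) : ℝ) ≠ 0 → u ∈ e ∨ v ∈ e := by
  intro e hxe hne
  by_cases hef : e = f
  · subst hef; exact hf hxe
  · rw [Function.update_of_ne hef] at hne
    exact hw e hxe hne

/-! ### The apex events and their insensitivity -/

omit [Fintype V] in
/-- `u ↔ v` avoiding the apex pairs is insensitive to the apex pairs. [cite: Grimmett2006, §1.4 eq. (1.20) (p. 15)] -/
theorem symmDiff_apex_diff (ω : BondConfig V) (u v x : V) {e : Sym2 V} (he : e = s(u, x) ∨ e = s(x, v)) :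
    (ω ∆ {e}) \ {s(u, x), s(x, v)} = ω \ {s(u, x), s(x, v)} := by
  ext f
  simp only [Set.mem_sdiff, Set.mem_symmDiff, Set.mem_singleton_iff, Set.mem_insert_iff]
  constructor
  · rintro ⟨hf | hf, hn⟩
    · exact ⟨hf.1, hn⟩
    · rcases he with rfl | rfl
      · exact absurd (Or.inl hf.1) hn
      · exact absurd (Or.inr hf.1) hn
  · rintro ⟨hf, hn⟩
    refine ⟨Or.inl ⟨hf, fun h => ?_⟩, hn⟩
    rcases he with rfl | rfl
    · exact hn (Or.inl h)
    · exact hn (Or.inr h)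

omit [Fintype V] in
/-- Toggling a pair `e` does not change membership of another pair `f ≠ e`. [cite: Grimmett2006, §1.4 eq. (1.20) (p. 15)] -/
theorem mem_symmDiff_singleton_of_ne (ω : BondConfig V) {e f : Sym2 V} (hfe : f ≠ e) : f ∈ ω ∆ {e} ↔ f ∈ ω := by
  simp [Set.mem_symmDiff, hfe]

end FK

end Literature.Probability.LatticeModels.RandomClusterRayleigh

end Part7

/-!
## Part 8 — port of `Summits/CriticalPhenomena/PercolationContinuityZ3/Theorems/Transplant/FKConnectivityAllQApexMass.lean` (16 declarations kept)

# Connectivity correlation inequalities for `φ_{w,q}`, every `q > 0` — file 9b: apex elimination, THE THREE APEX IDENTITIES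
# (pendant contraction, `S_w(F)`, `S_w(J_b ∩ F ∩ K')`, `S_w(J_a ∩ J_b ∩ F)` in terms of the apex-deleted vector)

Verbatim declaration-level port (the declarations listed in the Part header count) of a helper module of the
PercolationContinuityZ3 tree (FK sub-lane); route bookkeeping of the source docstring is not reproduced.

THE ARGUMENT (files `…ApexTools`, `…ApexMass`, `…ApexCases`, `…ApexStep`, `…TwoTree`).  Wagner (Ann. Comb. 2008, Ex. 5.1 +
Thm. 5.8(d) + §5.3) proves that the random-cluster (Potts) model with `0 < q ≤ 1` is Rayleigh — edge-negatively associated,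
`φ(J_e ∩ J_f) ≤ φ(J_e)φ(J_f)` (Grimmett 2006 §3.9 (3.94)) — on every series–parallel graph, by induction over two-sums.  We prove the
graph case by APEX ELIMINATION over 2-trees (whose subgraphs are exactly the series–parallel = `K₄`-minor-free graphs): a 2-tree
is `{uv}` or `T ∪ {ux, xv}` with `uv ∈ T` and `x` fresh; for a weight vector `w` supported in `T ∪ {ux, xv}` write `a = ux`,
`b = xv`, `g = uv`, `w° = w[a↦0][b↦0]` and `K' = {u ↔ v avoiding a, b}`.  Three exact identities for events `F` insensitive to
`a, b` (file `…ApexMass`): `S_w(F) = ((1−p_a)+p_a q⁻¹)((1−p_b)+p_b q⁻¹)·S°(F) − p_a p_b q⁻¹(q⁻¹−1)·S°(F ∩ K')`,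
`S_w(J_b ∩ F ∩ K') = p_b q⁻¹·S°(F ∩ K')`, `S_w(J_a ∩ J_b ∩ F) = p_a p_b (q⁻¹ S°(F) + (q⁻¹−1)q⁻¹ S°(F ∩ K'ᶜ))`.  With fk-2's
master identity (`negCorr_defect_eq`: `Cov(J_e, J_f) ≤ 0 ⟺` opening `f` does not lower `φ_{w[e↦0]}(x ↔ y)`, `e = xy`) every pair
reduces to EC⁺ for `u ↔ v` one level down, i.e. to negative association on `T` (file `…ApexCases`): `(a, f)`:
`φ_{w[a↦0][f↦s]}(u ↔ x) = θ·φ_{w°[f↦s]}(u ↔ v)`; `(g, f)`: `φ_{w[g↦0][f↦s]}(u ↔ v)` is an increasing Möbius function of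
`φ_{w°[g↦0][f↦s]}(u ↔ v)`; `(a, b)`, `(a, g)`: unconditional; and pairs `e, f ⊆ T ∖ g` are MARGINALISED (file `…ApexStep`):
`S_w(E) = α·S_{w°[g↦c]}(E)` for `E ∈ {J_e ∩ J_f, J_e, J_f, Ω}` with `α = (1−p_a)(1−p_b) + (p_a+p_b−p_ap_b)q⁻¹` and
`α c = α p_g + (1−p_g)p_a p_b q⁻¹` (the path `u–x–v` is a pair `uv` in parallel with `g`).

THIS FILE: the pendant step (`sum_pendant_update_one`: with `a` dead, contracting `b` costs exactly `q⁻¹`), the three apex identities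
`apex_mass`, `apex_mass_b_inter`, `apex_mass_ab_inter`, the measure/mass conversion for negative association
(`negCorr_real_iff_mass`), its trivial cases (dead pair, `q = 1`) and the LOCAL criterion `negCorr_of_edgeConnMono_at`
(EC⁺ at one state ⇒ negative association of one pair of pairs; the master identity of `…AllQEdgeToggle` read backwards).
[cite: Wagner2006, Ex. 5.1, Thm. 5.8(d), §5.3] [cite: Grimmett2006, §3.9 eq. (3.94) (pp. 63–64); §1.4 eq. (1.20) (p. 15); Thm. (3.1)(a) (p. 37)]
-/

section Part8

namespace Literature.Probability.LatticeModels.RandomClusterRayleigh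

namespace FK

open _root_.MeasureTheory _root_.Set Literature.Probability.LatticeModels Literature.Probability.Percolation
open Literature.Probability.Percolation.DecisionTree (ind ind_of_mem ind_of_not_mem ind_nonneg)
open Literature.Probability.Percolation.TwoAvoidanceSets (ind_mul_ind)
open scoped _root_.Classical symmDiff

variable {V : Type*} [Fintype V]

/-! ### The pendant step at `b = s(x,v)` when `a = s(u,x)` is dead -/

/-- **Pendant contraction**: if every live pair at `x` contains `u` or `v` and `a = s(u,x)` has parameter `0`, then for every
event `F` insensitive to `b = s(x,v)`, `S_{w[b↦1]}(F) = q⁻¹·S_{w[b↦0]}(F)` (opening the pendant pair always merges the otherwise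
isolated vertex `x`). [cite: Grimmett2006, Thm. (3.1)(a) (p. 37); §1.4 eq. (1.20) (p. 15)] -/
theorem sum_pendant_update_one (w : Sym2 V → unitInterval) {q : ℝ} (hq : q ≠ 0) {u v x : V} (hxu : x ≠ u) (hxv : x ≠ v)
    (huv : u ≠ v) (hw : ∀ e : Sym2 V, x ∈ e → ((w e : unitInterval) : ℝ) ≠ 0 → u ∈ e ∨ v ∈ e)
    (ha : ((w s(u, x) : unitInterval) : ℝ) = 0) (F : Set (BondConfig V))
    (hF : ∀ ω : BondConfig V, ω ∆ {s(x, v)} ∈ F ↔ ω ∈ F) :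
    ∑ ω : BondConfig V, rcWeightW (Function.update w s(x, v) 1) q ∅ ω * ind F ω =
      q⁻¹ * ∑ ω : BondConfig V, rcWeightW (Function.update w s(x, v) 0) q ∅ ω * ind F ω := by
  rw [sum_rcWeightW_update_one_eq_toggle w hq x v F hF]
  have hab := apex_pairs_ne hxu huv
  have hw0 := apex_hyp_update hw s(x, v) (fun _ => Or.inr (Sym2.mem_mk_right x v)) 0
  have ha0 : ((Function.update w s(x, v) 0 s(u, x) : unitInterval) : ℝ) = 0 := by
    rw [Function.update_of_ne hab]; exact ha
  have hb0 : ((Function.update w s(x, v) 0 s(x, v) : unitInterval) : ℝ) = 0 := by simp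
  have hfull : ∑ ω : BondConfig V, rcWeightW (Function.update w s(x, v) 0) q ∅ ω *
      ind (F ∩ (openConn x v : Set (BondConfig V))ᶜ) ω =
      ∑ ω : BondConfig V, rcWeightW (Function.update w s(x, v) 0) q ∅ ω * ind F ω := by
    refine sum_rcWeightW_ind_congr_ae _ q fun ω hω => ?_
    have hiso := isolated_of_rcWeightW_ne_zero _ q hxu hxv hw0 ha0 hb0 hω
    constructor
    · exact fun h => h.1
    · exact fun h => ⟨h, not_reachable_of_isolated hiso hxv.symm⟩
  rw [hfull]
  ring

/-- **Pendant opening**: under the same hypotheses, `S_w(J_b ∩ E) = (w b)·q⁻¹·S_{w[b↦0]}(E)` for `E` insensitive to `b`.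
[cite: Grimmett2006, Thm. (3.1)(a) (p. 37); §1.4 eq. (1.20) (p. 15)] -/
theorem sum_pendant_openPair (w : Sym2 V → unitInterval) {q : ℝ} (hq : q ≠ 0) {u v x : V} (hxu : x ≠ u) (hxv : x ≠ v)
    (huv : u ≠ v) (hw : ∀ e : Sym2 V, x ∈ e → ((w e : unitInterval) : ℝ) ≠ 0 → u ∈ e ∨ v ∈ e)
    (ha : ((w s(u, x) : unitInterval) : ℝ) = 0) (E : Set (BondConfig V))
    (hE : ∀ ω : BondConfig V, ω ∆ {s(x, v)} ∈ E ↔ ω ∈ E) :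
    ∑ ω : BondConfig V, rcWeightW w q ∅ ω * ind ({ω | s(x, v) ∈ ω} ∩ E) ω =
      ((w s(x, v) : unitInterval) : ℝ) * q⁻¹ * ∑ ω : BondConfig V, rcWeightW (Function.update w s(x, v) 0) q ∅ ω * ind E ω := by
  rw [sum_rcWeightW_ind_inter_openPair w q s(x, v) E, sum_pendant_update_one w hq hxu hxv huv hw ha E hE]
  ring

/-- **Pendant partition function**: `Z_w = ((1 − w b) + (w b)·q⁻¹)·Z_{w[b↦0]}`. [cite: Grimmett2006, Thm. (3.1)(a) (p. 37)] -/
theorem sum_pendant_affine (w : Sym2 V → unitInterval) {q : ℝ} (hq : q ≠ 0) {u v x : V} (hxu : x ≠ u) (hxv : x ≠ v)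
    (huv : u ≠ v) (hw : ∀ e : Sym2 V, x ∈ e → ((w e : unitInterval) : ℝ) ≠ 0 → u ∈ e ∨ v ∈ e)
    (ha : ((w s(u, x) : unitInterval) : ℝ) = 0) (E : Set (BondConfig V))
    (hE : ∀ ω : BondConfig V, ω ∆ {s(x, v)} ∈ E ↔ ω ∈ E) :
    ∑ ω : BondConfig V, rcWeightW w q ∅ ω * ind E ω =
      ((1 - ((w s(x, v) : unitInterval) : ℝ)) + ((w s(x, v) : unitInterval) : ℝ) * q⁻¹) *
        ∑ ω : BondConfig V, rcWeightW (Function.update w s(x, v) 0) q ∅ ω * ind E ω := by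
  rw [sum_rcWeightW_ind_affine w q s(x, v) E, sum_pendant_update_one w hq hxu hxv huv hw ha E hE]
  ring

/-! ### Insensitivity of the apex-avoiding connection event -/

omit [Fintype V] in
/-- `K' = {u ↔ v avoiding the apex pairs}` is insensitive to each apex pair. [cite: Grimmett2006, Thm. (3.1)(a) (p. 37); §1.4 eq. (1.20) (p. 15)] -/
theorem apexAvoid_insens (u v x : V) {e : Sym2 V} (he : e = s(u, x) ∨ e = s(x, v)) (ω : BondConfig V) :
    ω ∆ {e} ∈ {ω : BondConfig V | ω \ {s(u, x), s(x, v)} ∈ (openConn u v : Set (BondConfig V))} ↔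
      ω ∈ {ω : BondConfig V | ω \ {s(u, x), s(x, v)} ∈ (openConn u v : Set (BondConfig V))} := by
  simp only [Set.mem_setOf_eq]
  rw [symmDiff_apex_diff ω u v x he]

omit [Fintype V] in
/-- The complement of `K'` is insensitive to each apex pair. [cite: Grimmett2006, Thm. (3.1)(a) (p. 37); §1.4 eq. (1.20) (p. 15)] -/
theorem apexAvoid_compl_insens (u v x : V) {e : Sym2 V} (he : e = s(u, x) ∨ e = s(x, v)) (ω : BondConfig V) :
    ω ∆ {e} ∈ {ω : BondConfig V | ω \ {s(u, x), s(x, v)} ∈ (openConn u v : Set (BondConfig V))}ᶜ ↔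
      ω ∈ {ω : BondConfig V | ω \ {s(u, x), s(x, v)} ∈ (openConn u v : Set (BondConfig V))}ᶜ := by
  rw [Set.mem_compl_iff, Set.mem_compl_iff, apexAvoid_insens u v x he]

omit [Fintype V] in
/-- Intersections of insensitive events are insensitive. [cite: Grimmett2006, Thm. (3.1)(a) (p. 37); §1.4 eq. (1.20) (p. 15)] -/
theorem inter_insens {e : Sym2 V} {A B : Set (BondConfig V)} (hA : ∀ ω : BondConfig V, ω ∆ {e} ∈ A ↔ ω ∈ A)
    (hB : ∀ ω : BondConfig V, ω ∆ {e} ∈ B ↔ ω ∈ B) (ω : BondConfig V) : ω ∆ {e} ∈ A ∩ B ↔ ω ∈ A ∩ B := by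
  rw [Set.mem_inter_iff, Set.mem_inter_iff, hA, hB]

/-! ### The three apex identities -/

/-- **Apex identity 1**: for `F` insensitive to the apex pairs,
`S_w(F) = ((1 − w a) + (w a)q⁻¹)((1 − w b) + (w b)q⁻¹)·S_{w°}(F) − (w a)(w b)q⁻¹(q⁻¹ − 1)·S_{w°}(F ∩ K')`.
[cite: Grimmett2006, Thm. (3.1)(a) (p. 37); §1.4 eq. (1.20) (p. 15)] -/
theorem apex_mass (w : Sym2 V → unitInterval) {q : ℝ} (hq : q ≠ 0) {u v x : V} (hxu : x ≠ u) (hxv : x ≠ v)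
    (huv : u ≠ v) (hw : ∀ e : Sym2 V, x ∈ e → ((w e : unitInterval) : ℝ) ≠ 0 → u ∈ e ∨ v ∈ e)
    (F : Set (BondConfig V)) (hFa : ∀ ω : BondConfig V, ω ∆ {s(u, x)} ∈ F ↔ ω ∈ F)
    (hFb : ∀ ω : BondConfig V, ω ∆ {s(x, v)} ∈ F ↔ ω ∈ F) :
    ∑ ω : BondConfig V, rcWeightW w q ∅ ω * ind F ω =
      ((1 - ((w s(u, x) : unitInterval) : ℝ)) + ((w s(u, x) : unitInterval) : ℝ) * q⁻¹) *
          ((1 - ((w s(x, v) : unitInterval) : ℝ)) + ((w s(x, v) : unitInterval) : ℝ) * q⁻¹) *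
          ∑ ω : BondConfig V, rcWeightW (Function.update (Function.update w s(u, x) 0) s(x, v) 0) q ∅ ω * ind F ω -
        ((w s(u, x) : unitInterval) : ℝ) * ((w s(x, v) : unitInterval) : ℝ) * q⁻¹ * (q⁻¹ - 1) *
          ∑ ω : BondConfig V, rcWeightW (Function.update (Function.update w s(u, x) 0) s(x, v) 0) q ∅ ω *
            ind (F ∩ {ω : BondConfig V | ω \ {s(u, x), s(x, v)} ∈ (openConn u v : Set (BondConfig V))}) ω := by
  have hab := apex_pairs_ne hxu huv
  set K : Set (BondConfig V) := {ω : BondConfig V | ω \ {s(u, x), s(x, v)} ∈ (openConn u v : Set (BondConfig V))} with hK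
  have hw0 := apex_hyp_update hw s(u, x) (fun _ => Or.inl (Sym2.mem_mk_left u x)) 0
  have ha0 : ((Function.update w s(u, x) 0 s(u, x) : unitInterval) : ℝ) = 0 := by simp
  -- decomposition at `a`
  rw [sum_rcWeightW_ind_affine w q s(u, x) F, sum_rcWeightW_update_one_eq_toggle w hq u x F hFa,
    sum_rcWeightW_ind_inter_compl (Function.update w s(u, x) 0) q F (openConn u x)]
  -- with `a` dead, `u ↔ x` iff `b` open and `K'`
  have hux : ∑ ω : BondConfig V, rcWeightW (Function.update w s(u, x) 0) q ∅ ω *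
      ind (F ∩ (openConn u x : Set (BondConfig V))) ω =
      ∑ ω : BondConfig V, rcWeightW (Function.update w s(u, x) 0) q ∅ ω * ind ({ω | s(x, v) ∈ ω} ∩ (F ∩ K)) ω := by
    refine sum_rcWeightW_ind_congr_ae _ q fun ω hω => ?_
    have hapex := apex_of_rcWeightW_ne_zero _ q hxu hxv hw0 hω
    have ha : s(u, x) ∉ ω := not_mem_of_rcWeightW_ne_zero _ q ha0 hω
    rw [Set.mem_inter_iff, mem_openConn_iff', reachable_ux_apex_iff hxu hxv hapex]
    simp only [ha, false_or, Set.mem_inter_iff, Set.mem_setOf_eq, hK]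
    constructor
    · rintro ⟨hF, hb, hk⟩; exact ⟨hb, hF, hk⟩
    · rintro ⟨hb, hF, hk⟩; exact ⟨hF, hb, hk⟩
  have hFK : ∀ ω : BondConfig V, ω ∆ {s(x, v)} ∈ F ∩ K ↔ ω ∈ F ∩ K :=
    inter_insens hFb (apexAvoid_insens u v x (Or.inr rfl))
  rw [hux, sum_pendant_openPair (Function.update w s(u, x) 0) hq hxu hxv huv hw0 ha0 (F ∩ K) hFK,
    sum_pendant_affine (Function.update w s(u, x) 0) hq hxu hxv huv hw0 ha0 F hFb,
    Function.update_of_ne hab.symm]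
  ring

/-- **Apex identity 3**: for `F` insensitive to the apex pairs,
`S_w(J_a ∩ J_b ∩ F) = (w a)(w b)·(q⁻¹·S_{w°}(F) + (q⁻¹ − 1)q⁻¹·S_{w°}(F ∩ K'ᶜ))`.
[cite: Grimmett2006, Thm. (3.1)(a) (p. 37); §1.4 eq. (1.20) (p. 15)] -/
theorem apex_mass_ab_inter (w : Sym2 V → unitInterval) {q : ℝ} (hq : q ≠ 0) {u v x : V} (hxu : x ≠ u) (hxv : x ≠ v)
    (huv : u ≠ v) (hw : ∀ e : Sym2 V, x ∈ e → ((w e : unitInterval) : ℝ) ≠ 0 → u ∈ e ∨ v ∈ e)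
    (F : Set (BondConfig V)) (hFa : ∀ ω : BondConfig V, ω ∆ {s(u, x)} ∈ F ↔ ω ∈ F)
    (hFb : ∀ ω : BondConfig V, ω ∆ {s(x, v)} ∈ F ↔ ω ∈ F) :
    ∑ ω : BondConfig V, rcWeightW w q ∅ ω * ind ({ω | s(u, x) ∈ ω} ∩ ({ω | s(x, v) ∈ ω} ∩ F)) ω =
      ((w s(u, x) : unitInterval) : ℝ) * ((w s(x, v) : unitInterval) : ℝ) *
        (q⁻¹ * ∑ ω : BondConfig V, rcWeightW (Function.update (Function.update w s(u, x) 0) s(x, v) 0) q ∅ ω * ind F ω +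
          (q⁻¹ - 1) * q⁻¹ *
            ∑ ω : BondConfig V, rcWeightW (Function.update (Function.update w s(u, x) 0) s(x, v) 0) q ∅ ω *
              ind (F ∩ {ω : BondConfig V | ω \ {s(u, x), s(x, v)} ∈ (openConn u v : Set (BondConfig V))}ᶜ) ω) := by
  have hab := apex_pairs_ne hxu huv
  set K : Set (BondConfig V) := {ω : BondConfig V | ω \ {s(u, x), s(x, v)} ∈ (openConn u v : Set (BondConfig V))} with hK
  -- open `a`, then `b`
  rw [sum_rcWeightW_ind_inter_openPair w q s(u, x) ({ω | s(x, v) ∈ ω} ∩ F),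
    sum_rcWeightW_ind_inter_openPair (Function.update w s(u, x) 1) q s(x, v) F,
    Function.update_of_ne hab.symm, Function.update_comm hab]
  -- the vector `w[b↦1]` satisfies the apex hypothesis; toggle at `a`
  have hwb := apex_hyp_update hw s(x, v) (fun _ => Or.inr (Sym2.mem_mk_right x v)) 1
  rw [sum_rcWeightW_update_one_eq_toggle (Function.update w s(x, v) 1) hq u x F hFa,
    Function.update_comm hab.symm]
  -- now the base vector is `w[a↦0][b↦1]`; a.s. `b` is open and `a` closed, so `u ↔ x ↔ K'`
  have hw0 := apex_hyp_update hw s(u, x) (fun _ => Or.inl (Sym2.mem_mk_left u x)) 0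
  have hw01 := apex_hyp_update hw0 s(x, v) (fun _ => Or.inr (Sym2.mem_mk_right x v)) 1
  have ha0' : ((Function.update (Function.update w s(u, x) 0) s(x, v) 1 s(u, x) : unitInterval) : ℝ) = 0 := by
    rw [Function.update_of_ne hab]; simp
  have hb1' : ((Function.update (Function.update w s(u, x) 0) s(x, v) 1 s(x, v) : unitInterval) : ℝ) = 1 := by simp
  have hKc : ∑ ω : BondConfig V, rcWeightW (Function.update (Function.update w s(u, x) 0) s(x, v) 1) q ∅ ω *
      ind (F ∩ (openConn u x : Set (BondConfig V))ᶜ) ω =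
      ∑ ω : BondConfig V, rcWeightW (Function.update (Function.update w s(u, x) 0) s(x, v) 1) q ∅ ω * ind (F ∩ Kᶜ) ω := by
    refine sum_rcWeightW_ind_congr_ae _ q fun ω hω => ?_
    have hapex := apex_of_rcWeightW_ne_zero _ q hxu hxv hw01 hω
    have ha : s(u, x) ∉ ω := not_mem_of_rcWeightW_ne_zero _ q ha0' hω
    have hb : s(x, v) ∈ ω := mem_of_rcWeightW_ne_zero _ q hb1' hω
    rw [Set.mem_inter_iff, Set.mem_inter_iff, Set.mem_compl_iff, Set.mem_compl_iff, mem_openConn_iff',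
      reachable_ux_apex_iff hxu hxv hapex]
    simp only [ha, hb, false_or, true_and, hK, Set.mem_setOf_eq]
    exact Iff.rfl
  rw [hKc]
  -- pendant steps on the `a`-dead vector `w[a↦0]`
  have ha0 : ((Function.update w s(u, x) 0 s(u, x) : unitInterval) : ℝ) = 0 := by simp
  have hFKc : ∀ ω : BondConfig V, ω ∆ {s(x, v)} ∈ F ∩ Kᶜ ↔ ω ∈ F ∩ Kᶜ :=
    inter_insens hFb (apexAvoid_compl_insens u v x (Or.inr rfl))
  rw [sum_pendant_update_one (Function.update w s(u, x) 0) hq hxu hxv huv hw0 ha0 F hFb,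
    sum_pendant_update_one (Function.update w s(u, x) 0) hq hxu hxv huv hw0 ha0 (F ∩ Kᶜ) hFKc]
  ring

/-! ### Conversions between measure and mass forms; trivial cases of negative association -/

/-- `S_w(univ) = Z_w`. [cite: Grimmett2006, §1.4 eq. (1.20) (p. 15)] -/
theorem sum_rcWeightW_ind_univ (w : Sym2 V → unitInterval) (q : ℝ) :
    ∑ ω : BondConfig V, rcWeightW w q ∅ ω * ind (Set.univ : Set (BondConfig V)) ω = rcPartitionFunctionW w q ∅ := by
  unfold rcPartitionFunctionW
  refine Finset.sum_congr rfl fun ω _ => ?_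
  rw [ind_of_mem (Set.mem_univ _), mul_one]

/-- Negative association of the pairs `e, f` in measure form iff in mass form: `S(J_e ∩ J_f)·Z ≤ S(J_e)·S(J_f)`.
[cite: Grimmett2006, §3.9 eq. (3.94) (p. 63); §1.4 eq. (1.20) (p. 15)] -/
theorem negCorr_real_iff_mass {q : ℝ} (hq0 : 0 < q) (w : Sym2 V → unitInterval) (e f : Sym2 V) :
    (rcMeasureW w q ∅).real ({ω | e ∈ ω} ∩ {ω | f ∈ ω}) ≤
        (rcMeasureW w q ∅).real {ω | e ∈ ω} * (rcMeasureW w q ∅).real {ω | f ∈ ω} ↔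
      (∑ ω : BondConfig V, rcWeightW w q ∅ ω * ind ({ω | e ∈ ω} ∩ {ω | f ∈ ω}) ω) * rcPartitionFunctionW w q ∅ ≤
        (∑ ω : BondConfig V, rcWeightW w q ∅ ω * ind {ω | e ∈ ω} ω) *
          (∑ ω : BondConfig V, rcWeightW w q ∅ ω * ind {ω | f ∈ ω} ω) := by
  have hZ := rcPartitionFunctionW_pos w hq0 (∅ : Set V)
  rw [rcMeasureW_real_eq_sum_div w hq0 ∅, rcMeasureW_real_eq_sum_div w hq0 ∅, rcMeasureW_real_eq_sum_div w hq0 ∅,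
    div_mul_div_comm, div_le_div_iff₀ hZ (mul_pos hZ hZ)]
  constructor
  · intro h
    refine le_of_mul_le_mul_right ?_ hZ
    calc (∑ ω : BondConfig V, rcWeightW w q ∅ ω * ind ({ω | e ∈ ω} ∩ {ω | f ∈ ω}) ω) * rcPartitionFunctionW w q ∅ *
          rcPartitionFunctionW w q ∅
        = (∑ ω : BondConfig V, rcWeightW w q ∅ ω * ind ({ω | e ∈ ω} ∩ {ω | f ∈ ω}) ω) *
          (rcPartitionFunctionW w q ∅ * rcPartitionFunctionW w q ∅) := by ring
      _ ≤ _ := h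
  · intro h
    calc (∑ ω : BondConfig V, rcWeightW w q ∅ ω * ind ({ω | e ∈ ω} ∩ {ω | f ∈ ω}) ω) *
          (rcPartitionFunctionW w q ∅ * rcPartitionFunctionW w q ∅)
        = (∑ ω : BondConfig V, rcWeightW w q ∅ ω * ind ({ω | e ∈ ω} ∩ {ω | f ∈ ω}) ω) * rcPartitionFunctionW w q ∅ *
          rcPartitionFunctionW w q ∅ := by ring
      _ ≤ _ := mul_le_mul_of_nonneg_right h hZ.le

/-- Negative association is symmetric in the two pairs. [cite: Grimmett2006, §3.9 eq. (3.94) (p. 63)] -/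
theorem negCorr_symm {q : ℝ} (w : Sym2 V → unitInterval) {e f : Sym2 V}
    (h : (rcMeasureW w q ∅).real ({ω | e ∈ ω} ∩ {ω | f ∈ ω}) ≤
      (rcMeasureW w q ∅).real {ω | e ∈ ω} * (rcMeasureW w q ∅).real {ω | f ∈ ω}) :
    (rcMeasureW w q ∅).real ({ω | f ∈ ω} ∩ {ω | e ∈ ω}) ≤
      (rcMeasureW w q ∅).real {ω | f ∈ ω} * (rcMeasureW w q ∅).real {ω | e ∈ ω} := by
  rw [Set.inter_comm, mul_comm]; exact h

/-- A dead pair is negatively associated with everything (the joint event is null).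
[cite: Grimmett2006, §3.9 eq. (3.94) (p. 63); §1.4 eq. (1.20) (p. 15)] -/
theorem negCorr_of_weight_zero_left {q : ℝ} (hq0 : 0 < q) (w : Sym2 V → unitInterval) {e : Sym2 V} (f : Sym2 V)
    (h0 : ((w e : unitInterval) : ℝ) = 0) :
    (rcMeasureW w q ∅).real ({ω | e ∈ ω} ∩ {ω | f ∈ ω}) ≤
      (rcMeasureW w q ∅).real {ω | e ∈ ω} * (rcMeasureW w q ∅).real {ω | f ∈ ω} := by
  rw [rcMeasureW_real_eq_sum_div w hq0 ∅ ({ω | e ∈ ω} ∩ {ω | f ∈ ω}),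
    sum_rcWeightW_ind_inter_openPair_of_zero w q h0 {ω | f ∈ ω}, zero_div]
  exact mul_nonneg measureReal_nonneg measureReal_nonneg

/-- A dead pair is negatively associated with everything (second slot). [cite: Grimmett2006, §3.9 eq. (3.94) (p. 63)] -/
theorem negCorr_of_weight_zero_right {q : ℝ} (hq0 : 0 < q) (w : Sym2 V → unitInterval) (e : Sym2 V) {f : Sym2 V}
    (h0 : ((w f : unitInterval) : ℝ) = 0) :
    (rcMeasureW w q ∅).real ({ω | e ∈ ω} ∩ {ω | f ∈ ω}) ≤
      (rcMeasureW w q ∅).real {ω | e ∈ ω} * (rcMeasureW w q ∅).real {ω | f ∈ ω} :=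
  negCorr_symm w (negCorr_of_weight_zero_left hq0 w e h0)

/-- **Local form of EC⁺ ⇒ negative association** (`0 < q ≤ 1`): if opening `f` does not lower `φ(x ↔ y)` in the state with
`e = s(x,y)` closed, then `J_e` and `J_f` are negatively associated under `φ_w` (the master identity read backwards).
[cite: Grimmett2006, §3.9 eq. (3.94) (p. 63); Thm. (3.1)(a) (p. 37)] -/
theorem negCorr_of_edgeConnMono_at {q : ℝ} (hq0 : 0 < q) (hq1 : q ≤ 1) (w : Sym2 V → unitInterval) {x y : V}
    {f : Sym2 V} (hfe : f ≠ s(x, y))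
    (hEC : (rcMeasureW (Function.update (Function.update w s(x, y) 0) f 0) q ∅).real (openConn x y) ≤
      (rcMeasureW (Function.update (Function.update w s(x, y) 0) f 1) q ∅).real (openConn x y)) :
    (rcMeasureW w q ∅).real ({ω | s(x, y) ∈ ω} ∩ {ω | f ∈ ω}) ≤
      (rcMeasureW w q ∅).real {ω | s(x, y) ∈ ω} * (rcMeasureW w q ∅).real {ω | f ∈ ω} := by
  have hZ := rcPartitionFunctionW_pos w hq0 (∅ : Set V)
  rw [negCorr_real_iff_mass hq0]
  suffices hdef : (∑ ω : BondConfig V, rcWeightW w q ∅ ω * ind ({ω | s(x, y) ∈ ω} ∩ {ω | f ∈ ω}) ω) *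
      rcPartitionFunctionW w q ∅ -
      (∑ ω : BondConfig V, rcWeightW w q ∅ ω * ind {ω | s(x, y) ∈ ω} ω) *
        (∑ ω : BondConfig V, rcWeightW w q ∅ ω * ind {ω | f ∈ ω} ω) ≤ 0 by linarith [hdef]
  rw [negCorr_defect_eq w hq0.ne' x y hfe]
  have hEC' := (edgeConnMono_iff_compl_mass hq0 x y).1 hEC
  have hc0 : 0 ≤ ((w s(x, y) : unitInterval) : ℝ) := (w s(x, y)).2.1
  have hc1 : ((w s(x, y) : unitInterval) : ℝ) ≤ 1 := (w s(x, y)).2.2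
  have hd0 : 0 ≤ ((w f : unitInterval) : ℝ) := (w f).2.1
  have hd1 : ((w f : unitInterval) : ℝ) ≤ 1 := (w f).2.2
  have hr : 0 ≤ q⁻¹ - 1 := by rw [sub_nonneg]; exact (one_le_inv_iff₀.2 ⟨hq0, hq1⟩)
  have hfac : 0 ≤ ((w s(x, y) : unitInterval) : ℝ) * (1 - ((w s(x, y) : unitInterval) : ℝ)) *
      (((w f : unitInterval) : ℝ) * (1 - ((w f : unitInterval) : ℝ))) * (q⁻¹ - 1) := by
    have h1 : 0 ≤ 1 - ((w s(x, y) : unitInterval) : ℝ) := by linarith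
    have h2 : 0 ≤ 1 - ((w f : unitInterval) : ℝ) := by linarith
    positivity
  exact mul_nonpos_iff.2 (Or.inl ⟨hfac, by linarith⟩)

/-- At `q = 1` (product measure) every two pairs are exactly uncorrelated, in particular negatively associated.
[cite: Grimmett2006, §1.4 eq. (1.20) (p. 15); §3.9 eq. (3.94) (p. 63)] -/
theorem negCorr_of_q_one (w : Sym2 V → unitInterval) (e f : Sym2 V) (hfe : f ≠ e) :
    (rcMeasureW w 1 ∅).real ({ω | e ∈ ω} ∩ {ω | f ∈ ω}) ≤
      (rcMeasureW w 1 ∅).real {ω | e ∈ ω} * (rcMeasureW w 1 ∅).real {ω | f ∈ ω} := by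
  induction e using Sym2.ind with
  | h x y =>
  rw [negCorr_real_iff_mass one_pos]
  have hdef := negCorr_defect_eq w one_ne_zero x y hfe
  rw [inv_one, sub_self, mul_zero, zero_mul] at hdef
  linarith [hdef]

/-! ### Supports and updates -/

omit [Fintype V] in
/-- Updating inside the support keeps the support. [cite: Grimmett2006, Thm. (3.1)(a) (p. 37); §1.4 eq. (1.20) (p. 15)] -/
theorem supp_update_mem {w : Sym2 V → unitInterval} {S : Set (Sym2 V)} (hw : ∀ e, ((w e : unitInterval) : ℝ) ≠ 0 → e ∈ S)
    {f : Sym2 V} (hf : f ∈ S) (c : unitInterval) : ∀ e, ((Function.update w f c e : unitInterval) : ℝ) ≠ 0 → e ∈ S := by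
  intro e he
  by_cases hef : e = f
  · exact hef ▸ hf
  · rw [Function.update_of_ne hef] at he; exact hw e he

end FK

end Literature.Probability.LatticeModels.RandomClusterRayleigh

end Part8

/-!
## Part 9 — port of `Summits/CriticalPhenomena/PercolationContinuityZ3/Theorems/Transplant/FKConnectivityAllQApexCases.lean` (5 declarations kept)

# Connectivity correlation inequalities for `φ_{w,q}`, every `q > 0` — file 9c: apex elimination, THE PAIR CASES
# (an apex pair against anything; the base pair `g = uv` against a pair off the apex)

Verbatim declaration-level port (the declarations listed in the Part header count) of a helper module of the
PercolationContinuityZ3 tree (FK sub-lane); route bookkeeping of the source docstring is not reproduced.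

THE ARGUMENT (files `…ApexTools`, `…ApexMass`, `…ApexCases`, `…ApexStep`, `…TwoTree`).  Wagner (Ann. Comb. 2008, Ex. 5.1 +
Thm. 5.8(d) + §5.3) proves that the random-cluster (Potts) model with `0 < q ≤ 1` is Rayleigh — edge-negatively associated,
`φ(J_e ∩ J_f) ≤ φ(J_e)φ(J_f)` (Grimmett 2006 §3.9 (3.94)) — on every series–parallel graph, by induction over two-sums.  We prove the
graph case by APEX ELIMINATION over 2-trees (whose subgraphs are exactly the series–parallel = `K₄`-minor-free graphs): a 2-tree
is `{uv}` or `T ∪ {ux, xv}` with `uv ∈ T` and `x` fresh; for a weight vector `w` supported in `T ∪ {ux, xv}` write `a = ux`,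
`b = xv`, `g = uv`, `w° = w[a↦0][b↦0]` and `K' = {u ↔ v avoiding a, b}`.  Three exact identities for events `F` insensitive to
`a, b` (file `…ApexMass`): `S_w(F) = ((1−p_a)+p_a q⁻¹)((1−p_b)+p_b q⁻¹)·S°(F) − p_a p_b q⁻¹(q⁻¹−1)·S°(F ∩ K')`,
`S_w(J_b ∩ F ∩ K') = p_b q⁻¹·S°(F ∩ K')`, `S_w(J_a ∩ J_b ∩ F) = p_a p_b (q⁻¹ S°(F) + (q⁻¹−1)q⁻¹ S°(F ∩ K'ᶜ))`.  With fk-2's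
master identity (`negCorr_defect_eq`: `Cov(J_e, J_f) ≤ 0 ⟺` opening `f` does not lower `φ_{w[e↦0]}(x ↔ y)`, `e = xy`) every pair
reduces to EC⁺ for `u ↔ v` one level down, i.e. to negative association on `T` (file `…ApexCases`): `(a, f)`:
`φ_{w[a↦0][f↦s]}(u ↔ x) = θ·φ_{w°[f↦s]}(u ↔ v)`; `(g, f)`: `φ_{w[g↦0][f↦s]}(u ↔ v)` is an increasing Möbius function of
`φ_{w°[g↦0][f↦s]}(u ↔ v)`; `(a, b)`, `(a, g)`: unconditional; and pairs `e, f ⊆ T ∖ g` are MARGINALISED (file `…ApexStep`):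
`S_w(E) = α·S_{w°[g↦c]}(E)` for `E ∈ {J_e ∩ J_f, J_e, J_f, Ω}` with `α = (1−p_a)(1−p_b) + (p_a+p_b−p_ap_b)q⁻¹` and
`α c = α p_g + (1−p_g)p_a p_b q⁻¹` (the path `u–x–v` is a pair `uv` in parallel with `g`).

THIS FILE: EC⁺ for `u ↔ v` from negative association on the support (`edgeConnMono_of_negCorr_supp`, via fk-2's
`edgeConnMono_of_negCorr_at`), `edgeConnMono_self`; the cases `negCorr_apex_ab` (`a` vs `b`), `negCorr_apex_pair` (`a` vs
`f ∌ x`), `negCorr_base_pair` (`g` vs `f ∌ x`).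
[cite: Wagner2006, Ex. 5.1, Thm. 5.8(d), §5.3] [cite: Grimmett2006, §3.9 eq. (3.94) (pp. 63–64); Thm. (3.1)(a) (p. 37)]
[cite: AyyerLinussonRavichandran2025, §7 eq. (13)–(15) (p. 22)]
-/

section Part9

namespace Literature.Probability.LatticeModels.RandomClusterRayleigh

namespace FK

open _root_.MeasureTheory _root_.Set Literature.Probability.LatticeModels Literature.Probability.Percolation
open Literature.Probability.Percolation.DecisionTree (ind ind_of_mem ind_of_not_mem ind_nonneg)
open Literature.Probability.Percolation.TwoAvoidanceSets (ind_mul_ind)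
open scoped _root_.Classical symmDiff

variable {V : Type*} [Fintype V]

/-! ### EC⁺ for the base pair `g = s(u,v)` from negative association on `T` -/

/-- **EC⁺ from negative association on the support** (`0 < q < 1`): if every weight vector supported in `T ∋ s(u,v)` is
edge-negatively associated, then for `w` supported in `T` and `f ∈ T`, `f ≠ s(u,v)`, opening `f` does not lower `φ(u ↔ v)`.
[cite: Grimmett2006, §3.9 eq. (3.94) (p. 63); Thm. (3.1)(a) (p. 37)] -/
theorem edgeConnMono_of_negCorr_supp {q : ℝ} (hq0 : 0 < q) (hq1 : q < 1) {T : Set (Sym2 V)}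
    (hNC : ∀ w' : Sym2 V → unitInterval, (∀ e, ((w' e : unitInterval) : ℝ) ≠ 0 → e ∈ T) → ∀ e f : Sym2 V, ¬ e.IsDiag → f ≠ e →
      (rcMeasureW w' q ∅).real ({ω | e ∈ ω} ∩ {ω | f ∈ ω}) ≤ (rcMeasureW w' q ∅).real {ω | e ∈ ω} * (rcMeasureW w' q ∅).real {ω | f ∈ ω})
    {u v : V} (huvT : s(u, v) ∈ T) {f : Sym2 V} (hfT : f ∈ T)
    (w : Sym2 V → unitInterval) (hw : ∀ e, ((w e : unitInterval) : ℝ) ≠ 0 → e ∈ T) :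
    (rcMeasureW (Function.update w f 0) q ∅).real (openConn u v) ≤
      (rcMeasureW (Function.update w f 1) q ∅).real (openConn u v) := by
  set half : unitInterval := ⟨2⁻¹, by norm_num, by norm_num⟩ with hhalf
  refine edgeConnMono_of_negCorr_at hq0 hq1 w f u v half (by norm_num [hhalf]) (by norm_num [hhalf]) fun huv hfe => ?_
  refine hNC _ (supp_update_mem (supp_update_mem hw huvT half) hfT half) s(u, v) f ?_ hfe
  rw [Sym2.mk_isDiag_iff]; exact huv

/-- Contracting `g = s(u,v)` makes `u ↔ v` almost sure, so `φ_{w[g↦0]}(u ↔ v) ≤ φ_{w[g↦1]}(u ↔ v) = 1`.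
[cite: Grimmett2006, §1.4 eq. (1.20) (p. 15)] -/
theorem edgeConnMono_self {q : ℝ} (hq0 : 0 < q) (w : Sym2 V → unitInterval) (u v : V) :
    (rcMeasureW (Function.update w s(u, v) 0) q ∅).real (openConn u v) ≤
      (rcMeasureW (Function.update w s(u, v) 1) q ∅).real (openConn u v) := by
  have h1 : (rcMeasureW (Function.update w s(u, v) 1) q ∅).real (openConn u v) = 1 := by
    rw [rcMeasureW_real_eq_sum_div _ hq0 ∅, sum_rcWeightW_ind_eq_Z_ae _ q,
      div_self (rcPartitionFunctionW_pos _ hq0 (∅ : Set V)).ne']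
    intro ω hω
    have hg : s(u, v) ∈ ω := mem_of_rcWeightW_ne_zero _ q (by simp) hω
    rw [mem_openConn_iff']
    by_cases huv : u = v
    · subst huv; exact SimpleGraph.Reachable.refl u
    · have hadj : (openGraph ω).Adj u v := by rw [openGraph_adj]; exact ⟨hg, huv⟩
      exact hadj.reachable
  rw [h1, rcMeasureW_real_eq_sum_div _ hq0 ∅]
  exact (div_le_one (rcPartitionFunctionW_pos _ hq0 (∅ : Set V))).2 (sum_rcWeightW_ind_le_Z _ hq0.le _)

/-! ### Case (b): the two apex pairs -/

/-- **The two apex pairs are negatively associated**: with both apex pairs closed `x` is isolated, so `φ_{w[a↦0][b↦0]}(u ↔ x) = 0`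
and the local criterion applies. [cite: Grimmett2006, §3.9 eq. (3.94) (p. 63); Thm. (3.1)(a) (p. 37)] -/
theorem negCorr_apex_ab {q : ℝ} (hq0 : 0 < q) (hq1 : q ≤ 1) (w : Sym2 V → unitInterval) {u v x : V} (hxu : x ≠ u)
    (hxv : x ≠ v) (huv : u ≠ v) (hw : ∀ e : Sym2 V, x ∈ e → ((w e : unitInterval) : ℝ) ≠ 0 → u ∈ e ∨ v ∈ e) :
    (rcMeasureW w q ∅).real ({ω | s(u, x) ∈ ω} ∩ {ω | s(x, v) ∈ ω}) ≤
      (rcMeasureW w q ∅).real {ω | s(u, x) ∈ ω} * (rcMeasureW w q ∅).real {ω | s(x, v) ∈ ω} := by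
  have hab := apex_pairs_ne hxu huv
  refine negCorr_of_edgeConnMono_at hq0 hq1 w hab.symm ?_
  have hw0 := apex_hyp_update hw s(u, x) (fun _ => Or.inl (Sym2.mem_mk_left u x)) 0
  have hw00 := apex_hyp_update hw0 s(x, v) (fun _ => Or.inr (Sym2.mem_mk_right x v)) 0
  have ha : ((Function.update (Function.update w s(u, x) 0) s(x, v) 0 s(u, x) : unitInterval) : ℝ) = 0 := by
    rw [Function.update_of_ne hab]; simp
  have hb : ((Function.update (Function.update w s(u, x) 0) s(x, v) 0 s(x, v) : unitInterval) : ℝ) = 0 := by simp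
  have h0 : (rcMeasureW (Function.update (Function.update w s(u, x) 0) s(x, v) 0) q ∅).real (openConn u x) = 0 := by
    rw [rcMeasureW_real_eq_sum_div _ hq0 ∅, sum_rcWeightW_ind_eq_zero_ae _ q, zero_div]
    intro ω hω
    have hiso := isolated_of_rcWeightW_ne_zero _ q hxu hxv hw00 ha hb hω
    exact not_reachable_of_isolated' hiso hxu.symm
  rw [h0]
  exact measureReal_nonneg

/-! ### Case (a/g): an apex pair against a pair off `x` -/

/-- **An apex pair `a = s(u,x)` is negatively associated with every pair `f` off `x`**, provided opening `f` does not lower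
`φ°(u ↔ v)` in the apex-deleted state `w° = w[a↦0][b↦0]` (which is EC⁺ one level down).  Mechanism: with `a` closed,
`u ↔ x` iff `b` is open and `u ↔ v` avoiding `x`, and `b` is then a pendant pair: `φ_{w[a↦0][f↦s]}(u ↔ x) = θ·φ_{w°[f↦s]}(u ↔ v)`
with `θ = (w b)q⁻¹/((1 − w b) + (w b)q⁻¹)` independent of `s`. [cite: Grimmett2006, §3.9 eq. (3.94) (p. 63); Thm. (3.1)(a) (p. 37)] -/
theorem negCorr_apex_pair {q : ℝ} (hq0 : 0 < q) (hq1 : q ≤ 1) (w : Sym2 V → unitInterval) {u v x : V} (hxu : x ≠ u)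
    (hxv : x ≠ v) (huv : u ≠ v) (hw : ∀ e : Sym2 V, x ∈ e → ((w e : unitInterval) : ℝ) ≠ 0 → u ∈ e ∨ v ∈ e)
    {f : Sym2 V} (hfx : x ∉ f)
    (hEC : (rcMeasureW (Function.update (Function.update (Function.update w s(u, x) 0) s(x, v) 0) f 0) q ∅).real (openConn u v) ≤
      (rcMeasureW (Function.update (Function.update (Function.update w s(u, x) 0) s(x, v) 0) f 1) q ∅).real (openConn u v)) :
    (rcMeasureW w q ∅).real ({ω | s(u, x) ∈ ω} ∩ {ω | f ∈ ω}) ≤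
      (rcMeasureW w q ∅).real {ω | s(u, x) ∈ ω} * (rcMeasureW w q ∅).real {ω | f ∈ ω} := by
  have hab := apex_pairs_ne hxu huv
  have hfa : f ≠ s(u, x) := fun h => hfx (h ▸ Sym2.mem_mk_right u x)
  have hfb : f ≠ s(x, v) := fun h => hfx (h ▸ Sym2.mem_mk_left x v)
  set K : Set (BondConfig V) := {ω : BondConfig V | ω \ {s(u, x), s(x, v)} ∈ (openConn u v : Set (BondConfig V))} with hK
  have hKb : ∀ ω : BondConfig V, ω ∆ {s(x, v)} ∈ K ↔ ω ∈ K := apexAvoid_insens u v x (Or.inr rfl)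
  have huniv : ∀ ω : BondConfig V, ω ∆ {s(x, v)} ∈ (Set.univ : Set (BondConfig V)) ↔ ω ∈ (Set.univ : Set (BondConfig V)) :=
    fun ω => by simp
  refine negCorr_of_edgeConnMono_at hq0 hq1 w hfa ?_
  rw [real_le_real_iff_mass hq0]
  rw [real_le_real_iff_mass hq0] at hEC
  -- the two states `A_s = w[a↦0][f↦s]`
  have key : ∀ s : unitInterval,
      (∑ ω : BondConfig V, rcWeightW (Function.update (Function.update w s(u, x) 0) f s) q ∅ ω *
          ind (openConn u x : Set (BondConfig V)) ω =
        ((w s(x, v) : unitInterval) : ℝ) * q⁻¹ *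
          ∑ ω : BondConfig V, rcWeightW (Function.update (Function.update (Function.update w s(u, x) 0) s(x, v) 0) f s) q ∅ ω *
            ind (openConn u v : Set (BondConfig V)) ω) ∧
      rcPartitionFunctionW (Function.update (Function.update w s(u, x) 0) f s) q ∅ =
        ((1 - ((w s(x, v) : unitInterval) : ℝ)) + ((w s(x, v) : unitInterval) : ℝ) * q⁻¹) *
          rcPartitionFunctionW (Function.update (Function.update (Function.update w s(u, x) 0) s(x, v) 0) f s) q ∅ := by
    intro s
    have hwA := apex_hyp_update (apex_hyp_update hw s(u, x) (fun _ => Or.inl (Sym2.mem_mk_left u x)) 0) f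
      (fun h => absurd h hfx) s
    have haA : ((Function.update (Function.update w s(u, x) 0) f s s(u, x) : unitInterval) : ℝ) = 0 := by
      rw [Function.update_of_ne hfa.symm]; simp
    have hbA : ((Function.update (Function.update w s(u, x) 0) f s s(x, v) : unitInterval) : ℝ) =
        ((w s(x, v) : unitInterval) : ℝ) := by
      rw [Function.update_of_ne hfb.symm, Function.update_of_ne hab.symm]
    -- the state with `b` also killed is `w°[f↦s]`
    have hcomm : Function.update (Function.update (Function.update w s(u, x) 0) f s) s(x, v) 0 =
        Function.update (Function.update (Function.update w s(u, x) 0) s(x, v) 0) f s :=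
      Function.update_comm hfb _ _ _
    have hw0s := apex_hyp_update hwA s(x, v) (fun _ => Or.inr (Sym2.mem_mk_right x v)) 0
    have ha0s : ((Function.update (Function.update (Function.update w s(u, x) 0) f s) s(x, v) 0 s(u, x) : unitInterval) : ℝ) =
        0 := by rw [Function.update_of_ne hab]; exact haA
    have hb0s : ((Function.update (Function.update (Function.update w s(u, x) 0) f s) s(x, v) 0 s(x, v) : unitInterval) : ℝ) =
        0 := by simp
    constructor
    · -- `u ↔ x` a.s. iff `b` open and `K`
      have h1 : ∑ ω : BondConfig V, rcWeightW (Function.update (Function.update w s(u, x) 0) f s) q ∅ ω *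
          ind (openConn u x : Set (BondConfig V)) ω =
          ∑ ω : BondConfig V, rcWeightW (Function.update (Function.update w s(u, x) 0) f s) q ∅ ω *
            ind ({ω | s(x, v) ∈ ω} ∩ K) ω := by
        refine sum_rcWeightW_ind_congr_ae _ q fun ω hω => ?_
        have hapex := apex_of_rcWeightW_ne_zero _ q hxu hxv hwA hω
        have ha : s(u, x) ∉ ω := not_mem_of_rcWeightW_ne_zero _ q haA hω
        rw [mem_openConn_iff', reachable_ux_apex_iff hxu hxv hapex]
        simp only [ha, false_or, Set.mem_inter_iff, Set.mem_setOf_eq, hK]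
        exact Iff.rfl
      -- under `w°[f↦s]`, `K` a.s. iff `u ↔ v`
      have h2 : ∑ ω : BondConfig V, rcWeightW (Function.update (Function.update (Function.update w s(u, x) 0) f s) s(x, v) 0)
          q ∅ ω * ind K ω =
          ∑ ω : BondConfig V, rcWeightW (Function.update (Function.update (Function.update w s(u, x) 0) f s) s(x, v) 0)
            q ∅ ω * ind (openConn u v : Set (BondConfig V)) ω := by
        refine sum_rcWeightW_ind_congr_ae _ q fun ω hω => ?_
        have hapex := apex_of_rcWeightW_ne_zero _ q hxu hxv hw0s hω
        have ha : s(u, x) ∉ ω := not_mem_of_rcWeightW_ne_zero _ q ha0s hω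
        rw [hK, Set.mem_setOf_eq, mem_openConn_iff', mem_openConn_iff', reachable_uv_apex_iff hxu hxv hapex]
        simp only [ha, false_and, or_false]
      rw [h1, sum_pendant_openPair _ hq0.ne' hxu hxv huv hwA haA K hKb, hbA, h2, hcomm]
    · rw [← sum_rcWeightW_ind_univ, sum_pendant_affine _ hq0.ne' hxu hxv huv hwA haA Set.univ huniv, hbA,
        sum_rcWeightW_ind_univ, hcomm]
  obtain ⟨k0, z0⟩ := key 0
  obtain ⟨k1, z1⟩ := key 1
  rw [k0, z0, k1, z1]
  have hp0 : 0 ≤ ((w s(x, v) : unitInterval) : ℝ) := (w s(x, v)).2.1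
  have hp1 : ((w s(x, v) : unitInterval) : ℝ) ≤ 1 := (w s(x, v)).2.2
  have hqi : 0 ≤ q⁻¹ := inv_nonneg.2 hq0.le
  have hc : 0 ≤ ((w s(x, v) : unitInterval) : ℝ) * q⁻¹ * ((1 - ((w s(x, v) : unitInterval) : ℝ)) + ((w s(x, v) : unitInterval) : ℝ) * q⁻¹) := by
    have : 0 ≤ 1 - ((w s(x, v) : unitInterval) : ℝ) := by linarith
    positivity
  calc ((w s(x, v) : unitInterval) : ℝ) * q⁻¹ *
          (∑ ω : BondConfig V, rcWeightW (Function.update (Function.update (Function.update w s(u, x) 0) s(x, v) 0) f 0) q ∅ ω *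
            ind (openConn u v : Set (BondConfig V)) ω) *
        (((1 - ((w s(x, v) : unitInterval) : ℝ)) + ((w s(x, v) : unitInterval) : ℝ) * q⁻¹) *
          rcPartitionFunctionW (Function.update (Function.update (Function.update w s(u, x) 0) s(x, v) 0) f 1) q ∅)
      = ((w s(x, v) : unitInterval) : ℝ) * q⁻¹ * ((1 - ((w s(x, v) : unitInterval) : ℝ)) + ((w s(x, v) : unitInterval) : ℝ) * q⁻¹) *
          ((∑ ω : BondConfig V, rcWeightW (Function.update (Function.update (Function.update w s(u, x) 0) s(x, v) 0) f 0) q ∅ ω *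
              ind (openConn u v : Set (BondConfig V)) ω) *
            rcPartitionFunctionW (Function.update (Function.update (Function.update w s(u, x) 0) s(x, v) 0) f 1) q ∅) := by
        ring
    _ ≤ ((w s(x, v) : unitInterval) : ℝ) * q⁻¹ * ((1 - ((w s(x, v) : unitInterval) : ℝ)) + ((w s(x, v) : unitInterval) : ℝ) * q⁻¹) *
          ((∑ ω : BondConfig V, rcWeightW (Function.update (Function.update (Function.update w s(u, x) 0) s(x, v) 0) f 1) q ∅ ω *
              ind (openConn u v : Set (BondConfig V)) ω) *
            rcPartitionFunctionW (Function.update (Function.update (Function.update w s(u, x) 0) s(x, v) 0) f 0) q ∅) :=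
        mul_le_mul_of_nonneg_left hEC hc
    _ = _ := by ring

/-! ### Case (d): the base pair `g = s(u,v)` against a pair off `x` -/

/-- **The base pair `g = s(u,v)` is negatively associated with every pair `f ∌ x`, `f ≠ g`**, provided opening `f` does not
lower `φ(u ↔ v)` in the state `w°[g↦0]` (apex pairs and `g` deleted — EC⁺ one level down).  Mechanism: with `g` closed,
`u ↔ v` iff `u ↔ v` avoiding `x` or both apex pairs are open; by the apex identities `φ_{w[g↦0][f↦s]}(u ↔ v) = h(φ_{w°[g↦0][f↦s]}(u ↔ v))`
for one increasing Möbius map `h` independent of `s`. [cite: Grimmett2006, §3.9 eq. (3.94) (p. 63); Thm. (3.1)(a) (p. 37)] -/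
theorem negCorr_base_pair {q : ℝ} (hq0 : 0 < q) (hq1 : q ≤ 1) (w : Sym2 V → unitInterval) {u v x : V} (hxu : x ≠ u)
    (hxv : x ≠ v) (huv : u ≠ v) (hw : ∀ e : Sym2 V, x ∈ e → ((w e : unitInterval) : ℝ) ≠ 0 → u ∈ e ∨ v ∈ e)
    {f : Sym2 V} (hfx : x ∉ f) (hfg : f ≠ s(u, v))
    (hEC : (rcMeasureW (Function.update (Function.update (Function.update (Function.update w s(u, x) 0) s(x, v) 0) s(u, v) 0) f 0)
        q ∅).real (openConn u v) ≤
      (rcMeasureW (Function.update (Function.update (Function.update (Function.update w s(u, x) 0) s(x, v) 0) s(u, v) 0) f 1)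
        q ∅).real (openConn u v)) :
    (rcMeasureW w q ∅).real ({ω | s(u, v) ∈ ω} ∩ {ω | f ∈ ω}) ≤
      (rcMeasureW w q ∅).real {ω | s(u, v) ∈ ω} * (rcMeasureW w q ∅).real {ω | f ∈ ω} := by
  have hab := apex_pairs_ne hxu huv
  have hfa : f ≠ s(u, x) := fun h => hfx (h ▸ Sym2.mem_mk_right u x)
  have hfb : f ≠ s(x, v) := fun h => hfx (h ▸ Sym2.mem_mk_left x v)
  have hgx : x ∉ s(u, v) := by
    rw [Sym2.mem_iff]; rintro (h | h); exacts [hxu h, hxv h]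
  have hga : s(u, v) ≠ s(u, x) := fun h => hgx (h ▸ Sym2.mem_mk_right u x)
  have hgb : s(u, v) ≠ s(x, v) := fun h => hgx (h ▸ Sym2.mem_mk_left x v)
  set K : Set (BondConfig V) := {ω : BondConfig V | ω \ {s(u, x), s(x, v)} ∈ (openConn u v : Set (BondConfig V))} with hK
  have hKa : ∀ ω : BondConfig V, ω ∆ {s(u, x)} ∈ K ↔ ω ∈ K := apexAvoid_insens u v x (Or.inl rfl)
  have hKb : ∀ ω : BondConfig V, ω ∆ {s(x, v)} ∈ K ↔ ω ∈ K := apexAvoid_insens u v x (Or.inr rfl)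
  have hKca : ∀ ω : BondConfig V, ω ∆ {s(u, x)} ∈ Kᶜ ↔ ω ∈ Kᶜ := apexAvoid_compl_insens u v x (Or.inl rfl)
  have hKcb : ∀ ω : BondConfig V, ω ∆ {s(x, v)} ∈ Kᶜ ↔ ω ∈ Kᶜ := apexAvoid_compl_insens u v x (Or.inr rfl)
  have hUa : ∀ ω : BondConfig V, ω ∆ {s(u, x)} ∈ (Set.univ : Set (BondConfig V)) ↔ ω ∈ (Set.univ : Set (BondConfig V)) :=
    fun ω => by simp
  have hUb : ∀ ω : BondConfig V, ω ∆ {s(x, v)} ∈ (Set.univ : Set (BondConfig V)) ↔ ω ∈ (Set.univ : Set (BondConfig V)) :=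
    fun ω => by simp
  refine negCorr_of_edgeConnMono_at hq0 hq1 w hfg ?_
  rw [real_le_real_iff_mass hq0]
  rw [real_le_real_iff_mass hq0] at hEC
  -- the two states `C_s = w[g↦0][f↦s]` and their apex-deleted versions `D_s = w°[g↦0][f↦s]`
  have key : ∀ s : unitInterval,
      (∑ ω : BondConfig V, rcWeightW (Function.update (Function.update w s(u, v) 0) f s) q ∅ ω *
          ind (openConn u v : Set (BondConfig V)) ω =
        (((1 - ((w s(u, x) : unitInterval) : ℝ)) + ((w s(u, x) : unitInterval) : ℝ) * q⁻¹) *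
              ((1 - ((w s(x, v) : unitInterval) : ℝ)) + ((w s(x, v) : unitInterval) : ℝ) * q⁻¹) -
            ((w s(u, x) : unitInterval) : ℝ) * ((w s(x, v) : unitInterval) : ℝ) * q⁻¹ * (q⁻¹ - 1)) *
          (∑ ω : BondConfig V, rcWeightW (Function.update (Function.update (Function.update (Function.update w s(u, x) 0)
            s(x, v) 0) s(u, v) 0) f s) q ∅ ω * ind (openConn u v : Set (BondConfig V)) ω) +
        ((w s(u, x) : unitInterval) : ℝ) * ((w s(x, v) : unitInterval) : ℝ) * (q⁻¹ * q⁻¹) *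
          (rcPartitionFunctionW (Function.update (Function.update (Function.update (Function.update w s(u, x) 0)
            s(x, v) 0) s(u, v) 0) f s) q ∅ -
           ∑ ω : BondConfig V, rcWeightW (Function.update (Function.update (Function.update (Function.update w s(u, x) 0)
            s(x, v) 0) s(u, v) 0) f s) q ∅ ω * ind (openConn u v : Set (BondConfig V)) ω)) ∧
      rcPartitionFunctionW (Function.update (Function.update w s(u, v) 0) f s) q ∅ =
        (((1 - ((w s(u, x) : unitInterval) : ℝ)) + ((w s(u, x) : unitInterval) : ℝ) * q⁻¹) *
              ((1 - ((w s(x, v) : unitInterval) : ℝ)) + ((w s(x, v) : unitInterval) : ℝ) * q⁻¹)) *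
          rcPartitionFunctionW (Function.update (Function.update (Function.update (Function.update w s(u, x) 0)
            s(x, v) 0) s(u, v) 0) f s) q ∅ -
        ((w s(u, x) : unitInterval) : ℝ) * ((w s(x, v) : unitInterval) : ℝ) * q⁻¹ * (q⁻¹ - 1) *
          ∑ ω : BondConfig V, rcWeightW (Function.update (Function.update (Function.update (Function.update w s(u, x) 0)
            s(x, v) 0) s(u, v) 0) f s) q ∅ ω * ind (openConn u v : Set (BondConfig V)) ω := by
    intro s
    -- the state `C_s`
    have hwC := apex_hyp_update (apex_hyp_update hw s(u, v) (fun h => absurd h hgx) 0) f (fun h => absurd h hfx) s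
    have haC : ((Function.update (Function.update w s(u, v) 0) f s s(u, x) : unitInterval) : ℝ) =
        ((w s(u, x) : unitInterval) : ℝ) := by
      rw [Function.update_of_ne hfa.symm, Function.update_of_ne hga.symm]
    have hbC : ((Function.update (Function.update w s(u, v) 0) f s s(x, v) : unitInterval) : ℝ) =
        ((w s(x, v) : unitInterval) : ℝ) := by
      rw [Function.update_of_ne hfb.symm, Function.update_of_ne hgb.symm]
    -- its apex-deleted version is `D_s`
    have hcomm : Function.update (Function.update (Function.update (Function.update w s(u, v) 0) f s) s(u, x) 0) s(x, v) 0 =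
        Function.update (Function.update (Function.update (Function.update w s(u, x) 0) s(x, v) 0) s(u, v) 0) f s := by
      rw [Function.update_comm hfa, Function.update_comm hga, Function.update_comm hfb, Function.update_comm hgb]
    have hwD : ∀ e : Sym2 V, x ∈ e →
        ((Function.update (Function.update (Function.update (Function.update w s(u, v) 0) f s) s(u, x) 0) s(x, v) 0 e :
          unitInterval) : ℝ) ≠ 0 → u ∈ e ∨ v ∈ e :=
      apex_hyp_update (apex_hyp_update hwC s(u, x) (fun _ => Or.inl (Sym2.mem_mk_left u x)) 0) s(x, v)
        (fun _ => Or.inr (Sym2.mem_mk_right x v)) 0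
    have haD : ((Function.update (Function.update (Function.update (Function.update w s(u, v) 0) f s) s(u, x) 0) s(x, v) 0
        s(u, x) : unitInterval) : ℝ) = 0 := by rw [Function.update_of_ne hab]; simp
    have hbD : ((Function.update (Function.update (Function.update (Function.update w s(u, v) 0) f s) s(u, x) 0) s(x, v) 0
        s(x, v) : unitInterval) : ℝ) = 0 := by simp
    -- under `D_s`, `K` a.s. iff `u ↔ v`
    have hKD : ∑ ω : BondConfig V, rcWeightW (Function.update (Function.update (Function.update (Function.update w s(u, v) 0)
        f s) s(u, x) 0) s(x, v) 0) q ∅ ω * ind K ω =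
        ∑ ω : BondConfig V, rcWeightW (Function.update (Function.update (Function.update (Function.update w s(u, v) 0)
          f s) s(u, x) 0) s(x, v) 0) q ∅ ω * ind (openConn u v : Set (BondConfig V)) ω := by
      refine sum_rcWeightW_ind_congr_ae _ q fun ω hω => ?_
      have hapex := apex_of_rcWeightW_ne_zero _ q hxu hxv hwD hω
      have ha : s(u, x) ∉ ω := not_mem_of_rcWeightW_ne_zero _ q haD hω
      rw [hK, Set.mem_setOf_eq, mem_openConn_iff', mem_openConn_iff', reachable_uv_apex_iff hxu hxv hapex]
      simp only [ha, false_and, or_false]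
    rw [hcomm] at hKD
    -- split `u ↔ v` along `K`
    have hsplit := sum_rcWeightW_ind_inter_compl (Function.update (Function.update w s(u, v) 0) f s) q
      (openConn u v : Set (BondConfig V)) K
    have hinK : ∑ ω : BondConfig V, rcWeightW (Function.update (Function.update w s(u, v) 0) f s) q ∅ ω *
        ind ((openConn u v : Set (BondConfig V)) ∩ K) ω =
        ∑ ω : BondConfig V, rcWeightW (Function.update (Function.update w s(u, v) 0) f s) q ∅ ω * ind K ω := by
      refine sum_rcWeightW_ind_congr_ae _ q fun ω hω => ?_
      have hapex := apex_of_rcWeightW_ne_zero _ q hxu hxv hwC hω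
      rw [Set.mem_inter_iff, mem_openConn_iff', reachable_uv_apex_iff hxu hxv hapex, hK, Set.mem_setOf_eq, mem_openConn_iff']
      constructor
      · exact fun h => h.2
      · exact fun h => ⟨Or.inl h, h⟩
    have hoffK : ∑ ω : BondConfig V, rcWeightW (Function.update (Function.update w s(u, v) 0) f s) q ∅ ω *
        ind ((openConn u v : Set (BondConfig V)) ∩ Kᶜ) ω =
        ∑ ω : BondConfig V, rcWeightW (Function.update (Function.update w s(u, v) 0) f s) q ∅ ω *
          ind ({ω | s(u, x) ∈ ω} ∩ ({ω | s(x, v) ∈ ω} ∩ Kᶜ)) ω := by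
      refine sum_rcWeightW_ind_congr_ae _ q fun ω hω => ?_
      have hapex := apex_of_rcWeightW_ne_zero _ q hxu hxv hwC hω
      rw [Set.mem_inter_iff, mem_openConn_iff', reachable_uv_apex_iff hxu hxv hapex, Set.mem_inter_iff, Set.mem_inter_iff,
        Set.mem_compl_iff, hK, Set.mem_setOf_eq, mem_openConn_iff', Set.mem_setOf_eq, Set.mem_setOf_eq]
      tauto
    -- the apex identities in the state `C_s`
    have hA1 := apex_mass (Function.update (Function.update w s(u, v) 0) f s) hq0.ne' hxu hxv huv hwC K hKa hKb
    have hA3 := apex_mass_ab_inter (Function.update (Function.update w s(u, v) 0) f s) hq0.ne' hxu hxv huv hwC Kᶜ hKca hKcb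
    have hAZ := apex_mass (Function.update (Function.update w s(u, v) 0) f s) hq0.ne' hxu hxv huv hwC Set.univ hUa hUb
    rw [haC, hbC, hcomm] at hA1 hA3 hAZ
    rw [Set.inter_self] at hA1
    rw [← Set.compl_union, Set.union_self, sum_rcWeightW_ind_compl, hKD] at hA3
    rw [Set.univ_inter, sum_rcWeightW_ind_univ, sum_rcWeightW_ind_univ, hKD] at hAZ
    rw [hKD] at hA1
    constructor
    · have h := hsplit
      rw [hinK, hoffK, hA1, hA3] at h
      linarith [h]
    · exact hAZ
  obtain ⟨k0, z0⟩ := key 0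
  obtain ⟨k1, z1⟩ := key 1
  rw [k0, z0, k1, z1]
  -- positivity bookkeeping
  set p₁ : ℝ := ((w s(u, x) : unitInterval) : ℝ) with hp₁
  set p₂ : ℝ := ((w s(x, v) : unitInterval) : ℝ) with hp₂
  set r : ℝ := q⁻¹ with hr
  set S0 := ∑ ω : BondConfig V, rcWeightW (Function.update (Function.update (Function.update (Function.update w s(u, x) 0)
    s(x, v) 0) s(u, v) 0) f 0) q ∅ ω * ind (openConn u v : Set (BondConfig V)) ω
  set S1 := ∑ ω : BondConfig V, rcWeightW (Function.update (Function.update (Function.update (Function.update w s(u, x) 0)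
    s(x, v) 0) s(u, v) 0) f 1) q ∅ ω * ind (openConn u v : Set (BondConfig V)) ω
  set Z0 := rcPartitionFunctionW (Function.update (Function.update (Function.update (Function.update w s(u, x) 0)
    s(x, v) 0) s(u, v) 0) f 0) q ∅
  set Z1 := rcPartitionFunctionW (Function.update (Function.update (Function.update (Function.update w s(u, x) 0)
    s(x, v) 0) s(u, v) 0) f 1) q ∅
  have hp₁0 : 0 ≤ p₁ := (w s(u, x)).2.1
  have hp₁1 : p₁ ≤ 1 := (w s(u, x)).2.2
  have hp₂0 : 0 ≤ p₂ := (w s(x, v)).2.1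
  have hp₂1 : p₂ ≤ 1 := (w s(x, v)).2.2
  have hr0 : 0 ≤ r := inv_nonneg.2 hq0.le
  have hα : 0 ≤ (1 - p₁) * (1 - p₂) + (p₁ + p₂ * (1 - p₁)) * r := by
    have h1 : 0 ≤ 1 - p₁ := by linarith
    have h2 : 0 ≤ 1 - p₂ := by linarith
    positivity
  have hδ : 0 ≤ (1 - p₁) * (1 - p₂) + ((1 - p₁) * p₂ + p₁ * (1 - p₂)) * r := by
    have h1 : 0 ≤ 1 - p₁ := by linarith
    have h2 : 0 ≤ 1 - p₂ := by linarith
    positivity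
  have hk : 0 ≤ S1 * Z0 - S0 * Z1 := sub_nonneg.2 hEC
  have hid : (((1 - p₁ + p₁ * r) * (1 - p₂ + p₂ * r) - p₁ * p₂ * r * (r - 1)) * S1 + p₁ * p₂ * (r * r) * (Z1 - S1)) *
        ((1 - p₁ + p₁ * r) * (1 - p₂ + p₂ * r) * Z0 - p₁ * p₂ * r * (r - 1) * S0) -
      (((1 - p₁ + p₁ * r) * (1 - p₂ + p₂ * r) - p₁ * p₂ * r * (r - 1)) * S0 + p₁ * p₂ * (r * r) * (Z0 - S0)) *
        ((1 - p₁ + p₁ * r) * (1 - p₂ + p₂ * r) * Z1 - p₁ * p₂ * r * (r - 1) * S1) =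
      ((1 - p₁) * (1 - p₂) + (p₁ + p₂ * (1 - p₁)) * r) * ((1 - p₁) * (1 - p₂) + ((1 - p₁) * p₂ + p₁ * (1 - p₂)) * r) *
        (S1 * Z0 - S0 * Z1) := by ring
  have hprod := mul_nonneg (mul_nonneg hα hδ) hk
  linarith [hid, hprod]

end FK

end Literature.Probability.LatticeModels.RandomClusterRayleigh

end Part9

/-!
## Part 10 — port of `Summits/CriticalPhenomena/PercolationContinuityZ3/Theorems/Transplant/FKConnectivityAllQApexStep.lean` (5 declarations kept)

# Connectivity correlation inequalities for `φ_{w,q}`, every `q > 0` — file 9d: apex elimination, MARGINALISATION AND THE STEP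
# (pairs off the apex; the base case; the apex step of the induction)

Verbatim declaration-level port (the declarations listed in the Part header count) of a helper module of the
PercolationContinuityZ3 tree (FK sub-lane); route bookkeeping of the source docstring is not reproduced.

THE ARGUMENT (files `…ApexTools`, `…ApexMass`, `…ApexCases`, `…ApexStep`, `…TwoTree`).  Wagner (Ann. Comb. 2008, Ex. 5.1 +
Thm. 5.8(d) + §5.3) proves that the random-cluster (Potts) model with `0 < q ≤ 1` is Rayleigh — edge-negatively associated,
`φ(J_e ∩ J_f) ≤ φ(J_e)φ(J_f)` (Grimmett 2006 §3.9 (3.94)) — on every series–parallel graph, by induction over two-sums.  We prove the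
graph case by APEX ELIMINATION over 2-trees (whose subgraphs are exactly the series–parallel = `K₄`-minor-free graphs): a 2-tree
is `{uv}` or `T ∪ {ux, xv}` with `uv ∈ T` and `x` fresh; for a weight vector `w` supported in `T ∪ {ux, xv}` write `a = ux`,
`b = xv`, `g = uv`, `w° = w[a↦0][b↦0]` and `K' = {u ↔ v avoiding a, b}`.  Three exact identities for events `F` insensitive to
`a, b` (file `…ApexMass`): `S_w(F) = ((1−p_a)+p_a q⁻¹)((1−p_b)+p_b q⁻¹)·S°(F) − p_a p_b q⁻¹(q⁻¹−1)·S°(F ∩ K')`,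
`S_w(J_b ∩ F ∩ K') = p_b q⁻¹·S°(F ∩ K')`, `S_w(J_a ∩ J_b ∩ F) = p_a p_b (q⁻¹ S°(F) + (q⁻¹−1)q⁻¹ S°(F ∩ K'ᶜ))`.  With fk-2's
master identity (`negCorr_defect_eq`: `Cov(J_e, J_f) ≤ 0 ⟺` opening `f` does not lower `φ_{w[e↦0]}(x ↔ y)`, `e = xy`) every pair
reduces to EC⁺ for `u ↔ v` one level down, i.e. to negative association on `T` (file `…ApexCases`): `(a, f)`:
`φ_{w[a↦0][f↦s]}(u ↔ x) = θ·φ_{w°[f↦s]}(u ↔ v)`; `(g, f)`: `φ_{w[g↦0][f↦s]}(u ↔ v)` is an increasing Möbius function of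
`φ_{w°[g↦0][f↦s]}(u ↔ v)`; `(a, b)`, `(a, g)`: unconditional; and pairs `e, f ⊆ T ∖ g` are MARGINALISED (file `…ApexStep`):
`S_w(E) = α·S_{w°[g↦c]}(E)` for `E ∈ {J_e ∩ J_f, J_e, J_f, Ω}` with `α = (1−p_a)(1−p_b) + (p_a+p_b−p_ap_b)q⁻¹` and
`α c = α p_g + (1−p_g)p_a p_b q⁻¹` (the path `u–x–v` is a pair `uv` in parallel with `g`).

THIS FILE: `apex_marginal` (`S_w(E) = α·S_{w°[g↦c]}(E)` for `E` insensitive to `a, b, g`), `negCorr_off_apex`, the base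
`edgeNegCorr_supp_pair` and the step `edgeNegCorr_supp_apex_step`: negative association for all weight vectors supported in a
loopless `T ∋ uv` (`0 < q < 1`) implies it for all weight vectors supported in `T ∪ {ux, xv}`, `x` fresh.  The induction over
2-trees is run in `…AllQTwoTree.lean` (which carries the definition of a 2-tree).
[cite: Wagner2006, Ex. 5.1, Thm. 5.8(d), §5.3] [cite: Grimmett2006, §3.9 eq. (3.94) (pp. 63–64); Thm. (3.1)(a) (p. 37)]
-/

section Part10

namespace Literature.Probability.LatticeModels.RandomClusterRayleigh

namespace FK

open _root_.MeasureTheory _root_.Set Literature.Probability.LatticeModels Literature.Probability.Percolation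
open Literature.Probability.Percolation.DecisionTree (ind ind_of_mem ind_of_not_mem ind_nonneg)
open Literature.Probability.Percolation.TwoAvoidanceSets (ind_mul_ind)
open scoped _root_.Classical symmDiff

variable {V : Type*} [Fintype V]

/-! ### Case (r): pairs off the apex and off the base pair — marginalising the apex -/

/-- **Marginalising the apex**: for an event `E` insensitive to the apex pairs and to the base pair `g = s(u,v)`,
`S_w(E) = α·S_{w°[g↦c]}(E)`, where `α = (1 − w a)(1 − w b) + (w a + w b − (w a)(w b))q⁻¹` and the new parameter `c` of `g`
solves `α·c = α·(w g) + (1 − w g)(w a)(w b)q⁻¹` (the path `u – x – v` acts on the rest of the graph as an extra pair `uv` in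
parallel with `g`). [cite: Grimmett2006, Thm. (3.1)(a) (p. 37); §1.4 eq. (1.20) (p. 15)] -/
theorem apex_marginal (w : Sym2 V → unitInterval) {q : ℝ} (hq : q ≠ 0) {u v x : V} (hxu : x ≠ u) (hxv : x ≠ v)
    (huv : u ≠ v) (hw : ∀ e : Sym2 V, x ∈ e → ((w e : unitInterval) : ℝ) ≠ 0 → u ∈ e ∨ v ∈ e)
    (E : Set (BondConfig V)) (hEa : ∀ ω : BondConfig V, ω ∆ {s(u, x)} ∈ E ↔ ω ∈ E)
    (hEb : ∀ ω : BondConfig V, ω ∆ {s(x, v)} ∈ E ↔ ω ∈ E) (hEg : ∀ ω : BondConfig V, ω ∆ {s(u, v)} ∈ E ↔ ω ∈ E)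
    (c : unitInterval)
    (hc : ((1 - ((w s(u, x) : unitInterval) : ℝ)) * (1 - ((w s(x, v) : unitInterval) : ℝ)) +
        (((w s(u, x) : unitInterval) : ℝ) + ((w s(x, v) : unitInterval) : ℝ) -
          ((w s(u, x) : unitInterval) : ℝ) * ((w s(x, v) : unitInterval) : ℝ)) * q⁻¹) * (c : ℝ) =
      ((1 - ((w s(u, x) : unitInterval) : ℝ)) * (1 - ((w s(x, v) : unitInterval) : ℝ)) +
        (((w s(u, x) : unitInterval) : ℝ) + ((w s(x, v) : unitInterval) : ℝ) -
          ((w s(u, x) : unitInterval) : ℝ) * ((w s(x, v) : unitInterval) : ℝ)) * q⁻¹) * ((w s(u, v) : unitInterval) : ℝ) +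
        (1 - ((w s(u, v) : unitInterval) : ℝ)) * ((w s(u, x) : unitInterval) : ℝ) * ((w s(x, v) : unitInterval) : ℝ) * q⁻¹) :
    ∑ ω : BondConfig V, rcWeightW w q ∅ ω * ind E ω =
      ((1 - ((w s(u, x) : unitInterval) : ℝ)) * (1 - ((w s(x, v) : unitInterval) : ℝ)) +
        (((w s(u, x) : unitInterval) : ℝ) + ((w s(x, v) : unitInterval) : ℝ) -
          ((w s(u, x) : unitInterval) : ℝ) * ((w s(x, v) : unitInterval) : ℝ)) * q⁻¹) *
        ∑ ω : BondConfig V, rcWeightW (Function.update (Function.update (Function.update w s(u, x) 0) s(x, v) 0) s(u, v) c)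
          q ∅ ω * ind E ω := by
  have hab := apex_pairs_ne hxu huv
  have hgx : x ∉ s(u, v) := by
    rw [Sym2.mem_iff]; rintro (h | h); exacts [hxu h, hxv h]
  have hga : s(u, v) ≠ s(u, x) := fun h => hgx (h ▸ Sym2.mem_mk_right u x)
  have hgb : s(u, v) ≠ s(x, v) := fun h => hgx (h ▸ Sym2.mem_mk_left x v)
  set K : Set (BondConfig V) := {ω : BondConfig V | ω \ {s(u, x), s(x, v)} ∈ (openConn u v : Set (BondConfig V))} with hK
  -- the apex identity
  have hA1 := apex_mass w hq hxu hxv huv hw E hEa hEb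
  -- notation for the apex-deleted vector `w°` and the states `D_t = w°[g↦t]`
  set w0 := Function.update (Function.update w s(u, x) 0) s(x, v) 0 with hw0def
  have hw0 : ∀ e : Sym2 V, x ∈ e → ((w0 e : unitInterval) : ℝ) ≠ 0 → u ∈ e ∨ v ∈ e :=
    apex_hyp_update (apex_hyp_update hw s(u, x) (fun _ => Or.inl (Sym2.mem_mk_left u x)) 0) s(x, v)
      (fun _ => Or.inr (Sym2.mem_mk_right x v)) 0
  have hg0 : ((w0 s(u, v) : unitInterval) : ℝ) = ((w s(u, v) : unitInterval) : ℝ) := by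
    rw [hw0def, Function.update_of_ne hgb, Function.update_of_ne hga]
  have hwD : ∀ t : unitInterval, ∀ e : Sym2 V, x ∈ e → ((Function.update w0 s(u, v) t e : unitInterval) : ℝ) ≠ 0 → u ∈ e ∨ v ∈ e :=
    fun t => apex_hyp_update hw0 s(u, v) (fun h => absurd h hgx) t
  have haD : ∀ t : unitInterval, ((Function.update w0 s(u, v) t s(u, x) : unitInterval) : ℝ) = 0 := by
    intro t; rw [Function.update_of_ne hga.symm, hw0def, Function.update_of_ne hab]; simp
  have hbD : ∀ t : unitInterval, ((Function.update w0 s(u, v) t s(x, v) : unitInterval) : ℝ) = 0 := by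
    intro t; rw [Function.update_of_ne hgb.symm, hw0def]; simp
  -- expansions at `g`
  have e2 := sum_rcWeightW_ind_affine w0 q s(u, v) E
  have e3 := sum_rcWeightW_ind_affine w0 q s(u, v) (E ∩ K)
  have e6 := sum_rcWeightW_update_one_eq_toggle w0 hq u v E hEg
  have e7 := sum_rcWeightW_ind_inter_compl (Function.update w0 s(u, v) 0) q E (openConn u v : Set (BondConfig V))
  -- under `D_1`, `g` is a.s. open, so `K` holds a.s.
  have e4 : ∑ ω : BondConfig V, rcWeightW (Function.update w0 s(u, v) 1) q ∅ ω * ind (E ∩ K) ω =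
      ∑ ω : BondConfig V, rcWeightW (Function.update w0 s(u, v) 1) q ∅ ω * ind E ω := by
    refine sum_rcWeightW_ind_congr_ae _ q fun ω hω => ?_
    have hg : s(u, v) ∈ ω := mem_of_rcWeightW_ne_zero _ q (by simp) hω
    have hgK : ω ∈ K := by
      rw [hK, Set.mem_setOf_eq, mem_openConn_iff']
      have hmem : s(u, v) ∈ ω \ {s(u, x), s(x, v)} := by
        refine ⟨hg, ?_⟩
        rintro (h | h)
        · exact hga h
        · exact hgb h
      have hadj : (openGraph (ω \ {s(u, x), s(x, v)})).Adj u v := by rw [openGraph_adj]; exact ⟨hmem, huv⟩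
      exact hadj.reachable
    exact ⟨fun h => h.1, fun h => ⟨h, hgK⟩⟩
  -- under `D_0`, `x` is a.s. isolated, so `K` iff `u ↔ v`
  have e5 : ∑ ω : BondConfig V, rcWeightW (Function.update w0 s(u, v) 0) q ∅ ω * ind (E ∩ K) ω =
      ∑ ω : BondConfig V, rcWeightW (Function.update w0 s(u, v) 0) q ∅ ω * ind (E ∩ (openConn u v : Set (BondConfig V))) ω := by
    refine sum_rcWeightW_ind_congr_ae _ q fun ω hω => ?_
    have hapex := apex_of_rcWeightW_ne_zero _ q hxu hxv (hwD 0) hω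
    have ha : s(u, x) ∉ ω := not_mem_of_rcWeightW_ne_zero _ q (haD 0) hω
    rw [Set.mem_inter_iff, Set.mem_inter_iff, hK, Set.mem_setOf_eq, mem_openConn_iff', mem_openConn_iff',
      reachable_uv_apex_iff hxu hxv hapex]
    simp only [ha, false_and, or_false]
  -- the marginal vector `w°[g↦c]` expanded at `g`
  have e8 := sum_rcWeightW_ind_affine (Function.update w0 s(u, v) c) q s(u, v) E
  rw [Function.update_idem, Function.update_idem] at e8
  simp only [Function.update_self] at e8
  rw [hg0] at e2 e3
  rw [hA1, e8, e2, e3, e4, e5, e6, e7]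
  linear_combination (-((q⁻¹ - 1) *
    (∑ ω : BondConfig V, rcWeightW (Function.update w0 s(u, v) 0) q ∅ ω * ind E ω -
      ∑ ω : BondConfig V, rcWeightW (Function.update w0 s(u, v) 0) q ∅ ω * ind (E ∩ (openConn u v : Set (BondConfig V))) ω))) * hc

/-- **Two pairs off the apex and off the base pair are negatively associated under `φ_w` as soon as they are under the marginal
vector `w°[g↦c]`** (for every `c`; only the solution of `α c = α (w g) + (1 − w g)(w a)(w b)q⁻¹` is used).
[cite: Grimmett2006, §3.9 eq. (3.94) (p. 63); Thm. (3.1)(a) (p. 37)] -/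
theorem negCorr_off_apex {q : ℝ} (hq0 : 0 < q) (hq1 : q ≤ 1) (w : Sym2 V → unitInterval) {u v x : V} (hxu : x ≠ u)
    (hxv : x ≠ v) (huv : u ≠ v) (hw : ∀ e : Sym2 V, x ∈ e → ((w e : unitInterval) : ℝ) ≠ 0 → u ∈ e ∨ v ∈ e)
    {e f : Sym2 V} (hex : x ∉ e) (hfx : x ∉ f) (heg : e ≠ s(u, v)) (hfg : f ≠ s(u, v))
    (hNC : ∀ c : unitInterval,
      (rcMeasureW (Function.update (Function.update (Function.update w s(u, x) 0) s(x, v) 0) s(u, v) c) q ∅).real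
          ({ω | e ∈ ω} ∩ {ω | f ∈ ω}) ≤
        (rcMeasureW (Function.update (Function.update (Function.update w s(u, x) 0) s(x, v) 0) s(u, v) c) q ∅).real
            {ω | e ∈ ω} *
          (rcMeasureW (Function.update (Function.update (Function.update w s(u, x) 0) s(x, v) 0) s(u, v) c) q ∅).real
            {ω | f ∈ ω}) :
    (rcMeasureW w q ∅).real ({ω | e ∈ ω} ∩ {ω | f ∈ ω}) ≤
      (rcMeasureW w q ∅).real {ω | e ∈ ω} * (rcMeasureW w q ∅).real {ω | f ∈ ω} := by
  have hea : e ≠ s(u, x) := fun h => hex (h ▸ Sym2.mem_mk_right u x)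
  have heb : e ≠ s(x, v) := fun h => hex (h ▸ Sym2.mem_mk_left x v)
  have hfa : f ≠ s(u, x) := fun h => hfx (h ▸ Sym2.mem_mk_right u x)
  have hfb : f ≠ s(x, v) := fun h => hfx (h ▸ Sym2.mem_mk_left x v)
  -- the parameters
  set p₁ : ℝ := ((w s(u, x) : unitInterval) : ℝ) with hp₁
  set p₂ : ℝ := ((w s(x, v) : unitInterval) : ℝ) with hp₂
  set p₀ : ℝ := ((w s(u, v) : unitInterval) : ℝ) with hp₀
  have hp₁0 : 0 ≤ p₁ := (w s(u, x)).2.1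
  have hp₁1 : p₁ ≤ 1 := (w s(u, x)).2.2
  have hp₂0 : 0 ≤ p₂ := (w s(x, v)).2.1
  have hp₂1 : p₂ ≤ 1 := (w s(x, v)).2.2
  have hp₀0 : 0 ≤ p₀ := (w s(u, v)).2.1
  have hp₀1 : p₀ ≤ 1 := (w s(u, v)).2.2
  have hr1 : 1 ≤ q⁻¹ := one_le_inv_iff₀.2 ⟨hq0, hq1⟩
  set α : ℝ := (1 - p₁) * (1 - p₂) + (p₁ + p₂ - p₁ * p₂) * q⁻¹ with hα
  have hα1 : 1 ≤ α := by
    have h1 : 0 ≤ p₁ + p₂ - p₁ * p₂ := by nlinarith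
    have h2 : 0 ≤ (p₁ + p₂ - p₁ * p₂) * (q⁻¹ - 1) := mul_nonneg h1 (by linarith)
    have h3 : α = 1 + (p₁ + p₂ - p₁ * p₂) * (q⁻¹ - 1) := by rw [hα]; ring
    linarith
  have hαpos : 0 < α := by linarith
  have hnum0 : 0 ≤ (1 - p₀) * p₁ * p₂ * q⁻¹ := by
    have : 0 ≤ 1 - p₀ := by linarith
    have : 0 ≤ q⁻¹ := by linarith
    positivity
  have hnum1 : (1 - p₀) * p₁ * p₂ * q⁻¹ ≤ (1 - p₀) * α := by
    have h1 : p₁ * p₂ * q⁻¹ ≤ α := by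
      have h2 : α - p₁ * p₂ * q⁻¹ = (1 - p₁) * (1 - p₂) + ((1 - p₁) * p₂ + p₁ * (1 - p₂)) * q⁻¹ := by rw [hα]; ring
      have h3 : 0 ≤ (1 - p₁) * (1 - p₂) + ((1 - p₁) * p₂ + p₁ * (1 - p₂)) * q⁻¹ := by
        have : 0 ≤ 1 - p₁ := by linarith
        have : 0 ≤ 1 - p₂ := by linarith
        have : 0 ≤ q⁻¹ := by linarith
        positivity
      linarith
    have h0 : 0 ≤ 1 - p₀ := by linarith
    nlinarith [mul_le_mul_of_nonneg_left h1 h0]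
  set pr : ℝ := p₀ + (1 - p₀) * p₁ * p₂ * q⁻¹ / α with hpr
  have hpr0 : 0 ≤ pr := by rw [hpr]; positivity
  have hpr1 : pr ≤ 1 := by
    rw [hpr]
    have : (1 - p₀) * p₁ * p₂ * q⁻¹ / α ≤ 1 - p₀ := by
      rw [div_le_iff₀ hαpos]; exact hnum1
    linarith
  set c : unitInterval := ⟨pr, hpr0, hpr1⟩ with hcdef
  have hc : α * (c : ℝ) = α * p₀ + (1 - p₀) * p₁ * p₂ * q⁻¹ := by
    change α * pr = _
    rw [hpr, mul_add, mul_div_assoc', mul_div_cancel_left₀ _ hαpos.ne']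
  -- the marginal identities for the four events
  have hJe : ∀ g : Sym2 V, g ≠ e → ∀ ω : BondConfig V, ω ∆ {g} ∈ {ω : BondConfig V | e ∈ ω} ↔ ω ∈ {ω : BondConfig V | e ∈ ω} :=
    fun g hg ω => mem_symmDiff_singleton_of_ne ω hg.symm
  have hJf : ∀ g : Sym2 V, g ≠ f → ∀ ω : BondConfig V, ω ∆ {g} ∈ {ω : BondConfig V | f ∈ ω} ↔ ω ∈ {ω : BondConfig V | f ∈ ω} :=
    fun g hg ω => mem_symmDiff_singleton_of_ne ω hg.symm
  have hU : ∀ g : Sym2 V, ∀ ω : BondConfig V, ω ∆ {g} ∈ (Set.univ : Set (BondConfig V)) ↔ ω ∈ (Set.univ : Set (BondConfig V)) :=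
    fun g ω => by simp
  have m1 := apex_marginal w hq0.ne' hxu hxv huv hw ({ω | e ∈ ω} ∩ {ω | f ∈ ω})
    (inter_insens (hJe _ hea.symm) (hJf _ hfa.symm)) (inter_insens (hJe _ heb.symm) (hJf _ hfb.symm))
    (inter_insens (hJe _ heg.symm) (hJf _ hfg.symm)) c hc
  have m2 := apex_marginal w hq0.ne' hxu hxv huv hw {ω | e ∈ ω} (hJe _ hea.symm) (hJe _ heb.symm) (hJe _ heg.symm) c hc
  have m3 := apex_marginal w hq0.ne' hxu hxv huv hw {ω | f ∈ ω} (hJf _ hfa.symm) (hJf _ hfb.symm) (hJf _ hfg.symm) c hc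
  have m4 := apex_marginal w hq0.ne' hxu hxv huv hw Set.univ (hU _) (hU _) (hU _) c hc
  rw [sum_rcWeightW_ind_univ, sum_rcWeightW_ind_univ] at m4
  -- transfer
  have h := (negCorr_real_iff_mass hq0 _ e f).1 (hNC c)
  rw [negCorr_real_iff_mass hq0, m1, m2, m3, m4]
  have hα0 : 0 ≤ α * α := mul_nonneg hαpos.le hαpos.le
  calc α * (∑ ω : BondConfig V, rcWeightW (Function.update (Function.update (Function.update w s(u, x) 0) s(x, v) 0)
          s(u, v) c) q ∅ ω * ind ({ω | e ∈ ω} ∩ {ω | f ∈ ω}) ω) *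
        (α * rcPartitionFunctionW (Function.update (Function.update (Function.update w s(u, x) 0) s(x, v) 0) s(u, v) c) q ∅)
      = α * α * ((∑ ω : BondConfig V, rcWeightW (Function.update (Function.update (Function.update w s(u, x) 0) s(x, v) 0)
          s(u, v) c) q ∅ ω * ind ({ω | e ∈ ω} ∩ {ω | f ∈ ω}) ω) *
          rcPartitionFunctionW (Function.update (Function.update (Function.update w s(u, x) 0) s(x, v) 0) s(u, v) c) q ∅) := by
        ring
    _ ≤ α * α * ((∑ ω : BondConfig V, rcWeightW (Function.update (Function.update (Function.update w s(u, x) 0) s(x, v) 0)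
          s(u, v) c) q ∅ ω * ind {ω | e ∈ ω} ω) *
          ∑ ω : BondConfig V, rcWeightW (Function.update (Function.update (Function.update w s(u, x) 0) s(x, v) 0)
            s(u, v) c) q ∅ ω * ind {ω | f ∈ ω} ω) := mul_le_mul_of_nonneg_left h hα0
    _ = _ := by ring

/-! ### The induction: base pair and apex step -/

/-- **Base**: on a single pair `{uv}` every two distinct pairs are negatively associated (one of them is dead).
[cite: Grimmett2006, §3.9 eq. (3.94) (p. 63)] -/
theorem edgeNegCorr_supp_pair {q : ℝ} (hq0 : 0 < q) (g : Sym2 V) :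
    ∀ w : Sym2 V → unitInterval, (∀ e, ((w e : unitInterval) : ℝ) ≠ 0 → e ∈ ({g} : Set (Sym2 V))) →
      ∀ e f : Sym2 V, ¬ e.IsDiag → f ≠ e →
        (rcMeasureW w q ∅).real ({ω | e ∈ ω} ∩ {ω | f ∈ ω}) ≤
          (rcMeasureW w q ∅).real {ω | e ∈ ω} * (rcMeasureW w q ∅).real {ω | f ∈ ω} := by
  intro w hw e f _ hfe
  by_cases he : ((w e : unitInterval) : ℝ) = 0
  · exact negCorr_of_weight_zero_left hq0 w f he
  by_cases hf : ((w f : unitInterval) : ℝ) = 0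
  · exact negCorr_of_weight_zero_right hq0 w e hf
  have h1 : e = g := hw e he
  have h2 : f = g := hw f hf
  exact absurd (h2.trans h1.symm) hfe

omit [Fintype V] in
/-- The support of the apex-deleted vector lies in `T`. [cite: Grimmett2006, §3.9 eq. (3.94) (p. 63)] -/
theorem supp_apex_deleted {w : Sym2 V → unitInterval} {T : Set (Sym2 V)} {a b : Sym2 V}
    (hw : ∀ e, ((w e : unitInterval) : ℝ) ≠ 0 → e ∈ T ∪ {a, b}) :
    ∀ e, ((Function.update (Function.update w a 0) b 0 e : unitInterval) : ℝ) ≠ 0 → e ∈ T := by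
  intro e he
  by_cases heb : e = b
  · subst heb; simp at he
  rw [Function.update_of_ne heb] at he
  by_cases hea : e = a
  · subst hea; simp at he
  rw [Function.update_of_ne hea] at he
  rcases hw e he with h | h
  · exact h
  · rcases h with h | h
    · exact absurd h hea
    · exact absurd h heb

/-- **Apex step**: if every weight vector supported in the loopless edge set `T ∋ uv` is edge-negatively associated
(`0 < q < 1`) and `x` is not covered by `T`, then so is every weight vector supported in `T ∪ {ux, xv}`.
[cite: Wagner2006, Thm. 5.8(d), §5.3] [cite: Grimmett2006, §3.9 eq. (3.94) (p. 63)] -/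
theorem edgeNegCorr_supp_apex_step {q : ℝ} (hq0 : 0 < q) (hq1 : q < 1) {T : Set (Sym2 V)} {u v x : V}
    (hTl : ∀ e ∈ T, ¬ e.IsDiag) (huvT : s(u, v) ∈ T) (hx : ∀ e ∈ T, x ∉ e)
    (hNC : ∀ w' : Sym2 V → unitInterval, (∀ e, ((w' e : unitInterval) : ℝ) ≠ 0 → e ∈ T) → ∀ e f : Sym2 V, ¬ e.IsDiag → f ≠ e →
      (rcMeasureW w' q ∅).real ({ω | e ∈ ω} ∩ {ω | f ∈ ω}) ≤ (rcMeasureW w' q ∅).real {ω | e ∈ ω} * (rcMeasureW w' q ∅).real {ω | f ∈ ω}) :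
    ∀ w : Sym2 V → unitInterval, (∀ e, ((w e : unitInterval) : ℝ) ≠ 0 → e ∈ T ∪ {s(u, x), s(x, v)}) →
      ∀ e f : Sym2 V, ¬ e.IsDiag → f ≠ e →
        (rcMeasureW w q ∅).real ({ω | e ∈ ω} ∩ {ω | f ∈ ω}) ≤
          (rcMeasureW w q ∅).real {ω | e ∈ ω} * (rcMeasureW w q ∅).real {ω | f ∈ ω} := by
  intro w hw e f hediag hfe
  have huv : u ≠ v := fun h => hTl _ huvT (by rw [Sym2.mk_isDiag_iff]; exact h)
  have hxu : x ≠ u := fun h => hx _ huvT (by rw [h]; exact Sym2.mem_mk_left u v)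
  have hxv : x ≠ v := fun h => hx _ huvT (by rw [h]; exact Sym2.mem_mk_right u v)
  have hab := apex_pairs_ne hxu huv
  have hgx : x ∉ s(u, v) := hx _ huvT
  -- the apex hypothesis for `w`
  have hapex : ∀ e' : Sym2 V, x ∈ e' → ((w e' : unitInterval) : ℝ) ≠ 0 → u ∈ e' ∨ v ∈ e' := by
    intro e' hxe' hne
    rcases hw e' hne with h | h
    · exact absurd hxe' (hx e' h)
    · rcases h with rfl | rfl
      · exact Or.inl (Sym2.mem_mk_left u x)
      · exact Or.inr (Sym2.mem_mk_right x v)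
  -- the apex-deleted vector and its support
  set w0 := Function.update (Function.update w s(u, x) 0) s(x, v) 0 with hw0def
  have hsupp0 : ∀ e', ((w0 e' : unitInterval) : ℝ) ≠ 0 → e' ∈ T := supp_apex_deleted hw
  -- EC⁺ inputs one level down
  have hECf : ∀ {f' : Sym2 V}, f' ∈ T →
      (rcMeasureW (Function.update w0 f' 0) q ∅).real (openConn u v) ≤ (rcMeasureW (Function.update w0 f' 1) q ∅).real (openConn u v) := by
    intro f' hf'T
    by_cases hfg' : f' = s(u, v)
    · rw [hfg']; exact edgeConnMono_self hq0 w0 u v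
    · exact edgeConnMono_of_negCorr_supp hq0 hq1 hNC huvT hf'T w0 hsupp0
  -- the apex pairs against anything
  have apex_case : ∀ e' f' : Sym2 V, (e' = s(u, x) ∨ e' = s(x, v)) → f' ≠ e' → ((w f' : unitInterval) : ℝ) ≠ 0 →
      (rcMeasureW w q ∅).real ({ω | e' ∈ ω} ∩ {ω | f' ∈ ω}) ≤
        (rcMeasureW w q ∅).real {ω | e' ∈ ω} * (rcMeasureW w q ∅).real {ω | f' ∈ ω} := by
    intro e' f' he' hfe' hf'0
    -- where is `f'`?
    have hf'cases : f' ∈ T ∨ f' = s(u, x) ∨ f' = s(x, v) := by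
      rcases hw f' hf'0 with h | h
      · exact Or.inl h
      · rcases h with h | h
        · exact Or.inr (Or.inl h)
        · exact Or.inr (Or.inr h)
    rcases he' with rfl | rfl
    · -- `e' = a`
      rcases hf'cases with hf'T | rfl | rfl
      · exact negCorr_apex_pair hq0 hq1.le w hxu hxv huv hapex (hx f' hf'T) (hECf hf'T)
      · exact absurd rfl hfe'
      · exact negCorr_apex_ab hq0 hq1.le w hxu hxv huv hapex
    · -- `e' = b`: use the mirror apex `(v, u, x)`
      have hapex' : ∀ e'' : Sym2 V, x ∈ e'' → ((w e'' : unitInterval) : ℝ) ≠ 0 → v ∈ e'' ∨ u ∈ e'' :=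
        fun e'' h1 h2 => (hapex e'' h1 h2).symm
      have hswap : Function.update (Function.update w s(v, x) 0) s(x, u) 0 = w0 := by
        rw [hw0def, Sym2.eq_swap (a := v), Sym2.eq_swap (a := x) (b := u), Function.update_comm hab.symm]
      have hb : s(x, v) = s(v, x) := Sym2.eq_swap
      rw [hb]
      rcases hf'cases with hf'T | rfl | rfl
      · refine negCorr_apex_pair hq0 hq1.le w hxv hxu huv.symm hapex' (hx f' hf'T) ?_
        rw [hswap]
        have h := hECf hf'T
        rwa [openConn_comm] at h
      · have ha : s(u, x) = s(x, u) := Sym2.eq_swap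
        rw [ha]
        exact negCorr_apex_ab hq0 hq1.le w hxv hxu huv.symm hapex'
      · exact absurd rfl hfe'
  -- main case analysis
  by_cases he0 : ((w e : unitInterval) : ℝ) = 0
  · exact negCorr_of_weight_zero_left hq0 w f he0
  by_cases hf0 : ((w f : unitInterval) : ℝ) = 0
  · exact negCorr_of_weight_zero_right hq0 w e hf0
  rcases hw e he0 with heT | heab
  · rcases hw f hf0 with hfT | hfab
    · -- both in `T`
      have hex : x ∉ e := hx e heT
      have hfx : x ∉ f := hx f hfT
      by_cases heg : e = s(u, v)
      · subst heg
        exact negCorr_base_pair hq0 hq1.le w hxu hxv huv hapex hfx hfe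
          (edgeConnMono_of_negCorr_supp hq0 hq1 hNC huvT hfT (Function.update w0 s(u, v) 0) (supp_update_mem hsupp0 huvT 0))
      by_cases hfg : f = s(u, v)
      · subst hfg
        exact negCorr_symm w (negCorr_base_pair hq0 hq1.le w hxu hxv huv hapex hex (fun h => hfe h.symm)
          (edgeConnMono_of_negCorr_supp hq0 hq1 hNC huvT heT (Function.update w0 s(u, v) 0) (supp_update_mem hsupp0 huvT 0)))
      exact negCorr_off_apex hq0 hq1.le w hxu hxv huv hapex hex hfx heg hfg fun c =>
        hNC _ (supp_update_mem hsupp0 huvT c) e f hediag hfe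
    · -- `f` is an apex pair
      have hfab' : f = s(u, x) ∨ f = s(x, v) := by
        rcases hfab with h | h
        · exact Or.inl h
        · exact Or.inr h
      exact negCorr_symm w (apex_case f e hfab' (fun h => hfe h.symm) he0)
  · have heab' : e = s(u, x) ∨ e = s(x, v) := by
      rcases heab with h | h
      · exact Or.inl h
      · exact Or.inr h
    exact apex_case e f heab' hfe hf0

end FK

end Literature.Probability.LatticeModels.RandomClusterRayleigh

end Part10

/-!
## Part 11 — port of `Summits/CriticalPhenomena/PercolationContinuityZ3/Theorems/Transplant/FKConnectivityAllQTwoTree.lean` (4 declarations kept)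

# Connectivity correlation inequalities for `φ_{w,q}`, every `q > 0` — file 9e: NEGATIVE ASSOCIATION ON 2-TREE (SERIES–PARALLEL)
# SUPPORTS FOR `0 < q ≤ 1` (Wagner 2008, kernel proof) AND THE UNCONDITIONAL HUB INEQUALITY FOR `q < 1` ON THOSE SUPPORTS

Verbatim declaration-level port (the declarations listed in the Part header count) of a helper module of the
PercolationContinuityZ3 tree (FK sub-lane); route bookkeeping of the source docstring is not reproduced.

THE ARGUMENT (files `…ApexTools`, `…ApexMass`, `…ApexCases`, `…ApexStep`, `…TwoTree`).  Wagner (Ann. Comb. 2008, Ex. 5.1 +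
Thm. 5.8(d) + §5.3) proves that the random-cluster (Potts) model with `0 < q ≤ 1` is Rayleigh — edge-negatively associated,
`φ(J_e ∩ J_f) ≤ φ(J_e)φ(J_f)` (Grimmett 2006 §3.9 (3.94)) — on every series–parallel graph, by induction over two-sums.  We prove the
graph case by APEX ELIMINATION over 2-trees (whose subgraphs are exactly the series–parallel = `K₄`-minor-free graphs): a 2-tree
is `{uv}` or `T ∪ {ux, xv}` with `uv ∈ T` and `x` fresh; for a weight vector `w` supported in `T ∪ {ux, xv}` write `a = ux`,
`b = xv`, `g = uv`, `w° = w[a↦0][b↦0]` and `K' = {u ↔ v avoiding a, b}`.  Three exact identities for events `F` insensitive to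
`a, b` (file `…ApexMass`): `S_w(F) = ((1−p_a)+p_a q⁻¹)((1−p_b)+p_b q⁻¹)·S°(F) − p_a p_b q⁻¹(q⁻¹−1)·S°(F ∩ K')`,
`S_w(J_b ∩ F ∩ K') = p_b q⁻¹·S°(F ∩ K')`, `S_w(J_a ∩ J_b ∩ F) = p_a p_b (q⁻¹ S°(F) + (q⁻¹−1)q⁻¹ S°(F ∩ K'ᶜ))`.  With fk-2's
master identity (`negCorr_defect_eq`: `Cov(J_e, J_f) ≤ 0 ⟺` opening `f` does not lower `φ_{w[e↦0]}(x ↔ y)`, `e = xy`) every pair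
reduces to EC⁺ for `u ↔ v` one level down, i.e. to negative association on `T` (file `…ApexCases`): `(a, f)`:
`φ_{w[a↦0][f↦s]}(u ↔ x) = θ·φ_{w°[f↦s]}(u ↔ v)`; `(g, f)`: `φ_{w[g↦0][f↦s]}(u ↔ v)` is an increasing Möbius function of
`φ_{w°[g↦0][f↦s]}(u ↔ v)`; `(a, b)`, `(a, g)`: unconditional; and pairs `e, f ⊆ T ∖ g` are MARGINALISED (file `…ApexStep`):
`S_w(E) = α·S_{w°[g↦c]}(E)` for `E ∈ {J_e ∩ J_f, J_e, J_f, Ω}` with `α = (1−p_a)(1−p_b) + (p_a+p_b−p_ap_b)q⁻¹` and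
`α c = α p_g + (1−p_g)p_a p_b q⁻¹` (the path `u–x–v` is a pair `uv` in parallel with `g`).

RESULTS:
* **`FK.edgeNegCorrSupp_of_isTwoTree`** — for `0 < q ≤ 1` and every 2-tree `T`, every `φ_{w,q}` with `supp w ⊆ T` is
  edge-negatively associated.  This PROVES, on supports presented inside a 2-tree, the statement recorded as the named fact
  `Wagner2008_rc_edgeNegCorr_of_noK4Minor` (`Literature/Probability/LatticeModels/RandomClusterRayleighSeriesParallel.lean`;
  `rc_edgeNegCorr_of_isTwoTree` has that fact's shape with '`K₄`-minor-free' replaced by 'inside a 2-tree'); the purely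
  graph-theoretic identification 'simple `K₄`-minor-free graphs = subgraphs of 2-trees' (Dirac 1952, Duffin 1965, Wald–Colbourn
  1983) is not formalised here.
* **`FK.pairConnPosUnder_of_isTwoTree`, `FK.hubUnder_of_isTwoTree`** — for every `q ∈ (0,1)`: pairwise positive correlation of
  connection events, in particular Ayyer–Linusson–Ravichandran's hub inequality (13) `φ(o ↔ a)φ(b ↔ a) ≤ φ(o ↔ a ↔ b)`, for every
  weight vector supported in a 2-tree containing the two pairs — UNCONDITIONAL (`…AllQSeriesParallel` versions assume the
  named fact).  ALR (arXiv:2509.18788, §7) prove (13) for the arboreal gas on outerplanar graphs (Thm. 5.3) and state it as open in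
  general ('even for the arboreal gas'); as far as searched (corpus + galaxy + desk S133/S136) the `q < 1` random-cluster statement
  on all series–parallel supports is not in print as a theorem, though it follows from Wagner 2008 + the lane's reduction.
[cite: Wagner2006, Ex. 5.1, Thm. 5.8(d), §5.3] [cite: AyyerLinussonRavichandran2025, §7 eq. (13)–(15), Conj. 7.1, Thm. 5.3 (p. 22)]
[cite: Grimmett2006, §3.9 eq. (3.94) (pp. 63–64)]
-/

section Part11

namespace Literature.Probability.LatticeModels.RandomClusterRayleigh

namespace FK

open _root_.MeasureTheory _root_.Set Literature.Probability.LatticeModels Literature.Probability.Percolation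
open Literature.Probability.Percolation.DecisionTree (ind ind_of_mem ind_of_not_mem ind_nonneg)
open Literature.Probability.Percolation.TwoAvoidanceSets (ind_mul_ind)
open scoped _root_.Classical symmDiff

variable {V : Type*} [Fintype V]

/-! ### 2-trees (as edge sets) and negative association on a support -/

/-- **2-trees as edge sets**: the single pair `{uv}` (`u ≠ v`) is a 2-tree, and if `T` is a 2-tree containing the pair `uv`
and `x` is a vertex not covered by `T`, then `T ∪ {ux, xv}` is a 2-tree.  The subgraphs of 2-trees (partial 2-trees) are exactly
the finite simple graphs with no `K₄` minor, i.e. the series–parallel graphs (Wald–Colbourn 1983; Duffin 1965; Dirac 1952) —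
that identification is not formalised here. [cite: Wagner2006, §5.3] -/
inductive IsTwoTree : Set (Sym2 V) → Prop
  | pair {u v : V} (huv : u ≠ v) : IsTwoTree {s(u, v)}
  | cons {T : Set (Sym2 V)} {u v x : V} (hT : IsTwoTree T) (huv : s(u, v) ∈ T) (hx : ∀ e ∈ T, x ∉ e) :
      IsTwoTree (T ∪ {s(u, x), s(x, v)})

/-- **Edge-negative association of `φ_{w,q}` for every weight vector supported in the edge set `S`** (Grimmett 2006 §3.9 (3.94)
restricted to a support): `φ_w(J_e ∩ J_f) ≤ φ_w(J_e)·φ_w(J_f)` for all `w` with `{e | w e ≠ 0} ⊆ S`, all non-loop pairs `e` and all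
`f ≠ e` — the hypothesis shape of `pairConnPosUnder_of_edgeNegCorr_on`. [cite: Grimmett2006, §3.9 eq. (3.94) (p. 63)] -/
def EdgeNegCorrSupp (S : Set (Sym2 V)) (q : ℝ) : Prop :=
  ∀ w : Sym2 V → unitInterval, (∀ e, ((w e : unitInterval) : ℝ) ≠ 0 → e ∈ S) → ∀ e f : Sym2 V, ¬ e.IsDiag → f ≠ e →
    (rcMeasureW w q ∅).real ({ω | e ∈ ω} ∩ {ω | f ∈ ω}) ≤
      (rcMeasureW w q ∅).real {ω | e ∈ ω} * (rcMeasureW w q ∅).real {ω | f ∈ ω}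

omit [Fintype V] in
/-- 2-trees have no loops. [cite: Wagner2006, Ex. 5.1, Thm. 5.8(d), §5.3] -/
theorem IsTwoTree.not_isDiag {T : Set (Sym2 V)} (hT : IsTwoTree T) {e : Sym2 V} (he : e ∈ T) : ¬ e.IsDiag := by
  induction hT with
  | pair huv =>
    rw [Set.mem_singleton_iff] at he
    subst he
    rwa [Sym2.mk_isDiag_iff]
  | @cons T u v x hT' huvT hx ih =>
    rcases he with he | he
    · exact ih he
    · have hxu : x ≠ u := fun h => hx _ huvT (h ▸ Sym2.mem_mk_left u v)
      have hxv : x ≠ v := fun h => hx _ huvT (h ▸ Sym2.mem_mk_right u v)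
      rcases he with rfl | rfl
      · rw [Sym2.mk_isDiag_iff]; exact hxu.symm
      · rw [Sym2.mk_isDiag_iff]; exact hxv

/-! ### The theorem: negative association on 2-tree supports, and the unconditional hub inequality -/

/-- **Wagner's theorem (graph case) on 2-tree supports — kernel proof.**  For `0 < q ≤ 1` and every weight vector `w`
supported in a 2-tree `T`, the random-cluster measure `φ_{w,q}` is edge-negatively associated:
`φ(J_e ∩ J_f) ≤ φ(J_e)·φ(J_f)` for all non-loop `e` and all `f ≠ e`.  Proof by apex elimination (`edgeNegCorr_supp_apex_step`),
a vertex-level form of Wagner's two-sum induction (Ann. Comb. 2008, Thm. 5.8(d) with Ex. 5.1); `q = 1` is the product measure.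
Subgraphs of 2-trees are exactly the finite series–parallel (`K₄`-minor-free) graphs, so this proves the named fact
`Wagner2008_rc_edgeNegCorr_of_noK4Minor` on every support that is presented inside a 2-tree (the graph-theoretic identification
'no `K₄` minor ⟺ partial 2-tree' is not formalised). [cite: Wagner2006, Ex. 5.1, Thm. 5.8(d), §5.3]
[cite: Grimmett2006, §3.9 eq. (3.94) (pp. 63–64)] -/
theorem edgeNegCorrSupp_of_isTwoTree {q : ℝ} (hq0 : 0 < q) (hq1 : q ≤ 1) {T : Set (Sym2 V)} (hT : IsTwoTree T) :
    EdgeNegCorrSupp T q := by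
  rcases hq1.lt_or_eq with hlt | rfl
  · induction hT with
    | pair huv => exact edgeNegCorr_supp_pair hq0 _
    | cons hT' huvT hx ih => exact edgeNegCorr_supp_apex_step hq0 hlt (fun e he => hT'.not_isDiag he) huvT hx ih
  · intro w _ e f _ hfe
    exact negCorr_of_q_one w e f hfe

end FK

end Literature.Probability.LatticeModels.RandomClusterRayleigh

end Part11

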